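import Literature.Analysis.FluidPDE.WholeSpaceIBP
import Literature.Analysis.FluidPDE.NewtonKernel
import Literature.Analysis.FluidPDE.KNSSNoAxisymmetricTypeIHolds
import Literature.Analysis.FluidPDE.NSBoundedHigherRegularity
import Literature.Analysis.FluidPDE.SereginSverakOffAxisRegularity
import Literature.Analysis.FluidPDE.AxisymmetricSingularSetOnAxis
import Literature.Analysis.FluidPDE.SuitableWeakCongr
import Literature.Analysis.FluidPDE.LocalTypeI
import Literature.Analysis.FluidPDE.SuitableWeakProofs
import Literature.Analysis.FluidPDE.AxisymmetricEuler
import Literature.Analysis.FluidPDE.CKNTheoremB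
import Literature.Analysis.FluidPDE.SereginEpsilonRegularityHolds
import Literature.Analysis.FluidPDE.SuitableWeakInBallTools
import Literature.Analysis.FluidPDE.LocalTypeIScaling
import Literature.Analysis.FluidPDE.SereginSverakPressureDecayBalls
import Literature.Analysis.FluidPDE.SuitableWeakStability
import Literature.Analysis.FluidPDE.AxisymNoSwirlLocalMaxPrinciple
import Literature.Analysis.FluidPDE.AxisymGradientField
import Literature.Analysis.FluidPDE.LeiZhang2011ZoomIn
import Literature.Analysis.FluidPDE.NSBoundedHigherRegularityOfLemma61
import Literature.Analysis.FluidPDE.SereginEpsilonRegularityHigherHolds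
import Mathlib.MeasureTheory.Integral.IntervalIntegral.Basic
import Literature.Analysis.FluidPDE.CylinderTenThirds
import Literature.Analysis.FluidPDE.AxisymQuotientEquationsJ
import Literature.Analysis.FluidPDE.AxisymPoloidalMoments
import Literature.Analysis.FluidPDE.AxisymPoloidalCutoff
import Literature.Analysis.FluidPDE.SqIntegralBalance
import Literature.Analysis.FluidPDE.HouLiSpaceTime
import Literature.Analysis.FluidPDE.Wei2016PoloidalCurl
import Literature.Analysis.FluidPDE.CollapseDebris
import Mathlib.Analysis.FunctionalSpaces.SobolevInequality
import Literature.Analysis.Calculus.HardyLogarithmic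
import Literature.Analysis.Calculus.PlanarPolarIntegral
import Literature.Analysis.FluidPDE.Seregin2022LogSwirlOriginLocalClass
import HarnessLib

/-!
# Seregin 2022 local regularity of axisymmetric solutions, file 5 of 6: time moduli of the local families, the local key estimate, bridges to the cut-off globalisation, the Seregin 2020 representatives, the clean slab, the hypothesis block under transport, parabolic null lines, partial regularity up to the top time (re-homed proofs)

**G. Seregin, *A note on local regularity of axisymmetric solutions to the Navier–Stokes equations*, J. Math. Fluid Mech. 24
(2022), Paper 27 = arXiv:2201.00153, Theorem 1.2 via §2 from the swirl decay (2.2) [Seregin2022LocalAxisym]: for a suitable weak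
solution in the unit parabolic cylinder `Q = 𝒞 × ]-1,0[`, axisymmetric, with `v ∈ L_{2,∞}(Q)`, `∇v ∈ L₂(Q)`, `q ∈ L_{3/2}(Q)` and
`|v_θ(x,t)| ≤ C₁ |x'|⁻¹ / ln³(e/|x'|)` off the axis, the origin is a regular point.**  The named fact
`Literature.Analysis.FluidPDE.seregin2022_logSwirl_regularAtOrigin` (`Seregin2022LogSwirlCriterion.lean`) is PROVED in the tree by
the Navier–Stokes cell's `AxisymmetricKatoGlobal` line (Steps 1–4 of §2: reduction to a first singular time and a clean slab with a
smooth axisymmetric representative, the product cut-off, the Leray logarithmic Hardy inequality (Lemma 2.2), Lemma 2.1 and the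
Chen–Fang–Zhang / Lei–Zhang elliptic bounds for `u_r/r`, the `η⁶`-weighted energy estimates of `Γ = ω_θ/r` and `Φ = ω_r/r` with
the swirl source absorbed through (2.2), the key estimate, the Step-4 assembly `C(R) ≤ C R^{3/2} → 0` and ε-regularity) — until now
Summits-side only (`Summits/NavierStokesRegularity/NavierStokesRegularity/Theorems/AxisymmetricExtremalityAxisymmetricKatoGlobalStubSereginLogSwirlOrigin.lean`,
`seregin2022_logSwirl_regularAtOrigin_holds := stub_sereginLogSwirlOrigin`).  RE-HOMED into `Literature/` by the Hodge foundations
lane (`lit-hodgefound`, prover p20, generation 39) as SIX files: verbatim DECLARATION-LEVEL ports (the 312 declarations the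
discharge needs, in dependency order; each Part header lists the declarations of its source module that are NOT carried) of 55
Summits modules `Summits/NavierStokesRegularity/NavierStokesRegularity/Theorems/AxisymmetricExtremalityAxisymmetricKatoGlobalStub*.lean`,
namespaces `Summit.NavierStokesRegularity.NavierStokesRegularity.Theorems.AxisymmetricKatoGlobal{.EulerScaling,.Registered}` re-rooted
to `Literature.Analysis.SereginLogSwirlOrigin{.EulerScaling,.Registered}` (a root outside `Literature.Analysis.FluidPDE` on purpose:
namespace-prefix resolution would otherwise shadow the cone's lemmas by same-named `FluidPDE` lemmas); the sources' `local notation`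
`ℝ³` is expanded textually; imports from `Literature/` and Mathlib only; no `sorry`, no new axiom, NO named fact (D-0026).
PROVENANCE CONVENTION: docstrings are carried byte-for-byte; declarations the cell cites keep their cites; `[folklore]`-tagged and
untagged declarations (the cell's own lemmas) carry the Part's tag `[cite: <Key>, <loc> (source of the ARGUMENT this module
implements; this declaration is the cell's own lemma or plumbing, NOT a printed statement)]`, because the gate does not admit a
public Literature theorem without a cite tag.

THIS FILE (5 of 6) ports: …StubSereginLogSwirlOriginStep3LocalFamiliesW, …StubSereginLogSwirlOriginStep3LocalKeyEstimate, …StubSereginLogSwirlOriginCoreAtOriginBridges, …StubSeregin2020TypeIIOffAxisRepr, …StubSeregin2020TypeIINoSwirlRegularRepr, …StubSereginLogSwirlOriginCleanSlabRepr, …StubSereginLogSwirlOriginCoreNormaliseTransport, …StubSereginLogSwirlOriginParabolicNullLines, …StubSeregin2020TypeIINoSwirlFirstSingular, …StubSereginLogSwirlOriginTopTimePartialRegularity.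
-/

noncomputable section

/-!
## Part 1 — port of `Summits/NavierStokesRegularity/NavierStokesRegularity/Theorems/AxisymmetricExtremalityAxisymmetricKatoGlobalStubSereginLogSwirlOriginStep3LocalFamiliesW.lean` (9 declarations kept)

# Seregin 2022, §2 Step 3 for the LOCAL smooth class (IX): uniform-in-`x` time moduli of the
# vorticity right-hand side `W = νΔω − Dω[u] + Du[ω]` of a family of smooth fields —
# crux stmt-NavierStokesRegularity-15453 (`AxisymmetricExtremality.AxisymmetricKatoGlobal`), line registered, support for stub `stub_sereginLogSwirlOrigin`

Support file (`--supports stmt-NavierStokesRegularity-15453`; theorems only, everything proved)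
toward the registered stub `stub_sereginLogSwirlOrigin` = the named fact
`Literature.Analysis.FluidPDE.seregin2022_logSwirl_regularAtOrigin` (G. Seregin, J. Math. Fluid
Mech. 24 (2022), Paper 27 = arXiv:2201.00153, §2), sequel of `…Step3LocalFamilies`. In the port
of Step 3 to the local Seregin–Zajaczkowski class the time derivatives of `Γ = ω_θ/r`,
`Φ = ω_r/r` are the quotients `angVelQuot W`, `radVelQuot W` of the vorticity right-hand side
`W = νΔω − Dω[u] + Du[ω]` (`…Step3LocalEquations(Phi)`), and the key estimate
(`cutoff_energy_keyEstimate_local_unconditional`) needs their joint continuity on the slab. By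
`continuousOn_radQuot_family` this follows from uniform-in-`x` time moduli of the `x`-derivatives
of `swirl W`, `⟪x_h, W⟫`; this file derives the moduli of `W` itself from those of `u` (all
orders) for a family with smooth slices supported in a fixed ball:

* `unifTime_fderiv`, `unifTime_add`, `unifTime_sub`, `unifTime_const_smul` — the moduli pass
  to the gradient family and through linear combinations;
* `norm_iteratedFDeriv_laplacian_le`, `unifTime_laplacian` — `‖Dᵏ Δφ‖ ≤ 3‖Dᵏ⁺²φ‖`
  (`Δφ = Σᵢ ∂ᵢ∂ᵢφ`, `norm_iteratedFDeriv_clm_apply_fderiv_le` twice) and the moduli of `Δu`;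
* `fderiv_eq_zero_of_forall_norm_gt`, `curl_eq_zero_of_forall_norm_gt` — support bookkeeping;
* `unifTime_vorticityRHS` (registered sub-goal) — **the moduli of `W(t) = νΔ(curl u t) −
  D(curl u t)[u t] + D(u t)[curl u t]`**, all orders (`unifTime_curl`, `unifTime_laplacian`,
  `unifTime_bilinear` with the evaluation pairing for the two products).

## Mathlib / tree search

Tree: `unifTime_curl`, `unifTime_bilinear`, `unifTime_mono_order` (`…Step3LocalFamilies`),
`norm_iteratedFDeriv_clm_apply_fderiv_le`, `natCast_le_contDiff_infty` (`KNSSThm52Assembly`),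
`laplacian_eq_sum_fderiv_fderiv` (`WholeSpaceIBP`), `contDiff_laplacian` (`NewtonKernel`).
Mathlib: `iteratedFDeriv_fun_sum_apply`, `iteratedFDeriv_add_apply`, `iteratedFDeriv_const_smul_apply`,
`norm_iteratedFDeriv_fderiv`, `ContDiffAt.laplacian_sub`, `laplacian_const`,
`Filter.EventuallyEq.fderiv_eq`. `lean search 'unifTime_vorticityRHS|unifTime_laplacian' --decl`:
no matches (2026-08-17).

## References

* G. Seregin, J. Math. Fluid Mech. 24 (2022), Paper No. 27 = arXiv:2201.00153, §2 Step 3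
  (arXiv pp. 6–7). [`Seregin2022LocalAxisym`]
-/

section Part1

open _root_.MeasureTheory _root_.Set _root_.Filter _root_.Topology _root_.Function _root_.Metric
open scoped _root_.ContDiff RealInnerProductSpace Laplacian
open Literature.Analysis.FluidPDE

namespace Literature.Analysis.SereginLogSwirlOrigin.EulerScaling

section Linear

variable {S : Set ℝ} {F : Type*} [NormedAddCommGroup F] [NormedSpace ℝ F]

/-- **The moduli pass to the gradient family** (`‖Dᵏ(Df)‖ = ‖Dᵏ⁺¹f‖`). [folklore]
[cite: Seregin2022LocalAxisym, §2 proof of Thm. 1.2, Step 3 (arXiv:2201.00153 pp. 4–7) (source of the ARGUMENT this module implements; this declaration is the cell’s own lemma or plumbing, NOT a printed statement)] -/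
theorem unifTime_fderiv {u : ℝ → EuclideanSpace ℝ (Fin 3) → F} (hu : ∀ t ∈ S, ContDiff ℝ ∞ (u t))
    (hU : ∀ k : ℕ, ∀ t ∈ S, ∀ ε > 0, ∃ δ > 0, ∀ t' ∈ S, |t' - t| < δ → ∀ y,
      ‖iteratedFDeriv ℝ k (u t') y - iteratedFDeriv ℝ k (u t) y‖ ≤ ε) :
    ∀ k : ℕ, ∀ t ∈ S, ∀ ε > 0, ∃ δ > 0, ∀ t' ∈ S, |t' - t| < δ → ∀ y,
      ‖iteratedFDeriv ℝ k (fderiv ℝ (u t')) y - iteratedFDeriv ℝ k (fderiv ℝ (u t)) y‖ ≤ ε := by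
  intro k t ht ε hε
  obtain ⟨δ, hδ, h⟩ := hU (k + 1) t ht ε hε
  refine ⟨δ, hδ, fun t' ht' hlt y => ?_⟩
  have hsubf : fderiv ℝ (u t') - fderiv ℝ (u t) = fderiv ℝ (u t' - u t) := by
    funext z
    rw [Pi.sub_apply, fderiv_sub (((hu t' ht').differentiable (by simp)) z) (((hu t ht).differentiable (by simp)) z)]
  have hD : ∀ s ∈ S, ContDiff ℝ k (fderiv ℝ (u s)) := fun s hs =>
    (hu s hs).fderiv_right (m := k) (by exact_mod_cast le_top)
  rw [← iteratedFDeriv_sub_apply (hD t' ht').contDiffAt (hD t ht).contDiffAt, hsubf,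
    norm_iteratedFDeriv_fderiv, iteratedFDeriv_sub_apply ((hu t' ht').of_le (natCast_le_contDiff_infty _)).contDiffAt
      ((hu t ht).of_le (natCast_le_contDiff_infty _)).contDiffAt]
  exact h t' ht' hlt y

/-- Moduli of a sum of two families. [folklore]
[cite: Seregin2022LocalAxisym, §2 proof of Thm. 1.2, Step 3 (arXiv:2201.00153 pp. 4–7) (source of the ARGUMENT this module implements; this declaration is the cell’s own lemma or plumbing, NOT a printed statement)] -/
theorem unifTime_add {f g : ℝ → EuclideanSpace ℝ (Fin 3) → F} (hf : ∀ t ∈ S, ContDiff ℝ ∞ (f t))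
    (hg : ∀ t ∈ S, ContDiff ℝ ∞ (g t))
    (hUf : ∀ k : ℕ, ∀ t ∈ S, ∀ ε > 0, ∃ δ > 0, ∀ t' ∈ S, |t' - t| < δ → ∀ y,
      ‖iteratedFDeriv ℝ k (f t') y - iteratedFDeriv ℝ k (f t) y‖ ≤ ε)
    (hUg : ∀ k : ℕ, ∀ t ∈ S, ∀ ε > 0, ∃ δ > 0, ∀ t' ∈ S, |t' - t| < δ → ∀ y,
      ‖iteratedFDeriv ℝ k (g t') y - iteratedFDeriv ℝ k (g t) y‖ ≤ ε) :
    ∀ k : ℕ, ∀ t ∈ S, ∀ ε > 0, ∃ δ > 0, ∀ t' ∈ S, |t' - t| < δ → ∀ y,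
      ‖iteratedFDeriv ℝ k (fun y => f t' y + g t' y) y - iteratedFDeriv ℝ k (fun y => f t y + g t y) y‖ ≤ ε := by
  intro k t ht ε hε
  obtain ⟨δ₁, hδ₁, h₁⟩ := hUf k t ht (ε / 2) (half_pos hε)
  obtain ⟨δ₂, hδ₂, h₂⟩ := hUg k t ht (ε / 2) (half_pos hε)
  refine ⟨min δ₁ δ₂, lt_min hδ₁ hδ₂, fun t' ht' hlt y => ?_⟩
  have hc : ∀ s ∈ S, ∀ {φ : ℝ → EuclideanSpace ℝ (Fin 3) → F}, (∀ t ∈ S, ContDiff ℝ ∞ (φ t)) →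
      ContDiffAt ℝ k (φ s) y := fun s hs φ hφ => ((hφ s hs).of_le (natCast_le_contDiff_infty _)).contDiffAt
  rw [show (fun y => f t' y + g t' y) = f t' + g t' from rfl, show (fun y => f t y + g t y) = f t + g t from rfl,
    iteratedFDeriv_add_apply (hc t' ht' hf) (hc t' ht' hg), iteratedFDeriv_add_apply (hc t ht hf) (hc t ht hg)]
  calc ‖iteratedFDeriv ℝ k (f t') y + iteratedFDeriv ℝ k (g t') y - (iteratedFDeriv ℝ k (f t) y + iteratedFDeriv ℝ k (g t) y)‖
      = ‖(iteratedFDeriv ℝ k (f t') y - iteratedFDeriv ℝ k (f t) y) + (iteratedFDeriv ℝ k (g t') y - iteratedFDeriv ℝ k (g t) y)‖ := by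
        congr 1; abel
    _ ≤ ε / 2 + ε / 2 := (norm_add_le _ _).trans (add_le_add (h₁ t' ht' (hlt.trans_le (min_le_left _ _)) y)
        (h₂ t' ht' (hlt.trans_le (min_le_right _ _)) y))
    _ = ε := add_halves ε

/-- Moduli of a scalar multiple of a family. [folklore]
[cite: Seregin2022LocalAxisym, §2 proof of Thm. 1.2, Step 3 (arXiv:2201.00153 pp. 4–7) (source of the ARGUMENT this module implements; this declaration is the cell’s own lemma or plumbing, NOT a printed statement)] -/
theorem unifTime_const_smul {f : ℝ → EuclideanSpace ℝ (Fin 3) → F} (hf : ∀ t ∈ S, ContDiff ℝ ∞ (f t))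
    (hUf : ∀ k : ℕ, ∀ t ∈ S, ∀ ε > 0, ∃ δ > 0, ∀ t' ∈ S, |t' - t| < δ → ∀ y,
      ‖iteratedFDeriv ℝ k (f t') y - iteratedFDeriv ℝ k (f t) y‖ ≤ ε) (c : ℝ) :
    ∀ k : ℕ, ∀ t ∈ S, ∀ ε > 0, ∃ δ > 0, ∀ t' ∈ S, |t' - t| < δ → ∀ y,
      ‖iteratedFDeriv ℝ k (fun y => c • f t' y) y - iteratedFDeriv ℝ k (fun y => c • f t y) y‖ ≤ ε := by
  intro k t ht ε hε
  obtain ⟨δ, hδ, h⟩ := hUf k t ht (ε / (|c| + 1)) (by positivity)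
  refine ⟨δ, hδ, fun t' ht' hlt y => ?_⟩
  have hc : ∀ s ∈ S, ContDiffAt ℝ k (f s) y := fun s hs => ((hf s hs).of_le (natCast_le_contDiff_infty _)).contDiffAt
  rw [show (fun y => c • f t' y) = c • f t' from rfl, show (fun y => c • f t y) = c • f t from rfl,
    iteratedFDeriv_const_smul_apply (hc t' ht'), iteratedFDeriv_const_smul_apply (hc t ht), ← smul_sub,
    norm_smul, Real.norm_eq_abs]
  calc |c| * ‖iteratedFDeriv ℝ k (f t') y - iteratedFDeriv ℝ k (f t) y‖ ≤ |c| * (ε / (|c| + 1)) :=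
        mul_le_mul_of_nonneg_left (h t' ht' hlt y) (abs_nonneg c)
    _ ≤ ε := by rw [mul_div_assoc', div_le_iff₀ (by positivity)]; nlinarith [abs_nonneg c]

/-- Moduli of a difference of two families. [folklore]
[cite: Seregin2022LocalAxisym, §2 proof of Thm. 1.2, Step 3 (arXiv:2201.00153 pp. 4–7) (source of the ARGUMENT this module implements; this declaration is the cell’s own lemma or plumbing, NOT a printed statement)] -/
theorem unifTime_sub {f g : ℝ → EuclideanSpace ℝ (Fin 3) → F} (hf : ∀ t ∈ S, ContDiff ℝ ∞ (f t))
    (hg : ∀ t ∈ S, ContDiff ℝ ∞ (g t))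
    (hUf : ∀ k : ℕ, ∀ t ∈ S, ∀ ε > 0, ∃ δ > 0, ∀ t' ∈ S, |t' - t| < δ → ∀ y,
      ‖iteratedFDeriv ℝ k (f t') y - iteratedFDeriv ℝ k (f t) y‖ ≤ ε)
    (hUg : ∀ k : ℕ, ∀ t ∈ S, ∀ ε > 0, ∃ δ > 0, ∀ t' ∈ S, |t' - t| < δ → ∀ y,
      ‖iteratedFDeriv ℝ k (g t') y - iteratedFDeriv ℝ k (g t) y‖ ≤ ε) :
    ∀ k : ℕ, ∀ t ∈ S, ∀ ε > 0, ∃ δ > 0, ∀ t' ∈ S, |t' - t| < δ → ∀ y,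
      ‖iteratedFDeriv ℝ k (fun y => f t' y - g t' y) y - iteratedFDeriv ℝ k (fun y => f t y - g t y) y‖ ≤ ε := by
  intro k t ht ε hε
  obtain ⟨δ₁, hδ₁, h₁⟩ := hUf k t ht (ε / 2) (half_pos hε)
  obtain ⟨δ₂, hδ₂, h₂⟩ := hUg k t ht (ε / 2) (half_pos hε)
  refine ⟨min δ₁ δ₂, lt_min hδ₁ hδ₂, fun t' ht' hlt y => ?_⟩
  have hc : ∀ s ∈ S, ∀ {φ : ℝ → EuclideanSpace ℝ (Fin 3) → F}, (∀ t ∈ S, ContDiff ℝ ∞ (φ t)) →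
      ContDiffAt ℝ k (φ s) y := fun s hs φ hφ => ((hφ s hs).of_le (natCast_le_contDiff_infty _)).contDiffAt
  rw [show (fun y => f t' y - g t' y) = f t' - g t' from rfl, show (fun y => f t y - g t y) = f t - g t from rfl,
    iteratedFDeriv_sub_apply (hc t' ht' hf) (hc t' ht' hg), iteratedFDeriv_sub_apply (hc t ht hf) (hc t ht hg)]
  calc ‖iteratedFDeriv ℝ k (f t') y - iteratedFDeriv ℝ k (g t') y - (iteratedFDeriv ℝ k (f t) y - iteratedFDeriv ℝ k (g t) y)‖
      = ‖(iteratedFDeriv ℝ k (f t') y - iteratedFDeriv ℝ k (f t) y) - (iteratedFDeriv ℝ k (g t') y - iteratedFDeriv ℝ k (g t) y)‖ := by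
        congr 1; abel
    _ ≤ ε / 2 + ε / 2 := (norm_sub_le _ _).trans (add_le_add (h₁ t' ht' (hlt.trans_le (min_le_left _ _)) y)
        (h₂ t' ht' (hlt.trans_le (min_le_right _ _)) y))
    _ = ε := add_halves ε

end Linear

section Laplace

variable {S : Set ℝ}

/-- **`‖Dᵏ Δφ‖ ≤ 3 ‖Dᵏ⁺² φ‖`** for smooth vector fields on `ℝ³`: `Δφ = Σᵢ ∂ᵢ∂ᵢφ` and
`‖Dᵏ(Λ ∘ Dψ)‖ ≤ ‖Λ‖‖Dᵏ⁺¹ψ‖` twice with the evaluations `Λ = ev_{eᵢ}`. [folklore]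
[cite: Seregin2022LocalAxisym, §2 proof of Thm. 1.2, Step 3 (arXiv:2201.00153 pp. 4–7) (source of the ARGUMENT this module implements; this declaration is the cell’s own lemma or plumbing, NOT a printed statement)] -/
theorem norm_iteratedFDeriv_laplacian_le {φ : EuclideanSpace ℝ (Fin 3) → EuclideanSpace ℝ (Fin 3)} (hφ : ContDiff ℝ ∞ φ)
    (k : ℕ) (y : EuclideanSpace ℝ (Fin 3)) :
    ‖iteratedFDeriv ℝ k (Δ φ) y‖ ≤ 3 * ‖iteratedFDeriv ℝ (k + 2) φ y‖ := by
  have hφ2 : ContDiff ℝ 2 φ := hφ.of_le (by norm_cast)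
  have hrep : Δ φ = fun x => ∑ i, fderiv ℝ (fun z => fderiv ℝ φ z (stdOrthonormalBasis ℝ (EuclideanSpace ℝ (Fin 3)) i)) x
      (stdOrthonormalBasis ℝ (EuclideanSpace ℝ (Fin 3)) i) :=
    funext fun x => laplacian_eq_sum_fderiv_fderiv _ hφ2 x
  have hψ : ∀ i, ContDiff ℝ ∞ fun z => fderiv ℝ φ z (stdOrthonormalBasis ℝ (EuclideanSpace ℝ (Fin 3)) i) :=
    fun i => contDiff_infty_fderiv_apply hφ _
  have hg : ∀ i, ContDiff ℝ ∞ fun x => fderiv ℝ (fun z => fderiv ℝ φ z (stdOrthonormalBasis ℝ (EuclideanSpace ℝ (Fin 3)) i)) x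
      (stdOrthonormalBasis ℝ (EuclideanSpace ℝ (Fin 3)) i) := fun i => contDiff_infty_fderiv_apply (hψ i) _
  have hbi : ∀ i, ‖stdOrthonormalBasis ℝ (EuclideanSpace ℝ (Fin 3)) i‖ = 1 := fun i =>
    (stdOrthonormalBasis ℝ (EuclideanSpace ℝ (Fin 3))).orthonormal.1 i
  have hΛ : ∀ i, ‖ContinuousLinearMap.apply ℝ (EuclideanSpace ℝ (Fin 3)) (stdOrthonormalBasis ℝ (EuclideanSpace ℝ (Fin 3)) i)‖ ≤ 1 := fun i => by
    refine ContinuousLinearMap.opNorm_le_bound _ zero_le_one fun L => ?_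
    rw [ContinuousLinearMap.apply_apply, one_mul]
    simpa [hbi i] using L.le_opNorm (stdOrthonormalBasis ℝ (EuclideanSpace ℝ (Fin 3)) i)
  have hterm : ∀ i, ‖iteratedFDeriv ℝ k (fun x => fderiv ℝ (fun z => fderiv ℝ φ z (stdOrthonormalBasis ℝ (EuclideanSpace ℝ (Fin 3)) i)) x
      (stdOrthonormalBasis ℝ (EuclideanSpace ℝ (Fin 3)) i)) y‖ ≤ ‖iteratedFDeriv ℝ (k + 2) φ y‖ := by
    intro i
    have h1 := norm_iteratedFDeriv_clm_apply_fderiv_le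
      (ContinuousLinearMap.apply ℝ (EuclideanSpace ℝ (Fin 3)) (stdOrthonormalBasis ℝ (EuclideanSpace ℝ (Fin 3)) i)) (hψ i) k y
    have h2 := norm_iteratedFDeriv_clm_apply_fderiv_le
      (ContinuousLinearMap.apply ℝ (EuclideanSpace ℝ (Fin 3)) (stdOrthonormalBasis ℝ (EuclideanSpace ℝ (Fin 3)) i)) hφ (k + 1) y
    simp only [ContinuousLinearMap.apply_apply] at h1 h2
    have n0 : 0 ≤ ‖iteratedFDeriv ℝ (k + 1 + 1) φ y‖ := norm_nonneg _
    calc _ ≤ _ := h1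
      _ ≤ 1 * (1 * ‖iteratedFDeriv ℝ (k + 1 + 1) φ y‖) :=
          mul_le_mul (hΛ i) (h2.trans (mul_le_mul_of_nonneg_right (hΛ i) n0)) (norm_nonneg _) zero_le_one
      _ = ‖iteratedFDeriv ℝ (k + 2) φ y‖ := by ring_nf
  rw [hrep, iteratedFDeriv_fun_sum_apply fun i _ => ((hg i).of_le (natCast_le_contDiff_infty _)).contDiffAt]
  refine (norm_sum_le _ _).trans ((Finset.sum_le_sum fun i _ => hterm i).trans ?_)
  rw [Finset.sum_const, Finset.card_univ, Fintype.card_fin, finrank_euclideanSpace_fin, nsmul_eq_mul]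
  norm_num

/-- **The moduli pass to the Laplacian family.** [folklore]
[cite: Seregin2022LocalAxisym, §2 proof of Thm. 1.2, Step 3 (arXiv:2201.00153 pp. 4–7) (source of the ARGUMENT this module implements; this declaration is the cell’s own lemma or plumbing, NOT a printed statement)] -/
theorem unifTime_laplacian {u : ℝ → EuclideanSpace ℝ (Fin 3) → EuclideanSpace ℝ (Fin 3)}
    (hu : ∀ t ∈ S, ContDiff ℝ ∞ (u t))
    (hU : ∀ k : ℕ, ∀ t ∈ S, ∀ ε > 0, ∃ δ > 0, ∀ t' ∈ S, |t' - t| < δ → ∀ y,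
      ‖iteratedFDeriv ℝ k (u t') y - iteratedFDeriv ℝ k (u t) y‖ ≤ ε) :
    ∀ k : ℕ, ∀ t ∈ S, ∀ ε > 0, ∃ δ > 0, ∀ t' ∈ S, |t' - t| < δ → ∀ y,
      ‖iteratedFDeriv ℝ k (Δ (u t')) y - iteratedFDeriv ℝ k (Δ (u t)) y‖ ≤ ε := by
  intro k t ht ε hε
  obtain ⟨δ, hδ, h⟩ := hU (k + 2) t ht (ε / 3) (by positivity)
  refine ⟨δ, hδ, fun t' ht' hlt y => ?_⟩
  have hd : ContDiff ℝ ∞ (u t' - u t) := (hu t' ht').sub (hu t ht)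
  have hΔsub : Δ (u t') - Δ (u t) = Δ (u t' - u t) := by
    funext z
    exact (ContDiffAt.laplacian_sub ((hu t' ht').of_le (by norm_cast)).contDiffAt
      ((hu t ht).of_le (by norm_cast)).contDiffAt).symm
  have hΔ : ∀ s ∈ S, ContDiff ℝ k (Δ (u s)) := fun s hs =>
    (contDiff_laplacian (n := ⊤) (by exact_mod_cast hu s hs)).of_le (by exact_mod_cast le_top)
  rw [← iteratedFDeriv_sub_apply (hΔ t' ht').contDiffAt (hΔ t ht).contDiffAt, hΔsub]
  refine (norm_iteratedFDeriv_laplacian_le hd k y).trans ?_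
  rw [iteratedFDeriv_sub_apply ((hu t' ht').of_le (natCast_le_contDiff_infty _)).contDiffAt
    ((hu t ht).of_le (natCast_le_contDiff_infty _)).contDiffAt]
  linarith [h t' ht' hlt y]

end Laplace

section Support

variable {F : Type*} [NormedAddCommGroup F] [NormedSpace ℝ F]

/-- A field vanishing off a ball has vanishing gradient there. [folklore]
[cite: Seregin2022LocalAxisym, §2 proof of Thm. 1.2, Step 3 (arXiv:2201.00153 pp. 4–7) (source of the ARGUMENT this module implements; this declaration is the cell’s own lemma or plumbing, NOT a printed statement)] -/
theorem fderiv_eq_zero_of_forall_norm_gt {f : EuclideanSpace ℝ (Fin 3) → F} {R : ℝ}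
    (h : ∀ y, R < ‖y‖ → f y = 0) {y : EuclideanSpace ℝ (Fin 3)} (hy : R < ‖y‖) : fderiv ℝ f y = 0 := by
  have hev : f =ᶠ[𝓝 y] fun _ => (0 : F) := by
    filter_upwards [(isOpen_lt continuous_const continuous_norm).mem_nhds hy] with z hz using h z hz
  rw [hev.fderiv_eq, fderiv_const_apply]

/-- A field vanishing off a ball has vanishing curl there. [folklore]
[cite: Seregin2022LocalAxisym, §2 proof of Thm. 1.2, Step 3 (arXiv:2201.00153 pp. 4–7) (source of the ARGUMENT this module implements; this declaration is the cell’s own lemma or plumbing, NOT a printed statement)] -/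
theorem curl_eq_zero_of_forall_norm_gt {f : EuclideanSpace ℝ (Fin 3) → EuclideanSpace ℝ (Fin 3)} {R : ℝ}
    (h : ∀ y, R < ‖y‖ → f y = 0) {y : EuclideanSpace ℝ (Fin 3)} (hy : R < ‖y‖) : curl f y = 0 := by
  show curlCLM (fderiv ℝ f y) = 0
  rw [fderiv_eq_zero_of_forall_norm_gt h hy, map_zero]

end Support

section RHS

variable {S : Set ℝ}

/-- **Uniform-in-`x` time moduli of the vorticity right-hand side
`W(t) = νΔ(curl u t) − D(curl u t)[u t] + D(u t)[curl u t]`** of a family `u` with smooth slices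
supported in a fixed ball `B̄(0, R)` and moduli of all `x`-derivatives on `S`: for every order `k`,
`‖DᵏW(t', y) − DᵏW(t, y)‖ ≤ ε` for `|t' − t| < δ`, all `y`. (`unifTime_curl`, `unifTime_laplacian`,
and `unifTime_bilinear` with the evaluation pairing `(L, v) ↦ L v` for `Dω[u]`, `Du[ω]`.) This is
the time regularity of `∂ₜω` available for the cut-off globalisation `χV` of the
Seregin–Zajaczkowski representative; with `continuousOn_radQuot_family` it yields the joint
continuity of `∂ₜΓ = angVelQuot W`, `∂ₜΦ = radVelQuot W` required by the local key estimate.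
Registered sub-goal toward `stub_sereginLogSwirlOrigin`. [folklore]
[cite: Seregin2022LocalAxisym, §2 proof of Thm. 1.2, Step 3 (arXiv:2201.00153 pp. 4–7) (source of the ARGUMENT this module implements; this declaration is the cell’s own lemma or plumbing, NOT a printed statement)] -/
theorem unifTime_vorticityRHS : ∀ (S : Set ℝ) (u : ℝ → EuclideanSpace ℝ (Fin 3) → EuclideanSpace ℝ (Fin 3)) (ν R : ℝ), (∀ t ∈ S, ContDiff ℝ (⊤ : ℕ∞) (u t)) → (∀ t ∈ S, ∀ y, R < ‖y‖ → u t y = 0) → (∀ k : ℕ, ∀ t ∈ S, ∀ ε > 0, ∃ δ > 0, ∀ t' ∈ S, |t' - t| < δ → ∀ y, ‖iteratedFDeriv ℝ k (u t') y - iteratedFDeriv ℝ k (u t) y‖ ≤ ε) → ∀ k : ℕ, ∀ t ∈ S, ∀ ε > 0, ∃ δ > 0, ∀ t' ∈ S, |t' - t| < δ → ∀ y, ‖iteratedFDeriv ℝ k (fun y => ν • (Δ (curl (u t'))) y - fderiv ℝ (curl (u t')) y (u t' y) + fderiv ℝ (u t') y (curl (u t') y)) y - iteratedFDeriv ℝ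 k (fun y => ν • (Δ (curl (u t))) y - fderiv ℝ (curl (u t)) y (u t y) + fderiv ℝ (u t) y (curl (u t) y)) y‖ ≤ ε := by
  intro S u ν R hu hR hU
  have hω : ∀ t ∈ S, ContDiff ℝ ∞ (curl (u t)) := fun t ht => contDiff_curl (n := ⊤) (by exact_mod_cast hu t ht)
  have hΔω : ∀ t ∈ S, ContDiff ℝ ∞ (Δ (curl (u t))) := fun t ht =>
    contDiff_laplacian (n := ⊤) (by exact_mod_cast hω t ht)
  have hDω : ∀ t ∈ S, ContDiff ℝ ∞ (fderiv ℝ (curl (u t))) := fun t ht => (hω t ht).fderiv_right (m := ∞) (by simp)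
  have hDu : ∀ t ∈ S, ContDiff ℝ ∞ (fderiv ℝ (u t)) := fun t ht => (hu t ht).fderiv_right (m := ∞) (by simp)
  have hωR : ∀ t ∈ S, ∀ y, R < ‖y‖ → curl (u t) y = 0 := fun t ht y hy => curl_eq_zero_of_forall_norm_gt (hR t ht) hy
  -- moduli of `ω`, `Δω`, `Dω`, `Du`
  have hUω := unifTime_curl hu hU
  have hUΔ := unifTime_laplacian hω hUω
  have hUDω := unifTime_fderiv hω hUω
  have hUDu := unifTime_fderiv hu hU
  -- the two products via the evaluation pairing
  set B : (EuclideanSpace ℝ (Fin 3) →L[ℝ] EuclideanSpace ℝ (Fin 3)) →L[ℝ]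
      EuclideanSpace ℝ (Fin 3) →L[ℝ] EuclideanSpace ℝ (Fin 3) := ContinuousLinearMap.id ℝ _ with hB
  have hP := unifTime_bilinear (S := S) B (f := fun t y => fderiv ℝ (curl (u t)) y) (g := u) hDω hu hR hUDω hU
  have hQ := unifTime_bilinear (S := S) B (f := fun t y => fderiv ℝ (u t) y) (g := fun t y => curl (u t) y)
    hDu hω hωR hUDu hUω
  simp only [hB, ContinuousLinearMap.id_apply] at hP hQ
  -- assemble `ν • Δω − P + Q`
  have hA : ∀ t ∈ S, ContDiff ℝ ∞ fun y => ν • (Δ (curl (u t))) y := fun t ht => (hΔω t ht).const_smul ν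
  have hPs : ∀ t ∈ S, ContDiff ℝ ∞ fun y => fderiv ℝ (curl (u t)) y (u t y) := fun t ht => (hDω t ht).clm_apply (hu t ht)
  have hQs : ∀ t ∈ S, ContDiff ℝ ∞ fun y => fderiv ℝ (u t) y (curl (u t) y) := fun t ht => (hDu t ht).clm_apply (hω t ht)
  have hUA := unifTime_const_smul (S := S) hΔω hUΔ ν
  have h1 := unifTime_sub hA hPs hUA hP
  have hAP : ∀ t ∈ S, ContDiff ℝ ∞ fun y => ν • (Δ (curl (u t))) y - fderiv ℝ (curl (u t)) y (u t y) :=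
    fun t ht => (hA t ht).sub (hPs t ht)
  exact unifTime_add hAP hQs h1 hQ

end RHS

end Literature.Analysis.SereginLogSwirlOrigin.EulerScaling

end Part1

/-!
## Part 2 — port of `Summits/NavierStokesRegularity/NavierStokesRegularity/Theorems/AxisymmetricExtremalityAxisymmetricKatoGlobalStubSereginLogSwirlOriginStep3LocalKeyEstimate.lean` (2 declarations kept)

# Seregin 2022, §2 Step 3 for the LOCAL smooth class (XI): the key estimate for a family of
# smooth axisymmetric fields with uniform-in-`x` time moduli solving the vorticity equation near
# the cut-off — crux stmt-NavierStokesRegularity-15453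
# (`AxisymmetricExtremality.AxisymmetricKatoGlobal`), line registered, support for stub `stub_sereginLogSwirlOrigin`

Support file (`--supports stmt-NavierStokesRegularity-15453`; theorems only, everything proved)
toward the registered stub `stub_sereginLogSwirlOrigin` = the named fact
`Literature.Analysis.FluidPDE.seregin2022_logSwirl_regularAtOrigin` (G. Seregin, J. Math. Fluid
Mech. 24 (2022), Paper 27 = arXiv:2201.00153, §2). This is the top of the local-class port of
Step 3. The landed key estimate `cutoff_energy_keyEstimate_unconditional` (`…Step3KeyUnconditional`)
is stated for a whole-space classical solution `IsClassicalNSSolutionOn (Ioo a b) ν 0 v q`,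
whereas the first-singular-time reduction of the fact supplies only the Seregin–Zajaczkowski
representative `V` on an open cylinder (no `∂ₜV`, no regular pressure); the sibling files prove
the same estimate for a family `v` of globally `C^∞` axisymmetric fields which is divergence
free and solves the VORTICITY equation pointwise off the axis on an open `W ⊇ K ⊇ supp ζ`, given
the joint continuity of `Γ, ∇Γ, ∂ₜΓ, Φ, ∇Φ, ∂ₜΦ` (`cutoff_energy_keyEstimate_local_unconditional`).
Here that regularity is discharged from the time regularity the representative actually has:

* `continuousOn_quotient_families` — for `v` with smooth slices supported in a fixed ball and
  uniform-in-`x` time moduli of all `D_xᵏv` (`cutoffFamily_package`, `…Step3LocalCutoff`), the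
  six families `Γ = angVortQuot`, `∂ₜΓ = angVelQuot W`, `∇Γ`, `Φ = radVelQuot ∘ curl`,
  `∂ₜΦ = radVelQuot W`, `∇Φ` are jointly continuous on the slab (`continuousOn_radQuot_family`
  applied to `swirl (curl v)`, `⟪x_h, curl v⟫`, `swirl W`, `⟪x_h, W⟫`, whose moduli come from
  `unifTime_curl`, `unifTime_vorticityRHS` and `unifTime_bilinear` with the pairings
  `⟪Jy, ·⟫`, `⟪y_h, ·⟫`);
* `cutoff_energy_keyEstimate_local_of_moduli` (registered sub-goal) — **the Step-3 key estimate
  of Seregin 2022 for the local smooth class** (arXiv p. 7: "`sup_{-1<t<0}∫_𝒞 η⁶(|Γ|² + |Φ|²)dx +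
  ∫_Q (η³|∇Φ|)² + (η³|∇Γ|)² dxdt ≤ C(v,η,r₁)`"): hypotheses = those of
  `cutoff_energy_keyEstimate_unconditional` ((2.2) with `C₁` on `r < r₁`, the far-field bound
  `M`, the cut-off bound `Bcut`, the pointwise constants `P₀, …, P₄` on `supp ∇ζ ∪ {r ≥ r₁}`,
  `|B̄(0,2)| ≤ V`, the smallness `8C₁/ln(e/r₁) + 13C₁/ln²(e/r₁) + 4ε < 2ν`) with the classical
  solution replaced by: globally `C^∞` axisymmetric slices vanishing off `B̄(0, R)`, uniform-in-`x`
  time moduli of all `D_xᵏv`, `div v = 0` and the pointwise vorticity equation off the axis on an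
open `W ⊇ K`, `K` compact with `ζ = 0` off `K`. Conclusion and constant
  `K = E(t₁) + (Bcut + (12C₁(P₃² + P₄²)V/L² + ((P₀² + P₁²)/(2ε) + 2P₂)V) + 4MV)(t₂ − t₁)` verbatim,
  the gradients written as `‖∇·‖²` (`norm_fderiv_sq_eq_sum_sq`).

With `cutoffFamily_package` (for `v = χV`, `χ = 1` on `𝒞(r₀) ⊇ supp η`, where `v = V`) this is
the Step-3 input of the Step-4 assembly (`cubicC_le_of_keyEstimate`) for the representative.

## Mathlib / tree search

Tree: `cutoff_energy_keyEstimate_local_unconditional` (`…Step3LocalKeyEstimate0`),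
`continuousOn_radQuot_family`, `unifTime_curl`, `unifTime_bilinear` (`…Step3LocalFamilies`),
`unifTime_vorticityRHS`, `unifTime_fderiv`, `fderiv_eq_zero_of_forall_norm_gt`,
`curl_eq_zero_of_forall_norm_gt` (`…Step3LocalFamiliesW`), `contDiff_vorticityRHS`
(`…Step3LocalEquations`), `norm_fderiv_sq_eq_sum_sq` (`…Step4Assembly`), `swirl_eq_inner_rotGen`,
`rotGenL`, `contDiff_horizontal_inner`, `contDiff_swirl`. Mathlib: `innerSL_apply_apply`,
`EuclideanSpace.inner_single_left`, `laplacian_const`, `InnerProductSpace.laplacian_congr_nhds`.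
`lean search 'keyEstimate_local_of_moduli|quotient_families' --decl`: no matches (2026-08-17).

## References

* G. Seregin, J. Math. Fluid Mech. 24 (2022), Paper No. 27 = arXiv:2201.00153, §2 Step 3
  (arXiv p. 7, the key estimate). [`Seregin2022LocalAxisym`]
-/

section Part2

open _root_.MeasureTheory _root_.Set _root_.Filter _root_.Topology _root_.Function _root_.Metric intervalIntegral
open scoped _root_.ENNReal _root_.ContDiff Laplacian RealInnerProductSpace
open Literature.Analysis.FluidPDE

namespace Literature.Analysis.SereginLogSwirlOrigin.EulerScaling

/-! ### The six jointly continuous families from the time moduli -/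

section Families

/-- **Joint continuity of `Γ, ∂ₜΓ, ∇Γ, Φ, ∂ₜΦ, ∇Φ` from uniform-in-`x` time moduli.** Let `v` have
globally `C^∞` slices on `S`, supported in `B̄(0, R)`, with uniform-in-`y` time moduli of every
`D_yᵏ v` on `S`. Then the families `angVortQuot (v t)`, `angVelQuot W(t)`, `D(angVortQuot (v t))`,
`radVelQuot (curl (v t))`, `radVelQuot W(t)`, `D(radVelQuot (curl (v t)))`
(`W(t) = νΔ(curl v t) − D(curl v t)[v t] + D(v t)[curl v t]`) are jointly continuous on `S × ℝ³`
— the regularity hypotheses of `cutoff_energy_keyEstimate_local_unconditional`. [folklore]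
[cite: Seregin2022LocalAxisym, §2 proof of Thm. 1.2, Step 3 (arXiv:2201.00153 pp. 4–7) (source of the ARGUMENT this module implements; this declaration is the cell’s own lemma or plumbing, NOT a printed statement)] -/
theorem continuousOn_quotient_families {S : Set ℝ}
    {v : ℝ → EuclideanSpace ℝ (Fin 3) → EuclideanSpace ℝ (Fin 3)} {ν R : ℝ}
    (hu : ∀ t ∈ S, ContDiff ℝ ∞ (v t)) (hR : ∀ t ∈ S, ∀ y, R < ‖y‖ → v t y = 0)
    (hU : ∀ k : ℕ, ∀ t ∈ S, ∀ ε > 0, ∃ δ > 0, ∀ t' ∈ S, |t' - t| < δ → ∀ y,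
      ‖iteratedFDeriv ℝ k (v t') y - iteratedFDeriv ℝ k (v t) y‖ ≤ ε) :
    ContinuousOn (fun z : ℝ × EuclideanSpace ℝ (Fin 3) => angVortQuot (v z.1) z.2) (S ×ˢ univ) ∧
    ContinuousOn (fun z : ℝ × EuclideanSpace ℝ (Fin 3) => angVelQuot (fun y => ν • (Δ (curl (v z.1))) y - fderiv ℝ (curl (v z.1)) y (v z.1 y) + fderiv ℝ (v z.1) y (curl (v z.1) y)) z.2) (S ×ˢ univ) ∧
    ContinuousOn (fun z : ℝ × EuclideanSpace ℝ (Fin 3) => fderiv ℝ (angVortQuot (v z.1)) z.2) (S ×ˢ univ) ∧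
    ContinuousOn (fun z : ℝ × EuclideanSpace ℝ (Fin 3) => radVelQuot (curl (v z.1)) z.2) (S ×ˢ univ) ∧
    ContinuousOn (fun z : ℝ × EuclideanSpace ℝ (Fin 3) => radVelQuot (fun y => ν • (Δ (curl (v z.1))) y - fderiv ℝ (curl (v z.1)) y (v z.1 y) + fderiv ℝ (v z.1) y (curl (v z.1) y)) z.2) (S ×ˢ univ) ∧
    ContinuousOn (fun z : ℝ × EuclideanSpace ℝ (Fin 3) => fderiv ℝ (radVelQuot (curl (v z.1))) z.2) (S ×ˢ univ) := by
  -- name the right-hand side family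
  obtain ⟨Wf, hWf⟩ : ∃ Wf : ℝ → EuclideanSpace ℝ (Fin 3) → EuclideanSpace ℝ (Fin 3),
      ∀ t, Wf t = fun y => ν • (Δ (curl (v t))) y - fderiv ℝ (curl (v t)) y (v t y) + fderiv ℝ (v t) y (curl (v t) y) := ⟨_, fun _ => rfl⟩
  have hω : ∀ t ∈ S, ContDiff ℝ ∞ (curl (v t)) := fun t ht => contDiff_curl (n := ⊤) (by exact_mod_cast hu t ht)
  have hWs : ∀ t ∈ S, ContDiff ℝ ∞ (Wf t) := fun t ht => by rw [hWf]; exact contDiff_vorticityRHS (hu t ht) ν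
  have hωR : ∀ t ∈ S, ∀ y, R < ‖y‖ → curl (v t) y = 0 := fun t ht y hy => curl_eq_zero_of_forall_norm_gt (hR t ht) hy
  have hWR : ∀ t ∈ S, ∀ y, R < ‖y‖ → Wf t y = 0 := by
    intro t ht y hy
    have hopen : IsOpen {z : EuclideanSpace ℝ (Fin 3) | R < ‖z‖} := isOpen_lt continuous_const continuous_norm
    have hcurl : curl (v t) =ᶠ[𝓝 y] fun _ => (0 : EuclideanSpace ℝ (Fin 3)) := by
      filter_upwards [hopen.mem_nhds hy] with z hz using hωR t ht z hz
    have hΔ : (Δ (curl (v t))) y = 0 := by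
      rw [(InnerProductSpace.laplacian_congr_nhds hcurl).self_of_nhds, InnerProductSpace.laplacian_const, Pi.zero_apply]
    rw [hWf]
    show ν • (Δ (curl (v t))) y - fderiv ℝ (curl (v t)) y (v t y) + fderiv ℝ (v t) y (curl (v t) y) = 0
    rw [hΔ, fderiv_eq_zero_of_forall_norm_gt (hωR t ht) hy, hωR t ht y hy, smul_zero, map_zero]
    simp
  -- moduli of `ω` and `W`
  have hUω := unifTime_curl hu hU
  have hUW : ∀ k : ℕ, ∀ t ∈ S, ∀ ε > 0, ∃ δ > 0, ∀ t' ∈ S, |t' - t| < δ → ∀ y,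
      ‖iteratedFDeriv ℝ k (Wf t') y - iteratedFDeriv ℝ k (Wf t) y‖ ≤ ε := by
    intro k t ht ε hε
    obtain ⟨δ, hδ, h⟩ := unifTime_vorticityRHS S v ν R hu hR hU k t ht ε hε
    exact ⟨δ, hδ, fun t' ht' hlt y => by rw [hWf t', hWf t]; exact h t' ht' hlt y⟩
  -- the two pairings `⟪Jy, w⟫` and `⟪y_h, w⟫ = ⟪P y, w⟫`
  set P : EuclideanSpace ℝ (Fin 3) →L[ℝ] EuclideanSpace ℝ (Fin 3) :=
    (EuclideanSpace.proj (0 : Fin 3) : EuclideanSpace ℝ (Fin 3) →L[ℝ] ℝ).smulRight (EuclideanSpace.single 0 1) +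
      (EuclideanSpace.proj (1 : Fin 3) : EuclideanSpace ℝ (Fin 3) →L[ℝ] ℝ).smulRight (EuclideanSpace.single 1 1) with hP
  have hPinner : ∀ (y w : EuclideanSpace ℝ (Fin 3)), ⟪P y, w⟫ = y 0 * w 0 + y 1 * w 1 := fun y w => by
    simp [hP, inner_add_left, inner_smul_left, EuclideanSpace.inner_single_left]
  have eS : ∀ w : EuclideanSpace ℝ (Fin 3) → EuclideanSpace ℝ (Fin 3),
      swirl w = fun y => innerSL ℝ (rotGenL y) (w y) := fun w => by
    rw [swirl_eq_inner_rotGen]; rfl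
  have eH : ∀ w : EuclideanSpace ℝ (Fin 3) → EuclideanSpace ℝ (Fin 3),
      (fun y : EuclideanSpace ℝ (Fin 3) => y 0 * w y 0 + y 1 * w y 1) = fun y => innerSL ℝ (P y) (w y) := fun w => by
    funext y; rw [innerSL_apply_apply, hPinner]
  -- constant left families have trivial moduli
  have hconst : ∀ (L : EuclideanSpace ℝ (Fin 3) →L[ℝ] EuclideanSpace ℝ (Fin 3)),
      ∀ k : ℕ, ∀ t ∈ S, ∀ ε > 0, ∃ δ > 0, ∀ t' ∈ S, |t' - t| < δ → ∀ y,
        ‖iteratedFDeriv ℝ k ((fun (_ : ℝ) (y : EuclideanSpace ℝ (Fin 3)) => L y) t') y -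
          iteratedFDeriv ℝ k ((fun (_ : ℝ) (y : EuclideanSpace ℝ (Fin 3)) => L y) t) y‖ ≤ ε :=
    fun L k t _ ε hε => ⟨1, one_pos, fun t' _ _ y => by rw [sub_self, norm_zero]; exact hε.le⟩
  have hLs : ∀ (L : EuclideanSpace ℝ (Fin 3) →L[ℝ] EuclideanSpace ℝ (Fin 3)), ∀ t ∈ S,
      ContDiff ℝ ∞ ((fun (_ : ℝ) (y : EuclideanSpace ℝ (Fin 3)) => L y) t) := fun L _ _ => L.contDiff
  -- moduli of the four scalar families
  have mk : ∀ {w : ℝ → EuclideanSpace ℝ (Fin 3) → EuclideanSpace ℝ (Fin 3)} (L : EuclideanSpace ℝ (Fin 3) →L[ℝ] EuclideanSpace ℝ (Fin 3)),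
      (∀ t ∈ S, ContDiff ℝ ∞ (w t)) → (∀ t ∈ S, ∀ y, R < ‖y‖ → w t y = 0) →
      (∀ k : ℕ, ∀ t ∈ S, ∀ ε > 0, ∃ δ > 0, ∀ t' ∈ S, |t' - t| < δ → ∀ y,
        ‖iteratedFDeriv ℝ k (w t') y - iteratedFDeriv ℝ k (w t) y‖ ≤ ε) →
      ∀ k : ℕ, ∀ t ∈ S, ∀ ε > 0, ∃ δ > 0, ∀ t' ∈ S, |t' - t| < δ → ∀ y,
        ‖iteratedFDeriv ℝ k (fun y => innerSL ℝ (L y) (w t' y)) y -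
          iteratedFDeriv ℝ k (fun y => innerSL ℝ (L y) (w t y)) y‖ ≤ ε :=
    fun L hw hwR hUw => unifTime_bilinear (S := S) (innerSL ℝ) (f := fun (_ : ℝ) y => L y) (hLs L) hw hwR (hconst L) hUw
  have hUΓ : ∀ k : ℕ, k = 2 ∨ k = 3 → ∀ t ∈ S, ∀ ε > 0, ∃ δ > 0, ∀ t' ∈ S, |t' - t| < δ → ∀ y,
      ‖iteratedFDeriv ℝ k (swirl (curl (v t'))) y - iteratedFDeriv ℝ k (swirl (curl (v t))) y‖ ≤ ε := by
    intro k _ t ht ε hε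
    obtain ⟨δ, hδ, h⟩ := mk rotGenL hω hωR hUω k t ht ε hε
    exact ⟨δ, hδ, fun t' ht' hlt y => by rw [eS, eS]; exact h t' ht' hlt y⟩
  have hUΓ' : ∀ k : ℕ, k = 2 ∨ k = 3 → ∀ t ∈ S, ∀ ε > 0, ∃ δ > 0, ∀ t' ∈ S, |t' - t| < δ → ∀ y,
      ‖iteratedFDeriv ℝ k (swirl (Wf t')) y - iteratedFDeriv ℝ k (swirl (Wf t)) y‖ ≤ ε := by
    intro k _ t ht ε hε
    obtain ⟨δ, hδ, h⟩ := mk rotGenL hWs hWR hUW k t ht ε hε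
    exact ⟨δ, hδ, fun t' ht' hlt y => by rw [eS, eS]; exact h t' ht' hlt y⟩
  have hUJ : ∀ k : ℕ, k = 2 ∨ k = 3 → ∀ t ∈ S, ∀ ε > 0, ∃ δ > 0, ∀ t' ∈ S, |t' - t| < δ → ∀ y,
      ‖iteratedFDeriv ℝ k (fun y : EuclideanSpace ℝ (Fin 3) => y 0 * curl (v t') y 0 + y 1 * curl (v t') y 1) y -
        iteratedFDeriv ℝ k (fun y : EuclideanSpace ℝ (Fin 3) => y 0 * curl (v t) y 0 + y 1 * curl (v t) y 1) y‖ ≤ ε := by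
    intro k _ t ht ε hε
    obtain ⟨δ, hδ, h⟩ := mk P hω hωR hUω k t ht ε hε
    exact ⟨δ, hδ, fun t' ht' hlt y => by rw [eH, eH]; exact h t' ht' hlt y⟩
  have hUJ' : ∀ k : ℕ, k = 2 ∨ k = 3 → ∀ t ∈ S, ∀ ε > 0, ∃ δ > 0, ∀ t' ∈ S, |t' - t| < δ → ∀ y,
      ‖iteratedFDeriv ℝ k (fun y : EuclideanSpace ℝ (Fin 3) => y 0 * Wf t' y 0 + y 1 * Wf t' y 1) y -
        iteratedFDeriv ℝ k (fun y : EuclideanSpace ℝ (Fin 3) => y 0 * Wf t y 0 + y 1 * Wf t y 1) y‖ ≤ ε := by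
    intro k _ t ht ε hε
    obtain ⟨δ, hδ, h⟩ := mk P hWs hWR hUW k t ht ε hε
    exact ⟨δ, hδ, fun t' ht' hlt y => by rw [eH, eH]; exact h t' ht' hlt y⟩
  -- the radial quotients
  obtain ⟨cΓ, cDΓ⟩ := continuousOn_radQuot_family S (fun t => swirl (curl (v t)))
    (fun t ht => contDiff_swirl (hω t ht)) hUΓ
  obtain ⟨cΓ', -⟩ := continuousOn_radQuot_family S (fun t => swirl (Wf t))
    (fun t ht => contDiff_swirl (hWs t ht)) hUΓ'
  obtain ⟨cJ, cDJ⟩ := continuousOn_radQuot_family S (fun t => fun y : EuclideanSpace ℝ (Fin 3) => y 0 * curl (v t) y 0 + y 1 * curl (v t) y 1)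
    (fun t ht => contDiff_horizontal_inner (hω t ht)) hUJ
  obtain ⟨cJ', -⟩ := continuousOn_radQuot_family S (fun t => fun y : EuclideanSpace ℝ (Fin 3) => y 0 * Wf t y 0 + y 1 * Wf t y 1)
    (fun t ht => contDiff_horizontal_inner (hWs t ht)) hUJ'
  refine ⟨cΓ, ?_, cDΓ, cJ, ?_, cDJ⟩
  · refine cΓ'.congr fun z _ => ?_
    show angVelQuot _ z.2 = radQuot (swirl (Wf z.1)) z.2
    rw [hWf]; rfl
  · refine cJ'.congr fun z _ => ?_
    show radVelQuot _ z.2 = radQuot (fun y : EuclideanSpace ℝ (Fin 3) => y 0 * Wf z.1 y 0 + y 1 * Wf z.1 y 1) z.2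
    rw [hWf]; rfl

end Families

/-! ### The key estimate for the local class, from the time moduli -/

set_option maxHeartbeats 800000 in
/-- **Seregin 2022, §2 Step 3 — the key estimate for the LOCAL smooth class** (arXiv p. 7:
"`sup_{-1<t<0}∫_𝒞 η⁶(|Γ|² + |Φ|²)dx + ∫_Q (η³|∇Φ|)² + (η³|∇Γ|)² dxdt ≤ C(v,η,r₁)`"), in the
form needed after the first-singular-time reduction of the fact: the statement of
`cutoff_energy_keyEstimate_unconditional` with the whole-space classical solution replaced by a
family `v` of globally `C^∞` axisymmetric fields on `(a, b)` vanishing off `B̄(0, R)`, with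
uniform-in-`x` time moduli of all `D_xᵏv` (the cut-off globalisation `χV` of the
Seregin–Zajaczkowski representative, `cutoffFamily_package`), divergence free and solving the
vorticity equation pointwise off the axis on an open `W` containing the compact `K` off which
`ζ` vanishes. Hypotheses (2.2)/`M`/`Bcut`/`P₀…P₄`/`V`/smallness and the conclusion with its
constant `K = E(t₁) + (Bcut + (12C₁(P₃²+P₄²)V/L² + ((P₀²+P₁²)/(2ε) + 2P₂)V) + 4MV)(t₂ − t₁)`,
`L = ln(e/r₁)`, verbatim (gradients as `‖∇·‖²`). Registered sub-goal toward
`stub_sereginLogSwirlOrigin`. [cite: Seregin2022LocalAxisym, §2 Step 3 (arXiv:2201.00153 p. 7, the key estimate) and Lemma 2.1 (p. 5)] -/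
theorem cutoff_energy_keyEstimate_local_of_moduli : ∀ (a b ν : ℝ) (v : ℝ → EuclideanSpace ℝ (Fin 3) → EuclideanSpace ℝ (Fin 3)) (ζ : ℝ → EuclideanSpace ℝ (Fin 3) → ℝ) (K W : Set (EuclideanSpace ℝ (Fin 3))) (R t₁ t₂ C₁ r₁ M Bcut ε P₀ P₁ P₂ P₃ P₄ V : ℝ), (∀ s ∈ Ioo a b, ContDiff ℝ (⊤ : ℕ∞) (v s)) → (∀ s ∈ Ioo a b, IsAxisymmetric (v s)) → 0 ≤ ν → IsSmoothSpaceTimeOn (Ioo a b) ζ → (∀ s ∈ Ioo a b, IsAxisymmetricScalar (ζ s)) → (∀ s ∈ Ioo a b, tsupport (ζ s) ⊆ SereginSverak2009.spaceCyl 0 1) → Icc t₁ t₂ ⊆ Ioo a b → IsCompact K → (∀ s ∈ Ioo a b, ∀ x ∉ K, ζ s x = 0) → IsOpen W → K ⊆ W → (∀ s ∈ Ioo a b, ∀ x ∈ W, VectorCalculus.divergence (v s) x = 0) → (∀ s ∈ Ioo a b, ∀ x ∈ W, cylRadius x ≠ 0 → HasDerivAt (fun s' => curl (v s') x) (ν •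 (Δ (curl (v s))) x - fderiv ℝ (curl (v s)) x (v s x) + fderiv ℝ (v s) x (curl (v s) x)) s) → (∀ t ∈ Ioo a b, ∀ y, R < ‖y‖ → v t y = 0) → (∀ k : ℕ, ∀ t ∈ Ioo a b, ∀ ε > 0, ∃ δ > 0, ∀ t' ∈ Ioo a b, |t' - t| < δ → ∀ y, ‖iteratedFDeriv ℝ k (v t') y - iteratedFDeriv ℝ k (v t) y‖ ≤ ε) → t₁ ≤ t₂ → 0 ≤ C₁ → 0 < r₁ → r₁ < 1 → 0 ≤ M → 0 ≤ Bcut → 0 < ε → 0 ≤ P₂ → volume.real (closedBall (0 : EuclideanSpace ℝ (Fin 3)) 2) ≤ V → (∀ t ∈ Icc t₁ t₂, ∀ x, 0 < cylRadius x → cylRadius x < r₁ → |swirl (v t) x| ≤ C₁ / Real.log (Real.exp 1 / cylRadius x) ^ 3) → (∀ t ∈ Icc t₁ t₂, ∀ x, r₁ ≤ cylRadius x → |angVelQuot (v t) x * (ζ t x * angVortQuot (v t) x) * (ζ t x * radVelQuot (curl (v t)) x)| ≤ M) → (∀ t ∈ Icc t₁ t₂, (2 * (∫ x, ζ t x * timeDerivWithin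 (Ioo a b) ζ t x * angVortQuot (v t) x ^ 2) + 2 * (∫ x, ζ t x * angVortQuot (v t) x ^ 2 * fderiv ℝ (ζ t) x (v t x)) + 2 * ν * (∫ x, angVortQuot (v t) x ^ 2 * ‖fderiv ℝ (ζ t) x‖ ^ 2) - 4 * ν * (∫ x, ζ t x * angVortQuot (v t) x ^ 2 * radDerivQuot (ζ t) x)) + (2 * (∫ x, ζ t x * timeDerivWithin (Ioo a b) ζ t x * radVelQuot (curl (v t)) x ^ 2) + 2 * (∫ x, ζ t x * radVelQuot (curl (v t)) x ^ 2 * fderiv ℝ (ζ t) x (v t x)) + 2 * ν * (∫ x, radVelQuot (curl (v t)) x ^ 2 * ‖fderiv ℝ (ζ t) x‖ ^ 2) - 4 * ν * (∫ x, ζ t x * radVelQuot (curl (v t)) x ^ 2 * radDerivQuot (ζ t) x)) ≤ Bcut) → (∀ t ∈ Icc t₁ t₂, ∀ x, r₁ ≤ cylRadius x → |swirlVelocity (v t) x| * ‖fderiv ℝ (fun y => ζ t y * radVelQuot (v t) y) x‖ ≤ P₀) → (∀ t ∈ Icc t₁ t₂, ∀ x, |radVelQuot (v t) x| * |swirlVelocity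 (v t) x| * ‖fderiv ℝ (ζ t) x‖ ≤ P₁) → (∀ t ∈ Icc t₁ t₂, ∀ x, |ζ t x * radVelQuot (curl (v t)) x| * |swirlVelocity (v t) x| * (‖fderiv ℝ (ζ t) x‖ * ‖fderiv ℝ (radVelQuot (v t)) x‖) ≤ P₂) → (∀ t ∈ Icc t₁ t₂, ∀ x, fderiv ℝ (ζ t) x ≠ 0 → |fderiv ℝ (fun y => fderiv ℝ (ζ t) y (EuclideanSpace.single 2 1) * radVelQuot (v t) y - radDerivQuot (ζ t) y * v t y 2) x (EuclideanSpace.single 2 1)| ≤ P₃) → (∀ t ∈ Icc t₁ t₂, ∀ x, fderiv ℝ (ζ t) x ≠ 0 → |radDerivQuot (fun y => fderiv ℝ (ζ t) y (v t y)) x| ≤ P₄) → 8 * C₁ / Real.log (Real.exp 1 / r₁) + (13 * C₁ / Real.log (Real.exp 1 / r₁) ^ 2 + 4 * ε) < 2 * ν → (∀ t ∈ Icc t₁ t₂, (∫ x, (ζ t x * angVortQuot (v t) x) ^ 2) + (∫ x, (ζ t x * radVelQuot (curl (v t)) x) ^ 2) ≤ (∫ x, (ζ t₁ x * angVortQuot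 (v t₁) x) ^ 2) + (∫ x, (ζ t₁ x * radVelQuot (curl (v t₁)) x) ^ 2) + (Bcut + (12 * C₁ * (P₃ ^ 2 + P₄ ^ 2) * V / Real.log (Real.exp 1 / r₁) ^ 2 + ((P₀ ^ 2 + P₁ ^ 2) / (2 * ε) + 2 * P₂) * V) + 4 * M * V) * (t₂ - t₁)) ∧ ∫ s in t₁..t₂, ((∫ x, ‖fderiv ℝ (fun y => ζ s y * angVortQuot (v s) y) x‖ ^ 2) + (∫ x, ‖fderiv ℝ (fun y => ζ s y * radVelQuot (curl (v s)) y) x‖ ^ 2)) ≤ ((∫ x, (ζ t₁ x * angVortQuot (v t₁) x) ^ 2) + (∫ x, (ζ t₁ x * radVelQuot (curl (v t₁)) x) ^ 2) + (Bcut + (12 * C₁ * (P₃ ^ 2 + P₄ ^ 2) * V / Real.log (Real.exp 1 / r₁) ^ 2 + ((P₀ ^ 2 + P₁ ^ 2) / (2 * ε) + 2 * P₂) * V) + 4 * M * V) * (t₂ - t₁)) / (2 * ν - 8 * C₁ / Real.log (Real.exp 1 / r₁) - (13 * C₁ / Real.log (Real.exp 1 / r₁) ^ 2 + 4 * ε))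 := by
  intro a b ν v ζ K W R t₁ t₂ C₁ r₁ M Bcut ε P₀ P₁ P₂ P₃ P₄ V hu hax hν hζ hζax hζs hsub hK hsupp hWo hKW hdiv hvort hR hU h12 hC₁ hr₁ hr₁1 hM hBcut hε hP₂ hV hσ hfar hcut hP0 hP1 hP2 hP3 hP4 hsmall
  obtain ⟨hΓc, hΓ'c, hDΓc, hJc, hJ'c, hDJc⟩ := continuousOn_quotient_families (S := Ioo a b) (ν := ν) hu hR hU
  -- the cut-off bound in the coordinate form
  have hcut' : ∀ t ∈ Icc t₁ t₂, (2 * (∫ x, ζ t x * timeDerivWithin (Ioo a b) ζ t x * angVortQuot (v t) x ^ 2) + 2 * (∫ x, ζ t x * angVortQuot (v t) x ^ 2 * fderiv ℝ (ζ t) x (v t x)) + 2 * ν * (∫ x, angVortQuot (v t) x ^ 2 * (fderiv ℝ (ζ t) x (EuclideanSpace.single 0 1) ^ 2 + fderiv ℝ (ζ t) x (EuclideanSpace.single 1 1) ^ 2 + fderiv ℝ (ζ t) x (EuclideanSpace.single 2 1) ^ 2)) - 4 * ν * (∫ x, ζ t x * angVortQuot (v t) x ^ 2 * radDerivQuot (ζ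 t) x)) + (2 * (∫ x, ζ t x * timeDerivWithin (Ioo a b) ζ t x * radVelQuot (curl (v t)) x ^ 2) + 2 * (∫ x, ζ t x * radVelQuot (curl (v t)) x ^ 2 * fderiv ℝ (ζ t) x (v t x)) + 2 * ν * (∫ x, radVelQuot (curl (v t)) x ^ 2 * (fderiv ℝ (ζ t) x (EuclideanSpace.single 0 1) ^ 2 + fderiv ℝ (ζ t) x (EuclideanSpace.single 1 1) ^ 2 + fderiv ℝ (ζ t) x (EuclideanSpace.single 2 1) ^ 2)) - 4 * ν * (∫ x, ζ t x * radVelQuot (curl (v t)) x ^ 2 * radDerivQuot (ζ t) x)) ≤ Bcut := by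
    intro t ht
    simpa only [← norm_fderiv_sq_eq_sum_sq] using hcut t ht
  obtain ⟨hsup, hdiss⟩ := cutoff_energy_keyEstimate_local_unconditional a b ν v ζ K W t₁ t₂ C₁ r₁ M Bcut ε P₀ P₁ P₂ P₃ P₄ V
    hu hax hν hζ hζax hζs hsub hK hsupp hWo hKW hdiv hvort hΓc hΓ'c hDΓc hJc hJ'c hDJc h12 hC₁ hr₁ hr₁1 hM hBcut hε hP₂ hV hσ hfar hcut' hP0 hP1 hP2 hP3 hP4 hsmall
  refine ⟨hsup, ?_⟩
  simpa only [norm_fderiv_sq_eq_sum_sq] using hdiss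

end Literature.Analysis.SereginLogSwirlOrigin.EulerScaling

end Part2

/-!
## Part 3 — port of `Summits/NavierStokesRegularity/NavierStokesRegularity/Theorems/AxisymmetricExtremalityAxisymmetricKatoGlobalStubSereginLogSwirlOriginCoreAtOriginBridges.lean` (8 declarations kept)

# Seregin 2022, §2: bridges for the cut-off globalisation `v = χW` of the Seregin–Zajaczkowski
# representative (inputs of the Step 1 + 3 + 4 chain for the class of the fact's core) —
# crux stmt-NavierStokesRegularity-15453 (`AxisymmetricExtremality.AxisymmetricKatoGlobal`), line registered, support for stub `stub_sereginLogSwirlOrigin`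

Support file (`--supports stmt-NavierStokesRegularity-15453`; theorems only, everything proved)
toward the registered stub `stub_sereginLogSwirlOrigin` = the named fact
`Literature.Analysis.FluidPDE.seregin2022_logSwirl_regularAtOrigin` (G. Seregin, J. Math. Fluid
Mech. 24 (2022), Paper 27 = arXiv:2201.00153, §2: Def. 1.1 in `Q = 𝒞 × ]-1, 0[` + axial
symmetry + the swirl bound (2.2) ⇒ the origin is a regular point).

The sibling `…CoreNormalise` (p170530) reduced the fact to the CORE AT THE ORIGIN
(`seregin2022_logSwirl_regularAtOrigin_of_coreAtOrigin`: Steps 2–4 at `ẑ = 0`, `R = 1` for the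
Seregin–Zajaczkowski representative `W` of `u` on `Q`), the sibling `…Step1CutoffChain`
(p170786, `tendsto_cubicC_of_classical_cleanConfig`) ran Steps 1 + 3 + 4 end to end for the
CLASSICAL class, and the local port of the Step-3 key estimate has landed
(`…Step3LocalKeyEstimateSZ`, p171742, `cutoff_energy_keyEstimate_of_isSmoothAxisymmetricSolutionOn`,
stated for the cut-off globalisation `v = χW`, `χ = 1` on `𝒞(ρ₀)`, `tsupport χ ⊆ 𝒞(ρ₁)`,
`cutoffFamily_package`).  Re-running the chain for `v = χW` needs the following bridges between
the data of `W` on `Q` and the (global) hypotheses of the chain for `v`, proved here: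

* `swirl_cutoffField`, `swirlBound_cutoffField` — `σ(χW) = χσ(W)`, hence **(2.2) for `v`
  GLOBALLY off the axis** from (2.2) for `W` on `Q` off the axis (`0 ≤ χ ≤ 1`, `χ = 0` off `𝒞`;
  the key estimate asks the swirl bound at every `x` with `0 < ϱ(x) < r₁`, all `x₃`);
* `energyBound_cutoffField` — `∫_𝒞 |v(t)|² ≤ ∫_𝒞 |W(t)|² ≤ A`;
* `cutoffField_eq_of_mem`, `cubicC_cutoffField` — `v = W` on `𝒞(ρ₀)`, so
  `C(R; v) = C(R; W)` for `R ≤ ρ₀` (`SereginSverak2009.cubicC`);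
* `aestronglyMeasurable_cutoffField` — measurability of `v` on `Q(r)`, `r ≤ min ρ₀ 1`
  (`aestronglyMeasurable_repr`);
* `derivBounds_of_eventuallyEq` — the bounds `‖W‖ ≤ D₀`, `‖DW‖ ≤ D₁`, `‖D²W‖ ≤ D₂` at a point
  near which `v t = W t` pass to `v` (the regular region `K` of Step 1 lies in `𝒞(ρ₀)`);
* `continuousOn_dissipation_cutoffField` — **continuity in time of the two dissipation densities**
  `s ↦ ∫ Σᵢ(∂ᵢ(ζΓ(s)))²`, `s ↦ ∫ Σᵢ(∂ᵢ(ζΦ(s)))²` (`Γ = angVortQuot (v s)`, `Φ = radVelQuot (curl (v s))`)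
  on the open time set, the Step-4 input `hDΓc`/`hDΦc` of `tendsto_cubicC_of_keyEstimate`, from
  the uniform-in-`x` time moduli of `cutoffFamily_package` (`continuousOn_quotient_families`,
  `continuousOn_integral_gradSq_cutoff_of_continuousOn`) — replacing the joint space-time
  smoothness used by the classical chain, which the local class lacks.

## Mathlib / tree search

Tree: `continuousOn_quotient_families` (`…Step3LocalKeyEstimate`),
`continuousOn_integral_gradSq_cutoff_of_continuousOn` (`…Step3LocalApriori`),
`aestronglyMeasurable_repr`, `parCyl_zero_one_eq_prod` (`…Step1CutoffCompact`),
`one_le_log_exp_div` (`…Step1CutoffChain`), `mem_spaceCyl_zero_iff` (`…CoreNormaliseRescale`),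
`contDiff_angVortQuot`, `contDiff_radVelQuot`, `contDiff_curl_of_succ`, `swirl`.
Mathlib: `Filter.EventuallyEq.fderiv_eq/.iteratedFDeriv`, `AEStronglyMeasurable.congr`,
`setLIntegral_congr_fun`, `ofReal_norm`, `image_eq_zero_of_notMem_tsupport`.
`lean search 'cutoffField_eq_of_mem|swirlBound_cutoffField|dissipation_cutoffField' --decl`:
no matches (2026-08-17).

## References

* G. Seregin, J. Math. Fluid Mech. 24 (2022), Paper No. 27 = arXiv:2201.00153, §2 proof of
  Thm. 1.2, Steps 1, 3, 4 (arXiv pp. 5–7). [`Seregin2022LocalAxisym`]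
* G. Seregin, W. Zajaczkowski, SIAM J. Math. Anal. 39 (2007) 669–685, Prop. 4.1 (the class).
  [`SereginZajaczkowski2007`]
-/

section Part3

open _root_.Set _root_.Filter _root_.Topology _root_.Function _root_.Metric _root_.MeasureTheory intervalIntegral
open scoped _root_.ENNReal _root_.NNReal _root_.ContDiff
open Literature.Analysis.FluidPDE Literature.Analysis.FluidPDE.SereginZajaczkowski2007

namespace Literature.Analysis.SereginLogSwirlOrigin.EulerScaling

/-! ### Bridges for the cut-off globalisation `v = χW` -/

section Bridges

variable {W v : ℝ → EuclideanSpace ℝ (Fin 3) → EuclideanSpace ℝ (Fin 3)} {χ : EuclideanSpace ℝ (Fin 3) → ℝ}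

/-- `σ(χW) = χ σ(W)` (the swirl is linear in the field). [folklore]
[cite: Seregin2022LocalAxisym, §2 proof of Thm. 1.2 (arXiv:2201.00153 pp. 4–7) (source of the ARGUMENT this module implements; this declaration is the cell’s own lemma or plumbing, NOT a printed statement)] -/
theorem swirl_cutoffField (hv : ∀ t, v t = fun y => χ y • W t y) (t : ℝ) (x : EuclideanSpace ℝ (Fin 3)) :
    swirl (v t) x = χ x * swirl (W t) x := by
  rw [hv]
  simp only [swirl, PiLp.smul_apply, smul_eq_mul]
  ring

/-- **(2.2) for `v = χW`, globally off the axis**: if `|σ(W)| ≤ C₁/ln³(e/ϱ)` on `Q` off the axis,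
`0 ≤ χ ≤ 1`, `tsupport χ ⊆ 𝒞`, `C₁ ≥ 0`, then `|σ(v t)(x)| ≤ C₁/ln³(e/ϱ(x))` for `t ∈ ]-1, 0[` and
EVERY `x` with `0 < ϱ(x) < 1` (off `𝒞` the field vanishes and the bound is nonnegative).
[cite: Seregin2022LocalAxisym, §2 Step 1 (arXiv:2201.00153 p. 5), "we may assume also that (2.2) holds in 𝒞"] -/
theorem swirlBound_cutoffField (hv : ∀ t, v t = fun y => χ y • W t y)
    (hχ01 : ∀ y, 0 ≤ χ y ∧ χ y ≤ 1)
    (hχs : tsupport χ ⊆ SereginSverak2009.spaceCyl (0 : EuclideanSpace ℝ (Fin 3)) 1) {C₁ : ℝ} (hC₁ : 0 ≤ C₁)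
    (hσ : ∀ z ∈ SereginSverak2009.parCyl (0 : ℝ × EuclideanSpace ℝ (Fin 3)) 1, 0 < cylRadius z.2 →
      |swirl (W z.1) z.2| ≤ C₁ / Real.log (Real.exp 1 / cylRadius z.2) ^ 3) :
    ∀ t ∈ Ioo (-1 : ℝ) 0, ∀ x : EuclideanSpace ℝ (Fin 3), 0 < cylRadius x → cylRadius x < 1 →
      |swirl (v t) x| ≤ C₁ / Real.log (Real.exp 1 / cylRadius x) ^ 3 := by
  intro t ht x hx0 hx1
  have hRHS : 0 ≤ C₁ / Real.log (Real.exp 1 / cylRadius x) ^ 3 :=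
    div_nonneg hC₁ (pow_nonneg (zero_le_one.trans (one_le_log_exp_div hx0 hx1.le)) 3)
  rw [swirl_cutoffField hv]
  by_cases hχx : χ x = 0
  · rw [hχx, zero_mul, abs_zero]; exact hRHS
  · have hxs : x ∈ SereginSverak2009.spaceCyl (0 : EuclideanSpace ℝ (Fin 3)) 1 :=
      hχs (subset_tsupport _ (mem_support.2 hχx))
    have hz : ((t, x) : ℝ × EuclideanSpace ℝ (Fin 3)) ∈ SereginSverak2009.parCyl (0 : ℝ × EuclideanSpace ℝ (Fin 3)) 1 := by
      rw [parCyl_zero_one_eq_prod]; exact ⟨ht, hxs⟩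
    rw [abs_mul, abs_of_nonneg (hχ01 x).1]
    calc χ x * |swirl (W t) x| ≤ 1 * |swirl (W t) x| :=
        mul_le_mul_of_nonneg_right (hχ01 x).2 (abs_nonneg _)
      _ ≤ C₁ / Real.log (Real.exp 1 / cylRadius x) ^ 3 := by rw [one_mul]; exact hσ (t, x) hz hx0

/-- `‖χ W‖ₑ² ≤ ‖W‖ₑ²` for `0 ≤ χ ≤ 1`, hence the energy bound passes to `v = χW`. [folklore]
[cite: Seregin2022LocalAxisym, §2 proof of Thm. 1.2 (arXiv:2201.00153 pp. 4–7) (source of the ARGUMENT this module implements; this declaration is the cell’s own lemma or plumbing, NOT a printed statement)] -/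
theorem energyBound_cutoffField (hv : ∀ t, v t = fun y => χ y • W t y)
    (hχ01 : ∀ y, 0 ≤ χ y ∧ χ y ≤ 1) {A : ℝ≥0} {t : ℝ}
    (hA : ∫⁻ x in SereginSverak2009.spaceCyl (0 : EuclideanSpace ℝ (Fin 3)) 1, ‖W t x‖ₑ ^ 2 ≤ A) :
    ∫⁻ x in SereginSverak2009.spaceCyl (0 : EuclideanSpace ℝ (Fin 3)) 1, ‖v t x‖ₑ ^ 2 ≤ A := by
  refine (lintegral_mono fun x => ?_).trans hA
  have h : ‖v t x‖ ≤ ‖W t x‖ := by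
    rw [hv]
    show ‖χ x • W t x‖ ≤ ‖W t x‖
    rw [norm_smul, Real.norm_of_nonneg (hχ01 x).1]
    exact mul_le_of_le_one_left (norm_nonneg _) (hχ01 x).2
  have h' : ‖v t x‖ₑ ≤ ‖W t x‖ₑ := by
    rw [← ofReal_norm, ← ofReal_norm]
    exact ENNReal.ofReal_le_ofReal h
  gcongr

/-- On `𝒞(ρ₀)` (where `χ = 1`) the cut-off field is the field. [folklore]
[cite: Seregin2022LocalAxisym, §2 proof of Thm. 1.2 (arXiv:2201.00153 pp. 4–7) (source of the ARGUMENT this module implements; this declaration is the cell’s own lemma or plumbing, NOT a printed statement)] -/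
theorem cutoffField_eq_of_mem (hv : ∀ t, v t = fun y => χ y • W t y) {ρ₀ : ℝ}
    (hχ1 : ∀ y ∈ SereginSverak2009.spaceCyl (0 : EuclideanSpace ℝ (Fin 3)) ρ₀, χ y = 1) (t : ℝ)
    {x : EuclideanSpace ℝ (Fin 3)} (hx : x ∈ SereginSverak2009.spaceCyl (0 : EuclideanSpace ℝ (Fin 3)) ρ₀) :
    v t x = W t x := by
  rw [hv]
  show χ x • W t x = W t x
  rw [hχ1 x hx, one_smul]

/-- `C(R)` of the cut-off field is that of the field for `0 ≤ R ≤ ρ₀` (`v = W` on `Q(R) ⊆ ]-R², 0[ × 𝒞(ρ₀)`).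
[folklore]
[cite: Seregin2022LocalAxisym, §2 proof of Thm. 1.2 (arXiv:2201.00153 pp. 4–7) (source of the ARGUMENT this module implements; this declaration is the cell’s own lemma or plumbing, NOT a printed statement)] -/
theorem cubicC_cutoffField (hv : ∀ t, v t = fun y => χ y • W t y) {ρ₀ : ℝ}
    (hχ1 : ∀ y ∈ SereginSverak2009.spaceCyl (0 : EuclideanSpace ℝ (Fin 3)) ρ₀, χ y = 1) {R : ℝ}
    (hR : R ≤ ρ₀) :
    SereginSverak2009.cubicC 0 R v = SereginSverak2009.cubicC 0 R W := by
  unfold SereginSverak2009.cubicC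
  congr 1
  refine setLIntegral_congr_fun (SereginSverak2009.isOpen_parCyl 0 R).measurableSet fun z hz => ?_
  have hz' := SereginSverak2009.mem_parCyl_zero.1 hz
  have hx : z.2 ∈ SereginSverak2009.spaceCyl (0 : EuclideanSpace ℝ (Fin 3)) ρ₀ :=
    mem_spaceCyl_zero_iff.2 ⟨hz'.2.1.trans_le hR, hz'.2.2.trans_le hR⟩
  simp only [cutoffField_eq_of_mem hv hχ1 z.1 hx]

/-- Measurability of the cut-off field on `Q(r)`, `0 ≤ r ≤ min ρ₀ 1`, from that of the
representative (`aestronglyMeasurable_repr`; `v = W` on `Q(r)`). [folklore]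
[cite: Seregin2022LocalAxisym, §2 proof of Thm. 1.2 (arXiv:2201.00153 pp. 4–7) (source of the ARGUMENT this module implements; this declaration is the cell’s own lemma or plumbing, NOT a printed statement)] -/
theorem aestronglyMeasurable_cutoffField {π : ℝ → EuclideanSpace ℝ (Fin 3) → ℝ}
    (hW : IsSmoothAxisymmetricSolutionOn (SereginSverak2009.parCylOpens 0 1) W π)
    (hv : ∀ t, v t = fun y => χ y • W t y) {ρ₀ : ℝ}
    (hχ1 : ∀ y ∈ SereginSverak2009.spaceCyl (0 : EuclideanSpace ℝ (Fin 3)) ρ₀, χ y = 1) {r : ℝ}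
    (hr : 0 ≤ r) (hr1 : r ≤ 1) (hrρ : r ≤ ρ₀) :
    AEStronglyMeasurable (uncurry v) (volume.restrict (SereginSverak2009.parCyl (0 : ℝ × EuclideanSpace ℝ (Fin 3)) r)) := by
  refine (aestronglyMeasurable_repr hW hr hr1).congr ?_
  refine (ae_restrict_iff' (SereginSverak2009.isOpen_parCyl 0 r).measurableSet).2 (ae_of_all _ fun z hz => ?_)
  have hz' := SereginSverak2009.mem_parCyl_zero.1 hz
  have hx : z.2 ∈ SereginSverak2009.spaceCyl (0 : EuclideanSpace ℝ (Fin 3)) ρ₀ :=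
    mem_spaceCyl_zero_iff.2 ⟨hz'.2.1.trans_le hrρ, hz'.2.2.trans_le hrρ⟩
  show W z.1 z.2 = v z.1 z.2
  rw [cutoffField_eq_of_mem hv hχ1 z.1 hx]

/-- **Derivative bounds near a point pass to the cut-off field** where `v t = W t` near `x`.
[folklore]
[cite: Seregin2022LocalAxisym, §2 proof of Thm. 1.2 (arXiv:2201.00153 pp. 4–7) (source of the ARGUMENT this module implements; this declaration is the cell’s own lemma or plumbing, NOT a printed statement)] -/
theorem derivBounds_of_eventuallyEq {t : ℝ} {x : EuclideanSpace ℝ (Fin 3)} (he : v t =ᶠ[𝓝 x] W t)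
    {D₀ D₁ D₂ : ℝ} (h : ‖W t x‖ ≤ D₀ ∧ ‖fderiv ℝ (W t) x‖ ≤ D₁ ∧ ‖iteratedFDeriv ℝ 2 (W t) x‖ ≤ D₂) :
    ‖v t x‖ ≤ D₀ ∧ ‖fderiv ℝ (v t) x‖ ≤ D₁ ∧ ‖iteratedFDeriv ℝ 2 (v t) x‖ ≤ D₂ := by
  refine ⟨?_, ?_, ?_⟩
  · rw [he.eq_of_nhds]; exact h.1
  · rw [he.fderiv_eq]; exact h.2.1
  · rw [(he.iteratedFDeriv ℝ 2).eq_of_nhds]; exact h.2.2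

/-- **Continuity in time of the two dissipation densities of the cut-off field** on the open time
set `I`, from the uniform time moduli of `cutoffFamily_package` (`continuousOn_quotient_families`)
and `continuousOn_integral_gradSq_cutoff_of_continuousOn`, for a time-independent smooth
compactly supported cut-off `ζ`. [folklore]
[cite: Seregin2022LocalAxisym, §2 proof of Thm. 1.2 (arXiv:2201.00153 pp. 4–7) (source of the ARGUMENT this module implements; this declaration is the cell’s own lemma or plumbing, NOT a printed statement)] -/
theorem continuousOn_dissipation_cutoffField {I : Set ℝ} (hI : IsOpen I)
    (hsm : ∀ t ∈ I, ContDiff ℝ (⊤ : ℕ∞) (v t)) (hR : ∀ t ∈ I, ∀ y, 2 < ‖y‖ → v t y = 0)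
    (hU : ∀ k : ℕ, ∀ t ∈ I, ∀ ε > 0, ∃ δ > 0, ∀ t' ∈ I, |t' - t| < δ → ∀ y,
      ‖iteratedFDeriv ℝ k (v t') y - iteratedFDeriv ℝ k (v t) y‖ ≤ ε)
    {ζ : EuclideanSpace ℝ (Fin 3) → ℝ} (hζ : ContDiff ℝ (⊤ : ℕ∞) ζ) (hζc : HasCompactSupport ζ) :
    ContinuousOn (fun s => ∫ x, (fderiv ℝ (fun y => ζ y * angVortQuot (v s) y) x (EuclideanSpace.single 0 1) ^ 2 +
        fderiv ℝ (fun y => ζ y * angVortQuot (v s) y) x (EuclideanSpace.single 1 1) ^ 2 +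
        fderiv ℝ (fun y => ζ y * angVortQuot (v s) y) x (EuclideanSpace.single 2 1) ^ 2)) I ∧
    ContinuousOn (fun s => ∫ x, (fderiv ℝ (fun y => ζ y * radVelQuot (curl (v s)) y) x (EuclideanSpace.single 0 1) ^ 2 +
        fderiv ℝ (fun y => ζ y * radVelQuot (curl (v s)) y) x (EuclideanSpace.single 1 1) ^ 2 +
        fderiv ℝ (fun y => ζ y * radVelQuot (curl (v s)) y) x (EuclideanSpace.single 2 1) ^ 2)) I := by
  obtain ⟨hΓc, -, hDΓc, hΦc, -, hDΦc⟩ := continuousOn_quotient_families (S := I) (ν := (1 : ℝ)) hsm hR hU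
  have hζst : IsSmoothSpaceTimeOn I (fun _ : ℝ => ζ) := (hζ.comp contDiff_snd).contDiffOn
  have hsupp0 : ∀ t ∈ I, ∀ x ∉ tsupport ζ, (fun _ : ℝ => ζ) t x = 0 := fun t _ x hx =>
    image_eq_zero_of_notMem_tsupport hx
  have h4 : ∀ t ∈ I, ContDiff ℝ 4 (v t) := fun t ht => (hsm t ht).of_le (by norm_cast)
  have hΓd : ∀ t ∈ I, Differentiable ℝ fun x => angVortQuot (v t) x := fun t ht =>
    (contDiff_angVortQuot (n := 1) (by exact_mod_cast h4 t ht)).differentiable one_ne_zero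
  have hΦd : ∀ t ∈ I, Differentiable ℝ fun x => radVelQuot (curl (v t)) x := fun t ht =>
    (contDiff_radVelQuot (n := 1) (by exact_mod_cast
      (contDiff_curl_of_succ (n := 3) (by exact_mod_cast h4 t ht)))).differentiable one_ne_zero
  exact ⟨continuousOn_integral_gradSq_cutoff_of_continuousOn (G := fun t x => angVortQuot (v t) x) hI hζst hζc
      hsupp0 hΓc hΓd hDΓc,
    continuousOn_integral_gradSq_cutoff_of_continuousOn (G := fun t x => radVelQuot (curl (v t)) x) hI hζst hζc
      hsupp0 hΦc hΦd hDΦc⟩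

end Bridges

end Literature.Analysis.SereginLogSwirlOrigin.EulerScaling

end Part3

/-!
## Part 4 — port of `Summits/NavierStokesRegularity/NavierStokesRegularity/Theorems/AxisymmetricExtremalityAxisymmetricKatoGlobalStubSeregin2020TypeIIOffAxisRepr.lean` (1 declarations kept)

# Seregin 2020, proof of Thm 2.1: off the axis, an axisymmetric suitable weak solution is a
# "sufficiently smooth axially symmetric solution" (the Seregin–Zajaczkowski 2007 class)

Helper toward the stub `stub_seregin2020TypeII` of the crux `AxisymmetricKatoGlobal` (= the named
fact `Literature.Analysis.FluidPDE.Seregin2020_axisymmetricSingularPoint_typeII`, G. Seregin,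
Anal. Math. Phys. 10 (2020) Paper 46 = arXiv:2006.04140, Thm 2.1). The printed proof (arXiv
pp. 4–5) runs the swirl equation (2.2) and the Moser iteration (2.3)–(2.6) in
`Q ∖ ({x' = 0} × ]-1, 0[)`, using: "Denote by `S` the set of singular points of `v`. It is well
known that … `x' = 0` for any `z = (x, t) ∈ S`, and any spatial derivative of `v` is Hölder
continuous in `𝒞 × ]-1, 0] ∖ S`." The tree proves (2.2)–(2.4) for the hypothesis class
`SereginZajaczkowski2007.IsSmoothAxisymmetricSolutionOn S V P` on an arbitrary open, rotation
invariant, off-axis product region `S = ]lo, hi[ × U` (`Seregin2020SwirlEquationOffAxis.lean`,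
`Seregin2020SwirlEnergyInequality.lean`, `Seregin2020SwirlMoserEnergyBound.lean`), and it proves
the two quoted ingredients — off-axis points of an axisymmetric suitable weak solution are
regular (`isRegularPoint_of_cylRadius_ne_zero`, CKN) and essentially bounded distributional
solutions have smooth representatives with Hölder continuous spatial derivatives
(`NSBoundedHigherRegularity_holds`, glued on open sets by
`NSBoundedHigherRegularity.exists_smooth_representative`) — but the passage "axisymmetric suitable
weak solution ⇒ member of that class off the axis" was not recorded. This file records it:

* `exists_nhds_ae_norm_le_of_isRegularPoint` — a regular point has a neighbourhood on which the
  field is essentially bounded (unfolding of `IsRegularPoint`);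
* `exists_isSmoothAxisymmetricSolutionOn_of_offAxis` — GENERIC form: `(u, p)` suitable on an open
  `Q` with axisymmetric slices at the times of `Q`, `S ≤ Q` open, off the axis and invariant
  under `(t, x) ↦ (t, R_θ x)` ⟹ `u` has a representative `V` on `S` with `(V, p)` in the class on
  `S` (regular points ⟹ locally bounded ⟹ one smooth representative on `S`; suitability transported
  by `IsSuitableWeakSolutionOn.congr_ae`; pointwise symmetry of the continuous representative by
  `SereginSverak2009.isAxisymmetricOn_of_ae_eq`);
* `exists_isSmoothAxisymmetricSolutionOn_offAxis` — the form for the hypotheses (H) of Thm 2.1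
  (unit cylinder `Q = 𝒞 × ]-1, 0[`, regions `]lo, hi[ × U`, `-1 ≤ lo`, `hi ≤ 0`, `U ⊆ 𝒞` open,
  off the axis, rotation invariant);
* `exists_isSmoothAxisymmetricSolutionOn_offAxis_of_inBall` — the form for the blow-up limit
  (property (𝒜): suitable in Albritton–Barker's class on `Q(a)`, every slice axisymmetric);
* `stub_seregin2020TypeII_offAxisRepr` — the registered sub-stub (the three statements conjoined).

## References

* G. Seregin, Anal. Math. Phys. 10 (2020), Paper 46 = arXiv:2006.04140, proof of Thm. 2.1
  (structure of the singular set and smoothness off the axis, arXiv p. 5). [Seregin2020]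
* G. Seregin, W. Zajaczkowski, SIAM J. Math. Anal. 39 (2007) 669–685, §3 ("all spatial
  derivatives of `u` are Hölder continuous in a vicinity of each point with `y' ≠ 0`").
  [SereginZajaczkowski2007]
* L. Caffarelli, R. Kohn, L. Nirenberg, CPAM 35 (1982), §6. [CaffarelliKohnNirenberg1982]

Not carried from this source module (not needed by the declarations re-homed here; their consumers are Summits-side): `exists_isSmoothAxisymmetricSolutionOn_of_offAxis`, `exists_isSmoothAxisymmetricSolutionOn_offAxis`, `exists_isSmoothAxisymmetricSolutionOn_offAxis_of_inBall`, `stub_seregin2020TypeII_offAxisRepr`.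
-/

section Part4

open _root_.MeasureTheory _root_.Set _root_.Function _root_.Filter _root_.Topology _root_.TopologicalSpace
  _root_.Metric
open scoped _root_.NNReal _root_.ENNReal

namespace Literature.Analysis.SereginLogSwirlOrigin.EulerScaling

open Literature.Analysis.FluidPDE Literature.Analysis.FluidPDE.SereginZajaczkowski2007
  Literature.Analysis.FluidPDE.SereginSverak2009

/-! ### Regular points are points of local essential boundedness -/

/-- A regular point `z` of `u` (`u ∈ L^∞(Q*_r(z))` for some `r > 0`) has a neighbourhood on which
`‖u‖ ≤ M` almost everywhere (`M` the essential supremum over the centred cylinder). [folklore]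
[cite: Seregin2020, proof of Thm 2.1 (off-axis / no-swirl representatives, first singular point) (source of the ARGUMENT this module implements; this declaration is the cell’s own lemma or plumbing, NOT a printed statement)] -/
theorem exists_nhds_ae_norm_le_of_isRegularPoint
    {u : ℝ → EuclideanSpace ℝ (Fin 3) → EuclideanSpace ℝ (Fin 3)} {z : ℝ × EuclideanSpace ℝ (Fin 3)}
    (hreg : IsRegularPoint u z) :
    ∃ N ∈ 𝓝 z, ∃ M : ℝ, ∀ᵐ w ∂(volume.restrict N), ‖u w.1 w.2‖ ≤ M := by
  obtain ⟨r, hr, hfin⟩ := hreg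
  refine ⟨parabolicCylinderCentered r z, (isOpen_parabolicCylinderCentered r z).mem_nhds ?_,
    (eLpNorm (uncurry u) ∞ (volume.restrict (parabolicCylinderCentered r z))).toReal, ?_⟩
  · rw [mem_parabolicCylinderCentered, dist_self]
    have hr2 : 0 < r ^ 2 := by positivity
    exact ⟨⟨by linarith, by linarith⟩, hr⟩
  · filter_upwards [ae_le_eLpNormEssSup (f := uncurry u)
      (μ := volume.restrict (parabolicCylinderCentered r z))] with w hw
    rw [← eLpNorm_exponent_top] at hw
    calc ‖u w.1 w.2‖ = ‖uncurry u w‖ₑ.toReal := (toReal_enorm _).symm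
      _ ≤ (eLpNorm (uncurry u) ∞ (volume.restrict (parabolicCylinderCentered r z))).toReal :=
        ENNReal.toReal_mono hfin.ne hw

/-! ### The generic off-axis representative -/

end Literature.Analysis.SereginLogSwirlOrigin.EulerScaling

end Part4

/-!
## Part 5 — port of `Summits/NavierStokesRegularity/NavierStokesRegularity/Theorems/AxisymmetricExtremalityAxisymmetricKatoGlobalStubSeregin2020TypeIINoSwirlRegularRepr.lean` (1 declarations kept)

# Seregin 2020, proof of Thm 2.1, the no-swirl endgame: the smooth, axisymmetric, swirl-free
# representative on open sets of regular points

Helper toward the stub `stub_seregin2020TypeII` of the crux `AxisymmetricKatoGlobal` (= the named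
fact `Literature.Analysis.FluidPDE.Seregin2020_axisymmetricSingularPoint_typeII`, G. Seregin,
Anal. Math. Phys. 10 (2020) Paper 46 = arXiv:2006.04140, Thm 2.1). The last step of the printed
proof (arXiv p. 8: "any axially symmetric suitable weak solution with no swirl … is smooth … by
considering a problem for `η = ω_φ/ϱ`") is run, in the tree's rendering, as a local maximum
principle for `η` (`Literature.Analysis.FluidPDE.noSwirl_abs_scalar_le_of_boundary`) on a
cylinder all of whose points below the top time are REGULAR points, possibly on the axis. That
tool consumes a classical object: slices `C^∞` in space, axisymmetric and swirl free at every
point. The sibling `exists_isSmoothAxisymmetricSolutionOn_of_offAxis` produces the smooth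
axisymmetric representative (the Seregin–Zajaczkowski 2007 class
`IsSmoothAxisymmetricSolutionOn`) on OFF-AXIS regions, where regularity is automatic; this file
records the same passage on an arbitrary open, rotation invariant set of regular points
(`exists_isSmoothAxisymmetricSolutionOn_of_regular`), the pointwise vanishing of the swirl of
the continuous representative of an a.e. swirl-free field (`swirl_repr_eq_zero_of_ae`), and the
packaged form for a pair in Albritton–Barker's class on a ball `Q(a)` with axisymmetric,
swirl-free slices — the swirl-free normal form of the blow-up limit
(`exists_smooth_noSwirl_repr_of_inBall`).

## References

* G. Seregin, Anal. Math. Phys. 10 (2020), Paper 46 = arXiv:2006.04140, proof of Thm. 2.1, last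
  paragraph (arXiv p. 8) with the structure of the singular set (p. 7). [Seregin2020]
* G. Seregin, W. Zajaczkowski, SIAM J. Math. Anal. 39 (2007) 669–685, §3. [SereginZajaczkowski2007]

Not carried from this source module (not needed by the declarations re-homed here; their consumers are Summits-side): `swirl_repr_eq_zero_of_ae`, `exists_smooth_noSwirl_repr_of_inBall`.
-/

section Part5

open _root_.MeasureTheory _root_.Set _root_.Function _root_.Filter _root_.Topology _root_.TopologicalSpace
  _root_.Metric
open scoped _root_.NNReal _root_.ENNReal

namespace Literature.Analysis.SereginLogSwirlOrigin.EulerScaling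

open Literature.Analysis.FluidPDE Literature.Analysis.FluidPDE.SereginZajaczkowski2007
  Literature.Analysis.FluidPDE.SereginSverak2009

/-- **On an open, rotation invariant set of regular points, an axisymmetric suitable weak
solution is a "sufficiently smooth axially symmetric solution".** Let `(u, p)` be a suitable
weak solution of the unforced Navier–Stokes system (`ν = 1`) on an open `Q ⊆ ℝ × ℝ³` with
axisymmetric slices at the times of `Q`, and let `S ⊆ Q` be open, invariant under
`(t, x) ↦ (t, R_θ x)`, and consist of regular points of `u`. Then `u` has a representative `V` on
`S` with `(V, p)` in the class `SereginZajaczkowski2007.IsSmoothAxisymmetricSolutionOn S`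
(suitable on `S`, axisymmetric at every point of `S`, slices `C^∞` at the points of `S`, all
spatial derivatives locally Hölder continuous in space–time). Same proof as the off-axis case:
local essential boundedness at regular points, `NSBoundedHigherRegularity_holds`, transport of
suitability and pointwise symmetry of the continuous representative.
[cite: Seregin2020, proof of Thm 2.1, structure of the singular set (arXiv p. 7)] -/
theorem exists_isSmoothAxisymmetricSolutionOn_of_regular
    {Q S : Opens (ℝ × EuclideanSpace ℝ (Fin 3))}
    {u : ℝ → EuclideanSpace ℝ (Fin 3) → EuclideanSpace ℝ (Fin 3)}
    {p : ℝ → EuclideanSpace ℝ (Fin 3) → ℝ}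
    (hsw : IsSuitableWeakSolutionOn Q 1 0 u p)
    (hax : ∀ z ∈ (Q : Set (ℝ × EuclideanSpace ℝ (Fin 3))), IsAxisymmetric (u z.1))
    (hSQ : S ≤ Q)
    (hSreg : ∀ z ∈ (S : Set (ℝ × EuclideanSpace ℝ (Fin 3))), IsRegularPoint u z)
    (hSrot : ∀ θ : ℝ, ∀ z ∈ (S : Set (ℝ × EuclideanSpace ℝ (Fin 3))),
      ((z.1, rotZ θ z.2) : ℝ × EuclideanSpace ℝ (Fin 3)) ∈
        (S : Set (ℝ × EuclideanSpace ℝ (Fin 3)))) :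
    ∃ V : ℝ → EuclideanSpace ℝ (Fin 3) → EuclideanSpace ℝ (Fin 3),
      IsSmoothAxisymmetricSolutionOn S V p ∧
        uncurry u =ᵐ[volume.restrict (S : Set (ℝ × EuclideanSpace ℝ (Fin 3)))] uncurry V := by
  have hSo : IsOpen (S : Set (ℝ × EuclideanSpace ℝ (Fin 3))) := S.isOpen
  have hsol : IsDistributionalNSSolutionOn S 1 0 u p := hsw.distributional.of_le hSQ
  -- regular points: `u` is locally essentially bounded on `S`
  have hbd : ∀ z ∈ (S : Set (ℝ × EuclideanSpace ℝ (Fin 3))), ∃ N ∈ 𝓝 z, ∃ M : ℝ,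
      ∀ᵐ w ∂(volume.restrict N), ‖u w.1 w.2‖ ≤ M := fun z hz =>
    exists_nhds_ae_norm_le_of_isRegularPoint (hSreg z hz)
  -- `p ∈ L^{3/2}` near every point (compact neighbourhoods inside `Q`)
  have hp : ∀ z ∈ (S : Set (ℝ × EuclideanSpace ℝ (Fin 3))), ∃ N ∈ 𝓝 z,
      ∫⁻ w in N, ‖p w.1 w.2‖ₑ ^ (3 / 2 : ℝ) < ∞ := by
    intro z hz
    obtain ⟨K, hKc, hzK, hKQ⟩ := exists_compact_subset Q.isOpen (hSQ hz)
    exact ⟨K, mem_interior_iff_mem_nhds.1 hzK, hsw.pressure K hKQ hKc⟩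
  obtain ⟨V, hae, hVc, hCD, hHol⟩ :=
    NSBoundedHigherRegularity_holds.exists_smooth_representative hsol hbd hp
  have hsuit : IsSuitableWeakSolutionOn S 1 0 V p :=
    (hsw.of_le hSQ).congr_ae hae (Eventually.of_forall fun _ => rfl)
  have haxi : IsAxisymmetricOn (S : Set (ℝ × EuclideanSpace ℝ (Fin 3))) V :=
    isAxisymmetricOn_of_ae_eq hSo hSrot (fun z hz θ => hax z (hSQ hz) θ z.2) hVc hae
  refine ⟨V, ⟨hsuit, haxi, hCD, fun n z hz => ?_⟩, hae⟩
  obtain ⟨N, hNo, hzN, -, C, α, hα, hHN⟩ := hHol n z hz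
  exact ⟨N, hNo.mem_nhds hzN, C, α, hα, hHN.mono inter_subset_left⟩

end Literature.Analysis.SereginLogSwirlOrigin.EulerScaling

end Part5

/-!
## Part 6 — port of `Summits/NavierStokesRegularity/NavierStokesRegularity/Theorems/AxisymmetricExtremalityAxisymmetricKatoGlobalStubSereginLogSwirlOriginCleanSlabRepr.lean` (5 declarations kept)

# Seregin 2022, §2 Step 1: the smooth axisymmetric representative on the clean slab below a first
# singular point, and uniform derivative bounds up to the top time at backward regular points —
# crux stmt-NavierStokesRegularity-15453 (`AxisymmetricExtremality.AxisymmetricKatoGlobal`), line registered, support for stub `stub_sereginLogSwirlOrigin`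

Support file (`--supports stmt-NavierStokesRegularity-15453`; theorems only, everything proved)
toward the registered stub `stub_sereginLogSwirlOrigin` = the named fact
`Literature.Analysis.FluidPDE.seregin2022_logSwirl_regularAtOrigin` (G. Seregin, J. Math. Fluid
Mech. 24 (2022), Paper 27 = arXiv:2201.00153, §2). Step 1 of the printed proof (arXiv p. 5)
uses: "According to the properties of regular points, there are cylinders `Q₁ = Q(z₁, δ)`,
`Q₂ = Q(z₂, δ)` … such that `v ∈ C([-δ², 0]; C³(𝒞̄((0, hᵢ), δ)))` at least", and Steps 2–3
(pp. 5–7) repeatedly use that "in the set `supp |∇η|`, functions `v`, `∇v`, and `∇²v` are bounded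
in space-time" / "our solution `v` has bounded spatial derivatives of any order in the support of
`∇η`". In the first-singular-time form of the argument (siblings `…FirstSingular`,
`…FinalReduction`: the reduction of the fact to the core on the configuration (C1)–(C2) around an
axis point `ẑ = (t̂, x̂)` at scale `R`) these two regularity inputs read:

* `exists_isSmoothAxisymmetricSolutionOn_cleanSlab` — (C1) (every point of the closed
  coordinate cylinder `{|x'| ≤ R, |x₃ - x̂₃| ≤ R}` at the times `t̂ - R² ≤ t < t̂` is a regular
  point) makes the open slab `Q(ẑ, R) = 𝒞(x̂, R) × ]t̂ - R², t̂[` an open, rotation invariant set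
  of regular points inside `Q`, so `v` has there a representative `V` with `(V, q)` a
  "sufficiently smooth axially symmetric solution" in the sense of Seregin–Zajaczkowski 2007
  (`exists_isSmoothAxisymmetricSolutionOn_of_regular`: suitable, axisymmetric at every point,
  slices `C^∞`, all spatial derivatives locally Hölder in space–time);
* `exists_iteratedFDeriv_bound_of_backwardRegular` — at a BACKWARD regular point `z`
  (`v ∈ L_∞(Q(z, r))`, e.g. the top-time points of (C2)) lying over an open set `O ⊆ Q` on which
  `v` has a continuous representative `V`, all spatial derivatives of `V` are bounded on a
  backward cylinder `Q(z, ρ) ⊆ O`, uniformly up to the top time `t_z` (the higher regularity of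
  bounded solutions, `NSBoundedHigherRegularity_holds`, gives a representative with Hölder
  derivatives on `Q̄(z, ρ)`; two continuous representatives agree on the open overlap);
* `exists_cleanSlab_repr` (registered sub-goal) — both combined for the configuration of
  `exists_firstSingular_configuration`: the representative `V` on `Q(ẑ, R)` and, at every point
  `a ∈ 𝒞(x̂, R)` with `(t̂, a)` backward regular, bounds `‖D_xⁿV‖ ≤ Cₙ` on some `Q((t̂, a), ρ)`.

## References

* G. Seregin, J. Math. Fluid Mech. 24 (2022), Paper No. 27 = arXiv:2201.00153, §2 Step 1 (arXiv
  p. 5), Step 2 (proof of Lemma 2.1, p. 6), Step 3 (p. 7). [`Seregin2022LocalAxisym`]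
* G. Seregin, W. Zajaczkowski, SIAM J. Math. Anal. 39 (2007) 669–685, §3. [`SereginZajaczkowski2007`]
* G. Seregin, V. Šverák, Comm. PDE 34 (2009) = arXiv:0804.1803, §2 p. 8 (higher regularity of
  bounded solutions). [`SereginSverak2009`]
-/

section Part6

open _root_.MeasureTheory _root_.Set _root_.Function _root_.Filter _root_.Topology _root_.TopologicalSpace
  _root_.Metric
open scoped _root_.NNReal _root_.ENNReal

namespace Literature.Analysis.SereginLogSwirlOrigin.EulerScaling

open Literature.Analysis.FluidPDE Literature.Analysis.FluidPDE.SereginZajaczkowski2007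
  Literature.Analysis.FluidPDE.SereginSverak2009

/-! ### Coordinate cylinders around axis points -/

/-- Around an axis point `c` the distance to the axis through `c` is the distance to the axis:
`|(x - c)'| = |x'|`. [folklore]
[cite: Seregin2022LocalAxisym, §2 proof of Thm. 1.2, Step 1 (arXiv:2201.00153 pp. 4–7) (source of the ARGUMENT this module implements; this declaration is the cell’s own lemma or plumbing, NOT a printed statement)] -/
theorem cylRadius_sub_of_cylRadius_eq_zero {c : EuclideanSpace ℝ (Fin 3)} (hc : cylRadius c = 0)
    (x : EuclideanSpace ℝ (Fin 3)) : cylRadius (x - c) = cylRadius x := by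
  obtain ⟨hc0, hc1⟩ := (cylRadius_eq_zero_iff c).1 hc
  simp [cylRadius, hc0, hc1]

/-- **The slab `Q(ẑ, R)` of the configuration lies in `Q = 𝒞 × ]-1, 0[`** for an axis point
`ẑ = (t̂, x̂)` with `-1/16 < t̂ ≤ 0`, `|x̂₃| ≤ 1/4` and `0 < R ≤ 1/4`. [folklore]
[cite: Seregin2022LocalAxisym, §2 proof of Thm. 1.2, Step 1 (arXiv:2201.00153 pp. 4–7) (source of the ARGUMENT this module implements; this declaration is the cell’s own lemma or plumbing, NOT a printed statement)] -/
theorem parCyl_subset_unitParCyl_of_config {zc : ℝ × EuclideanSpace ℝ (Fin 3)} {R : ℝ}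
    (ht : zc.1 ∈ Ioc (-1 / 16 : ℝ) 0) (hc : cylRadius zc.2 = 0) (hx : |zc.2 2| ≤ 1 / 4)
    (hR : 0 < R) (hR4 : R ≤ 1 / 4) :
    parCyl zc R ⊆ parCyl (0 : ℝ × EuclideanSpace ℝ (Fin 3)) 1 := by
  intro z hz
  rw [mem_parCyl, cylRadius_sub_of_cylRadius_eq_zero hc] at hz
  obtain ⟨⟨h1, h2⟩, h3, h4⟩ := hz
  rw [mem_parCyl_zero]
  have hR2 : R ^ 2 ≤ 1 / 16 := by nlinarith
  refine ⟨⟨by linarith [ht.1], by linarith [ht.2]⟩, by linarith, ?_⟩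
  have h5 : |z.2 2| ≤ |z.2 2 - zc.2 2| + |zc.2 2| := by
    simpa using abs_add_le (z.2 2 - zc.2 2) (zc.2 2)
  linarith

/-! ### The smooth axisymmetric representative on the clean slab -/

/-- **Seregin 2022, §2 Step 1: on the clean slab the solution is a "sufficiently smooth axially
symmetric solution".** Let `(v, q)` be a suitable weak solution in `Q = 𝒞 × ]-1, 0[` with
axisymmetric slices, `ẑ = (t̂, x̂)` an axis point with `-1/16 < t̂ ≤ 0`, `|x̂₃| ≤ 1/4`,
`0 < R ≤ 1/4`, and assume the clean past (C1): every `(t, x)` with `t̂ - R² ≤ t < t̂`,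
`|x'| ≤ R`, `|x₃ - x̂₃| ≤ R` is a regular point of `v`. Then on the open slab
`Q(ẑ, R) = 𝒞(x̂, R) × ]t̂ - R², t̂[` — open, inside `Q`, invariant under the rotations about the
axis, made of regular points — `v` has a representative `V` (`v = V` a.e. on `Q(ẑ, R)`) with
`(V, q)` in the Seregin–Zajaczkowski class `IsSmoothAxisymmetricSolutionOn (Q(ẑ, R)) V q`
(`exists_isSmoothAxisymmetricSolutionOn_of_regular`).
[cite: Seregin2022LocalAxisym, §2 Step 1 (arXiv:2201.00153 p. 5)] -/
theorem exists_isSmoothAxisymmetricSolutionOn_cleanSlab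
    {v : ℝ → EuclideanSpace ℝ (Fin 3) → EuclideanSpace ℝ (Fin 3)}
    {q : ℝ → EuclideanSpace ℝ (Fin 3) → ℝ}
    (hsw : IsSuitableWeakSolutionOn (parCylOpens 0 1) 1 0 v q)
    (hv_ax : ∀ t ∈ Ioo (-1 : ℝ) 0, IsAxisymmetric (v t))
    {zc : ℝ × EuclideanSpace ℝ (Fin 3)} {R : ℝ}
    (ht : zc.1 ∈ Ioc (-1 / 16 : ℝ) 0) (hc : cylRadius zc.2 = 0) (hx : |zc.2 2| ≤ 1 / 4)
    (hR : 0 < R) (hR4 : R ≤ 1 / 4)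
    (hC1 : ∀ z : ℝ × EuclideanSpace ℝ (Fin 3), zc.1 - R ^ 2 ≤ z.1 → z.1 < zc.1 →
      cylRadius z.2 ≤ R → |z.2 2 - zc.2 2| ≤ R → IsRegularPoint v z) :
    ∃ V : ℝ → EuclideanSpace ℝ (Fin 3) → EuclideanSpace ℝ (Fin 3),
      IsSmoothAxisymmetricSolutionOn (parCylOpens zc R) V q ∧
        uncurry v =ᵐ[volume.restrict (parCyl zc R)] uncurry V := by
  have hsub := parCyl_subset_unitParCyl_of_config ht hc hx hR hR4
  have hSQ : parCylOpens zc R ≤ parCylOpens (0 : ℝ × EuclideanSpace ℝ (Fin 3)) 1 :=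
    fun z hz => hsub hz
  -- slices are axisymmetric at the times of `Q`
  have hax : ∀ z ∈ ((parCylOpens 0 1 : Opens (ℝ × EuclideanSpace ℝ (Fin 3))) :
      Set (ℝ × EuclideanSpace ℝ (Fin 3))), IsAxisymmetric (v z.1) := by
    intro z hz
    rw [coe_parCylOpens, mem_parCyl_zero] at hz
    refine hv_ax z.1 ⟨?_, hz.1.2⟩
    have := hz.1.1
    norm_num at this
    exact this
  -- the slab consists of regular points
  have hSreg : ∀ z ∈ ((parCylOpens zc R : Opens (ℝ × EuclideanSpace ℝ (Fin 3))) :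
      Set (ℝ × EuclideanSpace ℝ (Fin 3))), IsRegularPoint v z := by
    intro z hz
    rw [coe_parCylOpens, mem_parCyl, cylRadius_sub_of_cylRadius_eq_zero hc] at hz
    exact hC1 z hz.1.1.le hz.1.2 hz.2.1.le hz.2.2.le
  -- the slab is rotation invariant
  have hSrot : ∀ θ : ℝ, ∀ z ∈ ((parCylOpens zc R : Opens (ℝ × EuclideanSpace ℝ (Fin 3))) :
      Set (ℝ × EuclideanSpace ℝ (Fin 3))),
      ((z.1, rotZ θ z.2) : ℝ × EuclideanSpace ℝ (Fin 3)) ∈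
        ((parCylOpens zc R : Opens (ℝ × EuclideanSpace ℝ (Fin 3))) :
          Set (ℝ × EuclideanSpace ℝ (Fin 3))) := by
    intro θ z hz
    rw [coe_parCylOpens, mem_parCyl, cylRadius_sub_of_cylRadius_eq_zero hc] at hz ⊢
    rw [cylRadius_rotZ, rotZ_apply_two]
    exact hz
  exact exists_isSmoothAxisymmetricSolutionOn_of_regular hsw hax hSQ hSreg hSrot

/-! ### Uniform derivative bounds up to the top time at backward regular points -/

/-- **Bounded spatial derivatives of every order up to the top time at a backward regular
point** ("according to the properties of regular points, there are cylinders `Q(zᵢ, δ)` … such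
that `v ∈ C([-δ², 0]; C³)` at least"; "`v`, `∇v`, and `∇²v` are bounded in space-time" on
`supp |∇η|`). Let `(v, q)` be a suitable weak solution in `Q = 𝒞 × ]-1, 0[` with
`q ∈ L_{3/2}(Q)`, `O ⊆ Q` open, `V` a continuous representative of `v` on `O`, and `z` a point
with `Q(z, r₀) ⊆ O` at which `v` is backward regular (`v ∈ L_∞(Q(z, r))` for some `r > 0`; the
top time `t_z = 0` is allowed). Then for some `ρ > 0` with `Q(z, ρ) ⊆ O`, every spatial
derivative `D_xⁿV` is bounded on `Q(z, ρ)`: the higher regularity of bounded solutions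
(`NSBoundedHigherRegularity_holds`) yields a representative with Hölder continuous derivatives
on `Q̄(z, ρ)`, which agrees with `V` on the open cylinder (both continuous, equal a.e.).
[cite: Seregin2022LocalAxisym, §2 Step 1 (arXiv:2201.00153 p. 5)] -/
theorem exists_iteratedFDeriv_bound_of_backwardRegular
    {v V : ℝ → EuclideanSpace ℝ (Fin 3) → EuclideanSpace ℝ (Fin 3)}
    {q : ℝ → EuclideanSpace ℝ (Fin 3) → ℝ}
    (hsw : IsSuitableWeakSolutionOn (parCylOpens 0 1) 1 0 v q)
    (hq : ∫⁻ z in parCyl (0 : ℝ × EuclideanSpace ℝ (Fin 3)) 1, ‖q z.1 z.2‖ₑ ^ (3 / 2 : ℝ) < ∞)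
    {O : Set (ℝ × EuclideanSpace ℝ (Fin 3))}
    (hOQ : O ⊆ parCyl (0 : ℝ × EuclideanSpace ℝ (Fin 3)) 1)
    (hVc : ContinuousOn (uncurry V) O) (hae : uncurry v =ᵐ[volume.restrict O] uncurry V)
    {z : ℝ × EuclideanSpace ℝ (Fin 3)} {r₀ : ℝ} (hr₀ : 0 < r₀) (hzO : parabolicCylinder r₀ z ⊆ O)
    (hreg : ∃ r > 0, eLpNorm (uncurry v) ∞ (volume.restrict (parabolicCylinder r z)) < ∞) :
    ∃ ρ > 0, parabolicCylinder ρ z ⊆ O ∧ ∀ n : ℕ, ∃ C : ℝ,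
      ∀ w ∈ parabolicCylinder ρ z, ‖iteratedFDeriv ℝ n (V w.1) w.2‖ ≤ C := by
  obtain ⟨r₁, hr₁, hfin₁⟩ := hreg
  -- a backward cylinder `Q(z, r) ⊆ O` on which `v` is essentially bounded
  set r : ℝ := min r₀ r₁ with hr_def
  have hr : 0 < r := lt_min hr₀ hr₁
  have hrO : parabolicCylinder r z ⊆ O :=
    (parabolicCylinder_mono hr.le (min_le_left _ _) z).trans hzO
  have hfin : eLpNorm (uncurry v) ∞ (volume.restrict (parabolicCylinder r z)) < ∞ :=
    (eLpNorm_mono_measure _ (Measure.restrict_mono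
      (parabolicCylinder_mono hr.le (min_le_right _ _) z) le_rfl)).trans_lt hfin₁
  -- the hypotheses of the higher-regularity theorem on `Q(z, r)`
  have hle : parabolicCylinderOpens r z ≤ parCylOpens (0 : ℝ × EuclideanSpace ℝ (Fin 3)) 1 :=
    fun w hw => hOQ (hrO hw)
  have hdist : IsDistributionalNSSolutionOn (parabolicCylinderOpens r z) 1 0 v q :=
    hsw.distributional.of_le hle
  have hbd : ∀ᵐ w ∂(volume.restrict (parabolicCylinder r z)),
      ‖v w.1 w.2‖ ≤ (eLpNorm (uncurry v) ∞ (volume.restrict (parabolicCylinder r z))).toReal := by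
    -- adapted from `exists_nhds_ae_norm_le_of_isRegularPoint`
    filter_upwards [ae_le_eLpNormEssSup (f := uncurry v)
      (μ := volume.restrict (parabolicCylinder r z))] with w hw
    rw [← eLpNorm_exponent_top] at hw
    calc ‖v w.1 w.2‖ = ‖uncurry v w‖ₑ.toReal := (toReal_enorm _).symm
      _ ≤ (eLpNorm (uncurry v) ∞ (volume.restrict (parabolicCylinder r z))).toReal :=
        ENNReal.toReal_mono hfin.ne hw
  have hp : ∫⁻ w in parabolicCylinder r z, ‖q w.1 w.2‖ₑ ^ (3 / 2 : ℝ) < ∞ :=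
    (lintegral_mono_set (hrO.trans hOQ)).trans_lt hq
  obtain ⟨W, haeW, -, hHol⟩ := NSBoundedHigherRegularity_holds v q z r _ hdist hbd hp
  -- the two representatives agree on `Q(z, r/2)`
  have hρr : r / 2 ∈ Ioo 0 r := ⟨by positivity, by linarith⟩
  have hsub2 : parabolicCylinder (r / 2) z ⊆ parabolicCylinder r z :=
    parabolicCylinder_mono (by positivity) (by linarith) z
  obtain ⟨C₀, α₀, hα₀, hH₀⟩ := hHol 0 (r / 2) hρr
  have hWc : ContinuousOn (uncurry W) (parabolicCylinder (r / 2) z) :=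
    continuousOn_uncurry_of_holderOnWith_zero hα₀ hH₀
  have h1 : uncurry v =ᵐ[volume.restrict (parabolicCylinder (r / 2) z)] uncurry V :=
    ae_restrict_of_ae_restrict_of_subset (hsub2.trans hrO) hae
  have h2 : uncurry v =ᵐ[volume.restrict (parabolicCylinder (r / 2) z)] uncurry W :=
    ae_restrict_of_ae_restrict_of_subset hsub2 haeW
  have hVW : uncurry V =ᵐ[volume.restrict (parabolicCylinder (r / 2) z)] uncurry W :=
    h1.symm.trans h2
  have hEq : EqOn (uncurry V) (uncurry W) (parabolicCylinder (r / 2) z) :=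
    Measure.eqOn_open_of_ae_eq hVW (isOpen_parabolicCylinder _ _)
      (hVc.mono (hsub2.trans hrO)) hWc
  -- bounds for `W` from the Hölder estimate, transferred to `V`
  refine ⟨r / 2, by positivity, hsub2.trans hrO, fun n => ?_⟩
  obtain ⟨C, α, -, hH⟩ := hHol n (r / 2) hρr
  set w₀ : ℝ × EuclideanSpace ℝ (Fin 3) := (z.1 - (r / 2) ^ 2 / 2, z.2) with hw₀
  have hw₀mem : w₀ ∈ parabolicCylinder (r / 2) z := by
    rw [mem_parabolicCylinder, hw₀, dist_self]
    refine ⟨⟨?_, ?_⟩, by positivity⟩ <;> simp only <;> nlinarith [pow_pos hr 2]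
  set D : ℝ := (r / 2) ^ 2 + r / 2 with hD
  refine ⟨‖iteratedFDeriv ℝ n (W w₀.1) w₀.2‖ + C * D ^ (α : ℝ), fun w hw => ?_⟩
  have hdist : dist w w₀ ≤ D := by
    rw [Prod.dist_eq, max_le_iff, Real.dist_eq]
    rw [mem_parabolicCylinder] at hw
    have h1 : w₀.1 = z.1 - (r / 2) ^ 2 / 2 := rfl
    have h2 : w₀.2 = z.2 := rfl
    rw [h1, h2]
    refine ⟨?_, by nlinarith [hw.2, sq_nonneg (r / 2)]⟩
    rw [abs_le]
    constructor <;> nlinarith [hw.1.1, hw.1.2]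
  have hH' := hH.dist_le_of_le hw hw₀mem hdist
  rw [dist_eq_norm] at hH'
  rw [iteratedFDeriv_slice_eq_of_eqOn (isOpen_parabolicCylinder _ _) hEq n hw]
  calc ‖iteratedFDeriv ℝ n (W w.1) w.2‖
      = ‖(iteratedFDeriv ℝ n (W w.1) w.2 - iteratedFDeriv ℝ n (W w₀.1) w₀.2) +
          iteratedFDeriv ℝ n (W w₀.1) w₀.2‖ := by rw [sub_add_cancel]
    _ ≤ ‖iteratedFDeriv ℝ n (W w.1) w.2 - iteratedFDeriv ℝ n (W w₀.1) w₀.2‖ +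
          ‖iteratedFDeriv ℝ n (W w₀.1) w₀.2‖ := norm_add_le _ _
    _ ≤ C * D ^ (α : ℝ) + ‖iteratedFDeriv ℝ n (W w₀.1) w₀.2‖ := by gcongr
    _ = ‖iteratedFDeriv ℝ n (W w₀.1) w₀.2‖ + C * D ^ (α : ℝ) := add_comm _ _

/-! ### The registered sub-goal: representative and top-time bounds on the configuration -/

/-- **Seregin 2022, §2 Step 1, the regularity inputs of Steps 2–4 on the clean configuration.**
For `(v, q)` in the Def.-1.1 class in `Q = 𝒞 × ]-1, 0[` (suitable weak solution, `q ∈ L_{3/2}(Q)`)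
with axisymmetric slices, an axis point `ẑ = (t̂, x̂)` (`-1/16 < t̂ ≤ 0`, `|x̂₃| ≤ 1/4`), a scale
`0 < R ≤ 1/4` and the clean past (C1), there is a representative `V` of `v` on the slab
`Q(ẑ, R)` with `(V, q)` a sufficiently smooth axially symmetric solution there
(Seregin–Zajaczkowski class), such that at every `a ∈ 𝒞(x̂, R)` with `(t̂, a)` backward regular
(the top-slice points of (C2): off the axis, or in the strips around the regular heights `h±`)
all spatial derivatives of `V` are bounded on a backward cylinder `Q((t̂, a), ρ) ⊆ Q(ẑ, R)`, up
to the top time: "`v`, `∇v`, `∇²v` [indeed derivatives of any order] are bounded in space-time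
in `supp |∇η|`". [cite: Seregin2022LocalAxisym, §2 Step 1 (arXiv:2201.00153 p. 5)] -/
theorem exists_cleanSlab_repr : ∀ (v : ℝ → EuclideanSpace ℝ (Fin 3) → EuclideanSpace ℝ (Fin 3)) (q : ℝ → EuclideanSpace ℝ (Fin 3) → ℝ), IsSuitableWeakSolutionOn (SereginSverak2009.parCylOpens 0 1) 1 0 v q → (∫⁻ z in SereginSverak2009.parCyl 0 1, ‖q z.1 z.2‖ₑ ^ (3 / 2 : ℝ) < ∞) → (∀ t ∈ Ioo (-1 : ℝ) 0, IsAxisymmetric (v t)) → ∀ (zc : ℝ × EuclideanSpace ℝ (Fin 3)) (R : ℝ), zc.1 ∈ Ioc (-1 / 16 : ℝ) 0 → cylRadius zc.2 = 0 → |zc.2 2| ≤ 1 / 4 → 0 < R → R ≤ 1 / 4 → (∀ z : ℝ × EuclideanSpace ℝ (Fin 3), zc.1 - R ^ 2 ≤ z.1 → z.1 < zc.1 → cylRadius z.2 ≤ R → |z.2 2 - zc.2 2| ≤ R → IsRegularPoint v z) → ∃ V : ℝ → EuclideanSpace ℝ (Fin 3) → EuclideanSpace ℝ (Fin 3), SereginZajaczkowski2007.IsSmoothAxisymmetricSolutionOn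 (SereginSverak2009.parCylOpens zc R) V q ∧ uncurry v =ᵐ[volume.restrict (SereginSverak2009.parCyl zc R)] uncurry V ∧ ∀ a ∈ SereginSverak2009.spaceCyl zc.2 R, (∃ r > 0, eLpNorm (uncurry v) ∞ (volume.restrict (parabolicCylinder r ((zc.1, a) : ℝ × EuclideanSpace ℝ (Fin 3)))) < ∞) → ∃ ρ > 0, parabolicCylinder ρ ((zc.1, a) : ℝ × EuclideanSpace ℝ (Fin 3)) ⊆ SereginSverak2009.parCyl zc R ∧ ∀ n : ℕ, ∃ C : ℝ, ∀ w ∈ parabolicCylinder ρ ((zc.1, a) : ℝ × EuclideanSpace ℝ (Fin 3)), ‖iteratedFDeriv ℝ n (V w.1) w.2‖ ≤ C := by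
  intro v q hsw hq hv_ax zc R ht hc hx hR hR4 hC1
  obtain ⟨V, hV, hae⟩ := exists_isSmoothAxisymmetricSolutionOn_cleanSlab hsw hv_ax ht hc hx hR hR4 hC1
  refine ⟨V, hV, hae, fun a ha hreg => ?_⟩
  -- a backward cylinder at `(t̂, a)` inside the slab
  obtain ⟨ε, hε, hεsub⟩ := Metric.isOpen_iff.1 (isOpen_spaceCyl zc.2 R) a ha
  set r₀ : ℝ := min ε R with hr₀
  have hr₀pos : 0 < r₀ := lt_min hε hR
  have hzO : parabolicCylinder r₀ ((zc.1, a) : ℝ × EuclideanSpace ℝ (Fin 3)) ⊆ parCyl zc R := by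
    intro w hw
    rw [mem_parabolicCylinder] at hw
    have h1 : r₀ ^ 2 ≤ R ^ 2 := pow_le_pow_left₀ hr₀pos.le (min_le_right _ _) 2
    exact ⟨⟨by simp only at hw; linarith [hw.1.1], hw.1.2⟩,
      hεsub (mem_ball.2 (hw.2.trans_le (min_le_left _ _)))⟩
  exact exists_iteratedFDeriv_bound_of_backwardRegular hsw hq
    (parCyl_subset_unitParCyl_of_config ht hc hx hR hR4) hV.continuousOn_velocity hae hr₀pos
    hzO hreg

end Literature.Analysis.SereginLogSwirlOrigin.EulerScaling

end Part6

/-!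
## Part 7 — port of `Summits/NavierStokesRegularity/NavierStokesRegularity/Theorems/AxisymmetricExtremalityAxisymmetricKatoGlobalStubSereginLogSwirlOriginCoreNormaliseTransport.lean` (15 declarations kept)

# Seregin 2022, §2: the hypothesis block (H) of the criterion and the clean-slab data under the
# Navier–Stokes scaling about an axis point of the configuration —
# crux stmt-NavierStokesRegularity-15453 (`AxisymmetricExtremality.AxisymmetricKatoGlobal`), line registered, support for stub `stub_sereginLogSwirlOrigin`

Support file (`--supports stmt-NavierStokesRegularity-15453`; theorems only, everything proved)
toward the registered stub `stub_sereginLogSwirlOrigin` = the named fact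
`Literature.Analysis.FluidPDE.seregin2022_logSwirl_regularAtOrigin` (G. Seregin, J. Math. Fluid
Mech. 24 (2022), Paper 27 = arXiv:2201.00153, §2).  Second of three files normalising the
classical core of the fact (hypothesis `core` of `seregin2022_logSwirl_regularAtOrigin_of_cleanRepr`,
sibling `…FinalReduction`) to the origin at unit scale (sibling `…CoreNormaliseRescale` has the
covariance of the single ingredients, `…CoreNormalise` the normalisation itself).

For a configuration of the core — an axis point `ẑ = (t̂, b e₃)` with `-1/16 < t̂ ≤ 0`,
`|b| ≤ 1/4`, a scale `0 < R ≤ 1/4` (so `Q(ẑ, R) ⊆ Q = 𝒞 × ]-1, 0[`, `parCyl_config_subset`),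
heights `h±` and a width `δ` — and the zoom `Φ(s, y) = (t̂ + R² s, b e₃ + R y)`,
`v_R = R v ∘ Φ`, `q_R = R² q ∘ Φ` (`R • stPull (R²) R t̂ (b • eZ) v`), this file transports:

* the hypothesis block (H) of the fact from `(v, q)` on `Q` to `(v_R, q_R)` on `Q = Φ⁻¹(Q(ẑ, R))`:
  `suitable_axisZoom` (H1, accepted `IsSuitableWeakSolutionOn.stRescale`), `energyClass_axisZoom`
  (H2, `sup_s ∫_𝒞 |v_R|² ≤ R⁻¹ sup_t ∫_𝒞 |v|²`), `gradClass_axisZoom` (H3, `∇v_R = R² ∇v ∘ Φ`),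
  `pressureClass_axisZoom` (H4), `isAxisymmetric_axisZoom`, `isAxisymmetricScalar_axisZoom` (H5–H6,
  `b e₃` is fixed by the rotations), `swirlBound_axisZoom` (H7 = (2.2), registered; the swirl is
  scale invariant and the logarithmic weight monotone, constant `max(C₁, 0)`);
* the clean-slab data: `aeEq_axisZoom` (`v = V` a.e. on `Q(ẑ, R)` ⇒ `v_R = V_R` a.e. on `Q`),
  `heights_axisZoom` (`h± ↦ (h± - b)/R`, `δ ↦ δ/R`), `derivBounds_axisZoom` (the bounds
  `‖D_xⁿV‖ ≤ Cₙ` on `Q_ρ(t̂, a₀) ⊆ Q(ẑ, R)` at the top-slice points `a₀` off the axis or in the two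
  strips become `‖D_yⁿV_R‖ ≤ R^{n+1} Cₙ` on `Q_{ρ/R}(0, a) ⊆ Q`, `a₀ = b e₃ + R a`).

## References

* G. Seregin, J. Math. Fluid Mech. 24 (2022), Paper No. 27 = arXiv:2201.00153, §2, Def. 1.1 and
  (2.2) (arXiv p. 5). [`Seregin2022LocalAxisym`]
* L. Caffarelli, R. Kohn, L. Nirenberg, Comm. Pure Appl. Math. 35 (1982), §2 (scaling of the
  classes of a suitable weak solution). [`CaffarelliKohnNirenberg1982`]
-/

section Part7

open _root_.MeasureTheory _root_.Set _root_.Function _root_.Filter _root_.Topology _root_.TopologicalSpace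
  _root_.Metric
open scoped _root_.NNReal _root_.ENNReal

namespace Literature.Analysis.SereginLogSwirlOrigin.EulerScaling

open Literature.Analysis.FluidPDE Literature.Analysis.FluidPDE.SereginZajaczkowski2007
  Literature.Analysis.FluidPDE.SereginSverak2009

/-! ### The hypothesis block (H) of the fact under the zoom about an axis point of the configuration -/

section Transport

variable {v : ℝ → EuclideanSpace ℝ (Fin 3) → EuclideanSpace ℝ (Fin 3)} {q : ℝ → EuclideanSpace ℝ (Fin 3) → ℝ}
  {t₀ b R : ℝ}

/-- The slab `Q(ẑ, R)` of a configuration (`-1/16 < t̂ ≤ 0`, `|b| ≤ 1/4`, `0 < R ≤ 1/4`,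
`ẑ = (t̂, b e₃)`) lies in `Q = 𝒞 × ]-1, 0[`. [folklore]
[cite: Seregin2022LocalAxisym, §2 proof of Thm. 1.2 (arXiv:2201.00153 pp. 4–7) (source of the ARGUMENT this module implements; this declaration is the cell’s own lemma or plumbing, NOT a printed statement)] -/
theorem parCyl_config_subset (ht₀ : t₀ ∈ Ioc (-1 / 16 : ℝ) 0) (hb : |b| ≤ 1 / 4) (hR : 0 < R)
    (hR4 : R ≤ 1 / 4) :
    parCyl ((t₀, b • eZ) : ℝ × EuclideanSpace ℝ (Fin 3)) R ⊆ parCyl (0 : ℝ × EuclideanSpace ℝ (Fin 3)) 1 :=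
  parCyl_subset_unitParCyl_of_config (zc := ((t₀, b • eZ) : ℝ × EuclideanSpace ℝ (Fin 3))) ht₀
    (by simpa using cylRadius_axisAffine le_rfl b (0 : EuclideanSpace ℝ (Fin 3)))
    (by simpa [smul_eZ_apply_two] using hb) hR hR4

/-- The cylinder `𝒞(b e₃, R)` of a configuration lies in `𝒞 = 𝒞(0, 1)`. [folklore]
[cite: Seregin2022LocalAxisym, §2 proof of Thm. 1.2 (arXiv:2201.00153 pp. 4–7) (source of the ARGUMENT this module implements; this declaration is the cell’s own lemma or plumbing, NOT a printed statement)] -/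
theorem spaceCyl_config_subset (hb : |b| ≤ 1 / 4) (hR4 : R ≤ 1 / 4) :
    spaceCyl (b • eZ) R ⊆ spaceCyl (0 : EuclideanSpace ℝ (Fin 3)) 1 := by
  intro x hx
  rw [mem_spaceCyl, SereginSverak2009.cylRadius_sub_smul_eZ, smul_eZ_apply_two] at hx
  rw [mem_spaceCyl_zero_iff]
  refine ⟨by linarith [hx.1], ?_⟩
  calc |x 2| = |x 2 - b + b| := by rw [sub_add_cancel]
    _ ≤ |x 2 - b| + |b| := abs_add_le _ _
    _ < 1 := by linarith [hx.2]

/-- The times of `Q(0, 1)` are mapped into `]-1, 0[` by `s ↦ t̂ + R² s`. [folklore]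
[cite: Seregin2022LocalAxisym, §2 proof of Thm. 1.2 (arXiv:2201.00153 pp. 4–7) (source of the ARGUMENT this module implements; this declaration is the cell’s own lemma or plumbing, NOT a printed statement)] -/
theorem axisZoom_time_mem (ht₀ : t₀ ∈ Ioc (-1 / 16 : ℝ) 0) (hR : 0 < R) (hR4 : R ≤ 1 / 4) {s : ℝ}
    (hs : s ∈ Ioo (-1 : ℝ) 0) : t₀ + R ^ 2 * s ∈ Ioo (-1 : ℝ) 0 := by
  have hR2 : R ^ 2 ≤ 1 / 16 := by nlinarith
  have h1 : -(R ^ 2) < R ^ 2 * s := by nlinarith [hs.1, sq_pos_of_pos hR]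
  have h2 : R ^ 2 * s < 0 := mul_neg_of_pos_of_neg (sq_pos_of_pos hR) hs.2
  exact ⟨by linarith [ht₀.1], by linarith [ht₀.2]⟩

/-- The space zoom `y ↦ b e₃ + R y` maps `𝒞` into `𝒞` (`|b| ≤ 1/4`, `0 < R ≤ 1/4`). [folklore]
[cite: Seregin2022LocalAxisym, §2 proof of Thm. 1.2 (arXiv:2201.00153 pp. 4–7) (source of the ARGUMENT this module implements; this declaration is the cell’s own lemma or plumbing, NOT a printed statement)] -/
theorem axisZoom_space_mem (hb : |b| ≤ 1 / 4) (hR : 0 < R) (hR4 : R ≤ 1 / 4)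
    {y : EuclideanSpace ℝ (Fin 3)} (hy : y ∈ spaceCyl (0 : EuclideanSpace ℝ (Fin 3)) 1) :
    b • eZ + R • y ∈ spaceCyl (0 : EuclideanSpace ℝ (Fin 3)) 1 := by
  rw [mem_spaceCyl_zero_iff] at hy ⊢
  rw [cylRadius_axisAffine hR.le, smul_eZ_add_smul_apply_two]
  have h1 : R * cylRadius y < 1 := by nlinarith [hy.1, cylRadius_nonneg y]
  refine ⟨h1, ?_⟩
  have h2 : |R * y 2| < 1 / 4 := by
    rw [abs_mul, abs_of_pos hR]; nlinarith [hy.2, abs_nonneg (y 2)]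
  calc |b + R * y 2| ≤ |b| + |R * y 2| := abs_add_le _ _
    _ < 1 := by linarith

/-- **(H1) under the zoom**: the rescaled pair is a suitable weak solution of the unit-viscosity
system in `Q(0, 1) = Φ⁻¹(Q(ẑ, R))` (accepted `IsSuitableWeakSolutionOn.stRescale`, restriction to
`Q(ẑ, R) ⊆ Q`). [cite: CaffarelliKohnNirenberg1982, §2 (scaling)] -/
theorem suitable_axisZoom (hsw : IsSuitableWeakSolutionOn (parCylOpens 0 1) 1 0 v q)
    (ht₀ : t₀ ∈ Ioc (-1 / 16 : ℝ) 0) (hb : |b| ≤ 1 / 4) (hR : 0 < R) (hR4 : R ≤ 1 / 4) :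
    IsSuitableWeakSolutionOn (parCylOpens 0 1) 1 0 (R • stPull (R ^ 2) R t₀ (b • eZ) v)
      (R ^ 2 • stPull (R ^ 2) R t₀ (b • eZ) q) := by
  have hdom : parCylOpens ((t₀, b • eZ) : ℝ × EuclideanSpace ℝ (Fin 3)) R ≤
      parCylOpens (0 : ℝ × EuclideanSpace ℝ (Fin 3)) 1 := fun z hz => parCyl_config_subset ht₀ hb hR hR4 hz
  have h0 := (hsw.of_le hdom).stRescale hR hR (by ring : R ^ 2 = R * R) t₀ (b • eZ)
  have hvisc : R * 1 / R = 1 := by field_simp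
  have hforce : ((R ^ 2 * R) • stPull (R ^ 2) R t₀ (b • eZ)
      (0 : ℝ → EuclideanSpace ℝ (Fin 3) → EuclideanSpace ℝ (Fin 3))) = 0 := by
    funext s y; simp [stPull]
  rwa [hvisc, hforce, parCylOpens_axisZoom hR] at h0

/-- **(H2) under the zoom**: `v_R ∈ L_{2,∞}(Q)` with `sup ∫_𝒞 |v_R|² ≤ R⁻¹ sup ∫_𝒞 |v|²`
(`∫_𝒞 |R v(t, b e₃ + R y)|² dy = R² R⁻³ ∫_{𝒞(b e₃, R)} |v(t, x)|² dx`). [folklore]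
[cite: Seregin2022LocalAxisym, §2 proof of Thm. 1.2 (arXiv:2201.00153 pp. 4–7) (source of the ARGUMENT this module implements; this declaration is the cell’s own lemma or plumbing, NOT a printed statement)] -/
theorem energyClass_axisZoom
    (hA : ∃ C : ℝ≥0, ∀ᵐ t ∂(volume.restrict (Ioo (-1 : ℝ) 0)),
      ∫⁻ x in spaceCyl 0 1, ‖v t x‖ₑ ^ 2 ≤ C)
    (ht₀ : t₀ ∈ Ioc (-1 / 16 : ℝ) 0) (hb : |b| ≤ 1 / 4) (hR : 0 < R) (hR4 : R ≤ 1 / 4) :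
    ∃ C : ℝ≥0, ∀ᵐ s ∂(volume.restrict (Ioo (-1 : ℝ) 0)),
      ∫⁻ y in spaceCyl 0 1, ‖(R • stPull (R ^ 2) R t₀ (b • eZ) v) s y‖ₑ ^ 2 ≤ C := by
  obtain ⟨C, hC⟩ := hA
  have hsubT : Ioo (t₀ + R ^ 2 * (-1)) (t₀ + R ^ 2 * 0) ⊆ Ioo (-1 : ℝ) 0 := by
    intro t ht
    have hR2 : R ^ 2 ≤ 1 / 16 := by nlinarith
    exact ⟨by linarith [ht.1, ht₀.1], by linarith [ht.2, ht₀.2]⟩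
  have h2 := ae_restrict_Ioo_comp_time_affine (sq_pos_of_pos hR) t₀ (-1) 0
    (ae_restrict_of_ae_restrict_of_subset hsubT hC)
  have hsubS : spaceCyl (b • eZ) (R * 1) ⊆ spaceCyl (0 : EuclideanSpace ℝ (Fin 3)) 1 := by
    rw [mul_one]; exact spaceCyl_config_subset hb hR4
  have hC'top : (‖R‖ₑ ^ 2 * (ENNReal.ofReal (R ^ 3)⁻¹ * C) : ℝ≥0∞) ≠ ∞ :=
    ENNReal.mul_ne_top (by simp) (ENNReal.mul_ne_top ENNReal.ofReal_ne_top ENNReal.coe_ne_top)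
  refine ⟨(‖R‖ₑ ^ 2 * (ENNReal.ofReal (R ^ 3)⁻¹ * C)).toNNReal, ?_⟩
  rw [ENNReal.coe_toNNReal hC'top]
  filter_upwards [h2] with s hs
  have e : ∀ y : EuclideanSpace ℝ (Fin 3), ‖(R • stPull (R ^ 2) R t₀ (b • eZ) v) s y‖ₑ ^ 2 =
      ‖R‖ₑ ^ 2 * ‖v (t₀ + R ^ 2 * s) (b • eZ + R • y)‖ₑ ^ 2 := by
    intro y
    rw [smul_stPull_apply, enorm_smul, mul_pow]
  simp_rw [e]
  rw [lintegral_const_mul' _ _ (by simp), ← preimage_spaceCyl_axisAffine hR b 1,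
    setLIntegral_preimage_comp_space_affine hR (b • eZ) (fun x => ‖v (t₀ + R ^ 2 * s) x‖ₑ ^ 2)
      (spaceCyl (b • eZ) (R * 1)), finrank_euclideanSpace_fin]
  gcongr
  exact (lintegral_mono_set hsubS).trans hs

/-- **(H3) under the zoom**: `∇v_R = R² (∇v) ∘ Φ ∈ L₂(Q)` is a weak spatial gradient of `v_R`
(accepted `HasWeakSpatialGradientOn.stRescale`, `∫_Q |∇v_R|² = R⁴ R⁻⁵ ∫_{Q(ẑ,R)} |∇v|²`). [folklore]
[cite: Seregin2022LocalAxisym, §2 proof of Thm. 1.2 (arXiv:2201.00153 pp. 4–7) (source of the ARGUMENT this module implements; this declaration is the cell’s own lemma or plumbing, NOT a printed statement)] -/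
theorem gradClass_axisZoom
    (hG : ∃ G : ℝ → EuclideanSpace ℝ (Fin 3) → EuclideanSpace ℝ (Fin 3) →L[ℝ] EuclideanSpace ℝ (Fin 3),
      HasWeakSpatialGradientOn (parCylOpens 0 1) v G ∧
        ∫⁻ z in parCyl 0 1, ENNReal.ofReal (frobeniusNormSq (G z.1 z.2)) < ∞)
    (ht₀ : t₀ ∈ Ioc (-1 / 16 : ℝ) 0) (hb : |b| ≤ 1 / 4) (hR : 0 < R) (hR4 : R ≤ 1 / 4) :
    ∃ G : ℝ → EuclideanSpace ℝ (Fin 3) → EuclideanSpace ℝ (Fin 3) →L[ℝ] EuclideanSpace ℝ (Fin 3),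
      HasWeakSpatialGradientOn (parCylOpens 0 1) (R • stPull (R ^ 2) R t₀ (b • eZ) v) G ∧
        ∫⁻ z in parCyl 0 1, ENNReal.ofReal (frobeniusNormSq (G z.1 z.2)) < ∞ := by
  obtain ⟨G, hG, hfin⟩ := hG
  have hsub := parCyl_config_subset ht₀ hb hR hR4
  have hdom : parCylOpens ((t₀, b • eZ) : ℝ × EuclideanSpace ℝ (Fin 3)) R ≤
      parCylOpens (0 : ℝ × EuclideanSpace ℝ (Fin 3)) 1 := fun z hz => hsub hz
  refine ⟨(R * R) • stPull (R ^ 2) R t₀ (b • eZ) G, ?_, ?_⟩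
  · have h := (hG.mono hdom).stRescale R (sq_pos_of_pos hR) hR t₀ (b • eZ)
    rwa [parCylOpens_axisZoom hR] at h
  · rw [← stAffine_preimage_parCyl_self hR t₀ (b • eZ),
      setLIntegral_frobeniusNormSq_stRescale (sq_pos_of_pos hR) hR, finrank_euclideanSpace_fin]
    exact ENNReal.mul_lt_top (ENNReal.mul_lt_top ENNReal.ofReal_lt_top ENNReal.ofReal_lt_top)
      ((lintegral_mono_set hsub).trans_lt hfin)

/-- **(H4) under the zoom**: `q_R = R² q ∘ Φ ∈ L_{3/2}(Q)` (`∫_Q |q_R|^{3/2} = R³ R⁻⁵ ∫_{Q(ẑ,R)} |q|^{3/2}`).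
[folklore]
[cite: Seregin2022LocalAxisym, §2 proof of Thm. 1.2 (arXiv:2201.00153 pp. 4–7) (source of the ARGUMENT this module implements; this declaration is the cell’s own lemma or plumbing, NOT a printed statement)] -/
theorem pressureClass_axisZoom
    (hq : ∫⁻ z in parCyl 0 1, ‖q z.1 z.2‖ₑ ^ (3 / 2 : ℝ) < ∞)
    (ht₀ : t₀ ∈ Ioc (-1 / 16 : ℝ) 0) (hb : |b| ≤ 1 / 4) (hR : 0 < R) (hR4 : R ≤ 1 / 4) :
    ∫⁻ z in parCyl 0 1, ‖(R ^ 2 • stPull (R ^ 2) R t₀ (b • eZ) q) z.1 z.2‖ₑ ^ (3 / 2 : ℝ) < ∞ := by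
  have hsub := parCyl_config_subset ht₀ hb hR hR4
  rw [← stAffine_preimage_parCyl_self hR t₀ (b • eZ),
    setLIntegral_enorm_rpow_stRescale (sq_pos_of_pos hR) hR t₀ (b • eZ) (R ^ 2) q _
      (by norm_num : (0 : ℝ) ≤ 3 / 2), finrank_euclideanSpace_fin]
  refine ENNReal.mul_lt_top (ENNReal.mul_lt_top
    (ENNReal.rpow_lt_top_of_nonneg (by norm_num) enorm_ne_top) ENNReal.ofReal_lt_top) ?_
  exact (lintegral_mono_set hsub).trans_lt hq

/-- **(H5) under the zoom**: the rescaled slices are axisymmetric (`b e₃` is fixed by the linear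
rotations about the axis, accepted `isAxisymmetric_rescale`). [folklore]
[cite: Seregin2022LocalAxisym, §2 proof of Thm. 1.2 (arXiv:2201.00153 pp. 4–7) (source of the ARGUMENT this module implements; this declaration is the cell’s own lemma or plumbing, NOT a printed statement)] -/
theorem isAxisymmetric_axisZoom (hv_ax : ∀ t ∈ Ioo (-1 : ℝ) 0, IsAxisymmetric (v t))
    (ht₀ : t₀ ∈ Ioc (-1 / 16 : ℝ) 0) (hR : 0 < R) (hR4 : R ≤ 1 / 4) :
    ∀ s ∈ Ioo (-1 : ℝ) 0, IsAxisymmetric ((R • stPull (R ^ 2) R t₀ (b • eZ) v) s) :=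
  fun _ hs => isAxisymmetric_rescale (hv_ax _ (axisZoom_time_mem ht₀ hR hR4 hs)) R b R

/-- **(H6) under the zoom**: the rescaled pressure slices are axisymmetric scalars. [folklore]
[cite: Seregin2022LocalAxisym, §2 proof of Thm. 1.2 (arXiv:2201.00153 pp. 4–7) (source of the ARGUMENT this module implements; this declaration is the cell’s own lemma or plumbing, NOT a printed statement)] -/
theorem isAxisymmetricScalar_axisZoom (hq_ax : ∀ t ∈ Ioo (-1 : ℝ) 0, IsAxisymmetricScalar (q t))
    (ht₀ : t₀ ∈ Ioc (-1 / 16 : ℝ) 0) (hR : 0 < R) (hR4 : R ≤ 1 / 4) :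
    ∀ s ∈ Ioo (-1 : ℝ) 0, IsAxisymmetricScalar ((R ^ 2 • stPull (R ^ 2) R t₀ (b • eZ) q) s) := by
  intro s hs θ y
  show R ^ 2 • q (t₀ + R ^ 2 * s) (b • eZ + R • rotZ θ y) = R ^ 2 • q (t₀ + R ^ 2 * s) (b • eZ + R • y)
  rw [← rotZ_smul_eZ_add_smul, hq_ax _ (axisZoom_time_mem ht₀ hR hR4 hs) θ]

/-- **(H7) = (2.2) under the zoom**: the swirl bound of the fact for `v` on `Q` gives the swirl
bound for `v_R = R v ∘ Φ` on `Q` with constant `max(C₁, 0)` — the swirl `σ = ϱ v_φ` is invariant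
under the scaling about an axis point and the weight `ln⁻³(e/ϱ)` is monotone
(`abs_swirl_axisZoom_le`; `Φ` maps `Q` into `Q(ẑ, R) ⊆ Q`).
[cite: Seregin2022LocalAxisym, (2.2) (arXiv:2201.00153 p. 5)] -/
theorem swirlBound_axisZoom : ∀ (v : ℝ → EuclideanSpace ℝ (Fin 3) → EuclideanSpace ℝ (Fin 3)) (t₀ b R : ℝ), t₀ ∈ Ioc (-1 / 16 : ℝ) 0 → |b| ≤ 1 / 4 → 0 < R → R ≤ 1 / 4 → (∃ C₁ : ℝ, ∀ t ∈ Ioo (-1 : ℝ) 0, ∀ x ∈ SereginSverak2009.spaceCyl 0 1, 0 < cylRadius x → |swirl (v t) x| ≤ C₁ / Real.log (Real.exp 1 / cylRadius x) ^ 3) → ∃ C₁ : ℝ, 0 ≤ C₁ ∧ ∀ s ∈ Ioo (-1 : ℝ) 0, ∀ y ∈ SereginSverak2009.spaceCyl 0 1, 0 < cylRadius y → |swirl ((R • stPull (R ^ 2) R t₀ (b • eZ) v) s) y| ≤ C₁ / Real.log (Real.exp 1 / cylRadius y) ^ 3 := by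
  intro v t₀ b R ht₀ hb hR hR4 hσ
  obtain ⟨C₁, hC₁⟩ := hσ
  refine ⟨max C₁ 0, le_max_right _ _, fun s hs y hy hy0 => ?_⟩
  have hy1 : cylRadius y < 1 := (mem_spaceCyl_zero_iff.1 hy).1
  have hx : b • eZ + R • y ∈ spaceCyl (0 : EuclideanSpace ℝ (Fin 3)) 1 := axisZoom_space_mem hb hR hR4 hy
  have hx0 : 0 < cylRadius (b • eZ + R • y) := by
    rw [cylRadius_axisAffine hR.le]; positivity
  exact abs_swirl_axisZoom_le hR (by linarith) hy0 hy1
    (hC₁ _ (axisZoom_time_mem ht₀ hR hR4 hs) _ hx hx0)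

/-- **`v = V` a.e. on `Q(ẑ, R)` becomes `v_R = V_R` a.e. on `Q(0, 1)`** (the zoom is a
measure-scaling bijection, accepted `ae_eq_restrict_comp_stAffine`). [folklore]
[cite: Seregin2022LocalAxisym, §2 proof of Thm. 1.2 (arXiv:2201.00153 pp. 4–7) (source of the ARGUMENT this module implements; this declaration is the cell’s own lemma or plumbing, NOT a printed statement)] -/
theorem aeEq_axisZoom {V : ℝ → EuclideanSpace ℝ (Fin 3) → EuclideanSpace ℝ (Fin 3)} (hR : 0 < R)
    (hae : uncurry v =ᵐ[volume.restrict (parCyl ((t₀, b • eZ) : ℝ × EuclideanSpace ℝ (Fin 3)) R)] uncurry V) :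
    uncurry (R • stPull (R ^ 2) R t₀ (b • eZ) v) =ᵐ[volume.restrict (parCyl (0 : ℝ × EuclideanSpace ℝ (Fin 3)) 1)]
      uncurry (R • stPull (R ^ 2) R t₀ (b • eZ) V) := by
  have h := ae_eq_restrict_comp_stAffine (sq_pos_of_pos hR) hR t₀ (b • eZ) hae
  rw [stAffine_preimage_parCyl_self hR] at h
  filter_upwards [h] with z hz
  rcases z with ⟨s, y⟩
  have hz' : v (t₀ + R ^ 2 * s) (b • eZ + R • y) = V (t₀ + R ^ 2 * s) (b • eZ + R • y) := hz
  show R • v (t₀ + R ^ 2 * s) (b • eZ + R • y) = R • V (t₀ + R ^ 2 * s) (b • eZ + R • y)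
  rw [hz']

/-- The heights and the width of the configuration under the zoom: `h± ↦ (h± - b)/R`, `δ ↦ δ/R`.
[folklore]
[cite: Seregin2022LocalAxisym, §2 proof of Thm. 1.2 (arXiv:2201.00153 pp. 4–7) (source of the ARGUMENT this module implements; this declaration is the cell’s own lemma or plumbing, NOT a printed statement)] -/
theorem heights_axisZoom {hp hm δ : ℝ} (hR : 0 < R) (hδ : 0 < δ) (h1 : b - R ≤ hm - δ)
    (h2 : hm + δ < b) (h3 : b < hp - δ) (h4 : hp + δ ≤ b + R) :
    0 < δ / R ∧ -1 ≤ (hm - b) / R - δ / R ∧ (hm - b) / R + δ / R < 0 ∧ 0 < (hp - b) / R - δ / R ∧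
      (hp - b) / R + δ / R ≤ 1 := by
  refine ⟨div_pos hδ hR, ?_, ?_, ?_, ?_⟩
  · rw [← sub_div, le_div_iff₀ hR]; linarith
  · rw [← add_div, div_lt_iff₀ hR]; linarith
  · rw [← sub_div, lt_div_iff₀ hR]; linarith
  · rw [← add_div, div_le_iff₀ hR]; linarith

/-- `|b + R a₃ - h| < δ` iff `|a₃ - (h - b)/R| < δ/R` (`R > 0`). [folklore]
[cite: Seregin2022LocalAxisym, §2 proof of Thm. 1.2 (arXiv:2201.00153 pp. 4–7) (source of the ARGUMENT this module implements; this declaration is the cell’s own lemma or plumbing, NOT a printed statement)] -/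
theorem abs_sub_height_lt_iff {a h δ : ℝ} (hR : 0 < R) :
    |a - (h - b) / R| < δ / R ↔ |b + R * a - h| < δ := by
  have e : a - (h - b) / R = (b + R * a - h) / R := by field_simp; ring
  rw [e, abs_div, abs_of_pos hR, div_lt_div_iff_of_pos_right hR]

open scoped _root_.ContDiff in
/-- **The derivative bounds up to the top time under the zoom.** If at every top-slice point
`a₀ ∈ 𝒞(b e₃, R)` off the axis or of height within `δ` of `h₊` or `h₋` the derivatives `D_xⁿV` are
bounded on some `Q_ρ(t̂, a₀) ⊆ Q(ẑ, R)`, then at every `a ∈ 𝒞` off the axis or of height within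
`δ/R` of `(h± - b)/R` the derivatives of `V_R = R V ∘ Φ` are bounded on `Q_{ρ/R}(0, a) ⊆ Q(0, 1)`
(`a₀ = b e₃ + R a`, `D_yⁿV_R = R (DⁿV ∘ Φ) ∘ (R id)^{⊗n}`, `‖D_yⁿV_R‖ ≤ R^{n+1} Cₙ`).
[cite: Seregin2022LocalAxisym, §2 Step 1 (arXiv:2201.00153 p. 5)] -/
theorem derivBounds_axisZoom {V : ℝ → EuclideanSpace ℝ (Fin 3) → EuclideanSpace ℝ (Fin 3)} {hp hm δ : ℝ}
    (hR : 0 < R)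
    (hV : ∀ z ∈ parCyl ((t₀, b • eZ) : ℝ × EuclideanSpace ℝ (Fin 3)) R, ContDiffAt ℝ ∞ (V z.1) z.2)
    (hbd : ∀ a ∈ spaceCyl (b • eZ) R, (0 < cylRadius a ∨ |a 2 - hp| < δ ∨ |a 2 - hm| < δ) →
      ∃ ρ > 0, parabolicCylinder ρ ((t₀, a) : ℝ × EuclideanSpace ℝ (Fin 3)) ⊆
          parCyl ((t₀, b • eZ) : ℝ × EuclideanSpace ℝ (Fin 3)) R ∧
        ∀ n : ℕ, ∃ C : ℝ, ∀ w ∈ parabolicCylinder ρ ((t₀, a) : ℝ × EuclideanSpace ℝ (Fin 3)),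
          ‖iteratedFDeriv ℝ n (V w.1) w.2‖ ≤ C) :
    ∀ a ∈ spaceCyl (0 : EuclideanSpace ℝ (Fin 3)) 1,
      (0 < cylRadius a ∨ |a 2 - (hp - b) / R| < δ / R ∨ |a 2 - (hm - b) / R| < δ / R) →
      ∃ ρ > 0, parabolicCylinder ρ (((0 : ℝ), a) : ℝ × EuclideanSpace ℝ (Fin 3)) ⊆
          parCyl (0 : ℝ × EuclideanSpace ℝ (Fin 3)) 1 ∧
        ∀ n : ℕ, ∃ C : ℝ, ∀ w ∈ parabolicCylinder ρ (((0 : ℝ), a) : ℝ × EuclideanSpace ℝ (Fin 3)),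
          ‖iteratedFDeriv ℝ n ((R • stPull (R ^ 2) R t₀ (b • eZ) V) w.1) w.2‖ ≤ C := by
  intro a ha hcond
  have ha₀ : b • eZ + R • a ∈ spaceCyl (b • eZ) R := axisZoom_mem_spaceCyl hR b ha
  have hcond₀ : 0 < cylRadius (b • eZ + R • a) ∨ |(b • eZ + R • a) 2 - hp| < δ ∨
      |(b • eZ + R • a) 2 - hm| < δ := by
    rcases hcond with h | h | h
    · left; rw [cylRadius_axisAffine hR.le]; positivity
    · right; left; rw [smul_eZ_add_smul_apply_two]; exact (abs_sub_height_lt_iff hR).1 h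
    · right; right; rw [smul_eZ_add_smul_apply_two]; exact (abs_sub_height_lt_iff hR).1 h
  obtain ⟨ρ, hρ, hsub, hC⟩ := hbd _ ha₀ hcond₀
  have hpc := stAffine_preimage_parabolicCylinder_axisZoom hR t₀ (b • eZ) a ρ
  refine ⟨ρ / R, div_pos hρ hR, ?_, fun n => ?_⟩
  · rw [← hpc, ← stAffine_preimage_parCyl_self hR t₀ (b • eZ)]
    exact preimage_mono hsub
  · obtain ⟨C, hC⟩ := hC n
    refine ⟨|R| * |R| ^ n * C, fun w hw => ?_⟩
    have hw' : stAffine (R ^ 2) R t₀ (b • eZ) w ∈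
        parabolicCylinder ρ ((t₀, b • eZ + R • a) : ℝ × EuclideanSpace ℝ (Fin 3)) := by
      rw [← mem_preimage, hpc]; exact hw
    have hVw : ContDiffAt ℝ ∞ (V (t₀ + R ^ 2 * w.1)) (b • eZ + R • w.2) :=
      hV (stAffine (R ^ 2) R t₀ (b • eZ) w) (hsub hw')
    have hCw : ‖iteratedFDeriv ℝ n (V (t₀ + R ^ 2 * w.1)) (b • eZ + R • w.2)‖ ≤ C :=
      hC (stAffine (R ^ 2) R t₀ (b • eZ) w) hw'
    have hformula := iteratedFDeriv_smul_comp_axisZoom hR.ne' R (V (t₀ + R ^ 2 * w.1)) (b • eZ) w.2 n hVw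
    have e : (R • stPull (R ^ 2) R t₀ (b • eZ) V) w.1 =
        fun x' => R • V (t₀ + R ^ 2 * w.1) (b • eZ + R • x') := rfl
    rw [e, hformula]
    calc ‖R • (iteratedFDeriv ℝ n (V (t₀ + R ^ 2 * w.1)) (b • eZ + R • w.2)).compContinuousLinearMap
          (fun _ => R • ContinuousLinearMap.id ℝ (EuclideanSpace ℝ (Fin 3)))‖
        ≤ |R| * |R| ^ n * ‖iteratedFDeriv ℝ n (V (t₀ + R ^ 2 * w.1)) (b • eZ + R • w.2)‖ :=
          norm_smul_compContinuousLinearMap_smul_id_le R R _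
      _ ≤ |R| * |R| ^ n * C := mul_le_mul_of_nonneg_left hCw (by positivity)

end Transport

end Literature.Analysis.SereginLogSwirlOrigin.EulerScaling

end Part7

/-!
## Part 8 — port of `Summits/NavierStokesRegularity/NavierStokesRegularity/Theorems/AxisymmetricExtremalityAxisymmetricKatoGlobalStubSereginLogSwirlOriginParabolicNullLines.lean` (6 declarations kept)

# `𝒫¹`-null sets contain no spatial segment and have Lebesgue-null time projection —
# crux stmt-NavierStokesRegularity-15453 (`AxisymmetricExtremality.AxisymmetricKatoGlobal`), line registered, support for stub `stub_sereginLogSwirlOrigin`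

Support file (`--supports stmt-NavierStokesRegularity-15453`; theorems only, everything proved)
toward the registered stub `stub_sereginLogSwirlOrigin` = the named fact
`Literature.Analysis.FluidPDE.seregin2022_logSwirl_regularAtOrigin` (G. Seregin, J. Math. Fluid
Mech. 24 (2022), Paper 27 = arXiv:2201.00153, §2).  Step 1 of that proof constructs the cut-off
`η` from the partial regularity of the solution (arXiv p. 5): "Since the 1D parabolic Hausdorff
measure of the set of singular points is equal to zero, there exist at least two regular points
`z₁ = (0, h₁, 0)` and `z₂ = (0, -h₂, 0)` of `v` such that `0 < h₁, h₂ < 1`. … Moreover, one can find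
`t₀ ∈ ]-δ², 0[` such that there is no singular point in the set `𝒞̄(r₀) × [t₀, t₀ + δ₀²]`."
Both choices rest on two measure-theoretic facts about `𝒫¹`-null sets `S ⊆ ℝ × F`
(`IsParabolicNull 1 S`, Caffarelli–Kohn–Nirenberg 1982, (2.6); `SuitableWeak.lean`), proved here:

* `volume_setOf_mem_line_eq_zero_of_isParabolicNull`, `exists_not_mem_line_of_isParabolicNull`
  (registered sub-goal, `F = ℝ³`) — on every spatial line `h ↦ (t, x₀ + h v)`, `‖v‖ = 1`, at a
  fixed time, the parameters `h` with `(t, x₀ + h v) ∈ S` form a Lebesgue-null set; in particular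
  every interval `]a, b[` of the line contains a point outside `S` (the regular axis points
  `(0, ±h, 0)`);
* `volume_image_fst_eq_zero_of_isParabolicNull`, `ae_forall_not_mem_of_isParabolicNull`,
  `exists_forall_not_mem_slice_of_isParabolicNull` — the time projection of `S` is Lebesgue-null,
  so almost every (in particular some) time slice `{t₀} × F` misses `S` entirely (the
  singularity-free slice behind the slab `𝒞̄(r₀) × [t₀, t₀ + δ₀²]`, the slab then coming from the
  relative closedness of the singular set, `closure_singularSet_inter_subset`).

Proofs: a cover of `S` by centred parabolic cylinders `Q*_{rⱼ}(zⱼ)`, `rⱼ < 1`, of cost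
`∑ rⱼ < η` (`exists_cover_of_parabolicHausdorffContent_lt`) meets the line in parameter sets of
diameter `≤ 2rⱼ` (`Real.volume_le_diam`) and projects in time onto intervals of length
`2rⱼ² ≤ 2rⱼ`; let `η → 0`.

## References

* G. Seregin, J. Math. Fluid Mech. 24 (2022), Paper No. 27 = arXiv:2201.00153, §2 Step 1 (arXiv
  p. 5). [`Seregin2022LocalAxisym`]
* L. Caffarelli, R. Kohn, L. Nirenberg, Comm. Pure Appl. Math. 35 (1982), (2.6) and §6.
  [`CaffarelliKohnNirenberg1982`]

Not carried from this source module (not needed by the declarations re-homed here; their consumers are Summits-side): `ae_forall_not_mem_of_isParabolicNull`, `exists_forall_not_mem_slice_of_isParabolicNull`.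
-/

section Part8

open _root_.Set _root_.MeasureTheory _root_.Filter _root_.Topology _root_.Function _root_.Metric
open scoped _root_.ENNReal _root_.NNReal
open Literature.Analysis.FluidPDE

namespace Literature.Analysis.SereginLogSwirlOrigin.EulerScaling

section General

variable {F : Type*} [PseudoMetricSpace F]

/-- The `δ`-content is dominated by the parabolic Hausdorff measure (`𝒫^s = sup_δ 𝒫^s_δ`).
[cite: CaffarelliKohnNirenberg1982, (2.6)] -/
theorem parabolicHausdorffContent_le_parabolicHausdorff (s : ℝ) {δ : ℝ} (hδ : 0 < δ)
    (X : Set (ℝ × F)) : parabolicHausdorffContent s δ X ≤ parabolicHausdorff s X :=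
  le_iSup₂ (f := fun (δ : ℝ) (_ : 0 < δ) => parabolicHausdorffContent s δ X) δ hδ

/-- **Cheap covers of a `𝒫¹`-null set**: for every `η > 0`, `S` is covered by centred parabolic
cylinders `Q*_{rⱼ}(zⱼ)` with `0 ≤ rⱼ < 1` and `∑ⱼ rⱼ < η`. [cite: CaffarelliKohnNirenberg1982, (2.6)] -/
theorem exists_cover_of_isParabolicNull {S : Set (ℝ × F)} (hS : IsParabolicNull 1 S) {η : ℝ≥0∞}
    (hη : 0 < η) :
    ∃ (z : ℕ → ℝ × F) (r : ℕ → ℝ), (∀ j, 0 ≤ r j ∧ r j < 1) ∧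
      S ⊆ ⋃ j, parabolicCylinderCentered (r j) (z j) ∧ ∑' j, ENNReal.ofReal (r j) < η := by
  have h0 : parabolicHausdorffContent 1 1 S < η := by
    calc parabolicHausdorffContent 1 1 S ≤ parabolicHausdorff 1 S :=
          parabolicHausdorffContent_le_parabolicHausdorff 1 one_pos S
      _ = 0 := hS
      _ < η := hη
  obtain ⟨z, r, hr, hcov, hsum⟩ := exists_cover_of_parabolicHausdorffContent_lt h0
  refine ⟨z, r, hr, hcov, ?_⟩
  simpa only [Real.rpow_one] using hsum

/-- **The time projection of a `𝒫¹`-null set is Lebesgue-null** (each `Q*_{rⱼ}(zⱼ)` projects onto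
a time interval of length `2rⱼ² ≤ 2rⱼ`). [cite: Seregin2022LocalAxisym, §2 Step 1 (arXiv:2201.00153 p. 5)] -/
theorem volume_image_fst_eq_zero_of_isParabolicNull {S : Set (ℝ × F)} (hS : IsParabolicNull 1 S) :
    volume (Prod.fst '' S) = 0 := by
  refine le_antisymm (ENNReal.le_of_forall_pos_le_add fun ε hε _ => ?_) bot_le
  rw [zero_add]
  have hε2 : (0 : ℝ≥0∞) < (ε : ℝ≥0∞) / 2 := by
    refine ENNReal.div_pos_iff.2 ⟨?_, ENNReal.ofNat_ne_top⟩
    exact_mod_cast hε.ne'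
  obtain ⟨z, r, hr, hcov, hsum⟩ := exists_cover_of_isParabolicNull hS hε2
  have hsub : Prod.fst '' S ⊆ ⋃ j, Ioo ((z j).1 - r j ^ 2) ((z j).1 + r j ^ 2) := by
    rintro _ ⟨w, hw, rfl⟩
    obtain ⟨j, hj⟩ := mem_iUnion.1 (hcov hw)
    rw [mem_parabolicCylinderCentered] at hj
    exact mem_iUnion.2 ⟨j, hj.1⟩
  have hj : ∀ j, volume (Ioo ((z j).1 - r j ^ 2) ((z j).1 + r j ^ 2)) ≤ 2 * ENNReal.ofReal (r j) := by
    intro j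
    rw [Real.volume_Ioo, ← ENNReal.ofReal_ofNat, ← ENNReal.ofReal_mul (by norm_num)]
    refine ENNReal.ofReal_le_ofReal ?_
    nlinarith [(hr j).1, (hr j).2]
  calc volume (Prod.fst '' S)
      ≤ volume (⋃ j, Ioo ((z j).1 - r j ^ 2) ((z j).1 + r j ^ 2)) := measure_mono hsub
    _ ≤ ∑' j, volume (Ioo ((z j).1 - r j ^ 2) ((z j).1 + r j ^ 2)) := measure_iUnion_le _
    _ ≤ ∑' j, 2 * ENNReal.ofReal (r j) := ENNReal.tsum_le_tsum hj
    _ = 2 * ∑' j, ENNReal.ofReal (r j) := ENNReal.tsum_mul_left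
    _ ≤ 2 * ((ε : ℝ≥0∞) / 2) := by gcongr
    _ = ε := by rw [mul_comm, ENNReal.div_mul_cancel two_ne_zero ENNReal.ofNat_ne_top]

end General

section Line

variable {F : Type*} [NormedAddCommGroup F] [NormedSpace ℝ F]

/-- **A `𝒫¹`-null set meets every spatial line (at a fixed time) in a Lebesgue-null set of
parameters**: for `‖v‖ = 1`, `volume {h | (t, x₀ + h v) ∈ S} = 0` (each `Q*_{rⱼ}(zⱼ)` meets the
line in a parameter set of diameter `≤ 2rⱼ`). [cite: Seregin2022LocalAxisym, §2 Step 1 (arXiv:2201.00153 p. 5)] -/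
theorem volume_setOf_mem_line_eq_zero_of_isParabolicNull {S : Set (ℝ × F)} (hS : IsParabolicNull 1 S)
    (t : ℝ) (x₀ v : F) (hv : ‖v‖ = 1) :
    volume {h : ℝ | (t, x₀ + h • v) ∈ S} = 0 := by
  refine le_antisymm (ENNReal.le_of_forall_pos_le_add fun ε hε _ => ?_) bot_le
  rw [zero_add]
  have hε2 : (0 : ℝ≥0∞) < (ε : ℝ≥0∞) / 2 := by
    refine ENNReal.div_pos_iff.2 ⟨?_, ENNReal.ofNat_ne_top⟩
    exact_mod_cast hε.ne'
  obtain ⟨z, r, hr, hcov, hsum⟩ := exists_cover_of_isParabolicNull hS hε2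
  set A : ℕ → Set ℝ := fun j => {h : ℝ | (t, x₀ + h • v) ∈ parabolicCylinderCentered (r j) (z j)}
    with hA
  have hsub : {h : ℝ | (t, x₀ + h • v) ∈ S} ⊆ ⋃ j, A j := fun h hh => by
    obtain ⟨j, hj⟩ := mem_iUnion.1 (hcov hh)
    exact mem_iUnion.2 ⟨j, hj⟩
  have hdiam : ∀ j, volume (A j) ≤ 2 * ENNReal.ofReal (r j) := by
    intro j
    rw [← ENNReal.ofReal_ofNat, ← ENNReal.ofReal_mul (by norm_num)]
    refine (Real.volume_le_diam _).trans (Metric.ediam_le fun h hh h' hh' => ?_)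
    rw [edist_dist, Real.dist_eq]
    refine ENNReal.ofReal_le_ofReal ?_
    have h1 : dist (x₀ + h • v) (z j).2 < r j := (mem_parabolicCylinderCentered.1 hh).2
    have h2 : dist (x₀ + h' • v) (z j).2 < r j := (mem_parabolicCylinderCentered.1 hh').2
    have h3 : dist (x₀ + h • v) (x₀ + h' • v) = |h - h'| := by
      rw [dist_eq_norm, add_sub_add_left_eq_sub, ← sub_smul, norm_smul, hv, mul_one,
        Real.norm_eq_abs]
    have h4 := dist_triangle_right (x₀ + h • v) (x₀ + h' • v) (z j).2
    linarith
  calc volume {h : ℝ | (t, x₀ + h • v) ∈ S}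
      ≤ volume (⋃ j, A j) := measure_mono hsub
    _ ≤ ∑' j, volume (A j) := measure_iUnion_le _
    _ ≤ ∑' j, 2 * ENNReal.ofReal (r j) := ENNReal.tsum_le_tsum hdiam
    _ = 2 * ∑' j, ENNReal.ofReal (r j) := ENNReal.tsum_mul_left
    _ ≤ 2 * ((ε : ℝ≥0∞) / 2) := by gcongr
    _ = ε := by rw [mul_comm, ENNReal.div_mul_cancel two_ne_zero ENNReal.ofNat_ne_top]

/-- On every spatial line at a fixed time, every parameter interval contains a point outside a
`𝒫¹`-null set (general normed space). [cite: Seregin2022LocalAxisym, §2 Step 1 (arXiv:2201.00153 p. 5)] -/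
theorem exists_not_mem_line_of_isParabolicNull' {S : Set (ℝ × F)} (hS : IsParabolicNull 1 S)
    (t : ℝ) (x₀ v : F) (hv : ‖v‖ = 1) {a b : ℝ} (hab : a < b) :
    ∃ h ∈ Ioo a b, (t, x₀ + h • v) ∉ S := by
  by_contra hcon
  push Not at hcon
  have hle : volume (Ioo a b) ≤ volume {h : ℝ | (t, x₀ + h • v) ∈ S} :=
    measure_mono fun h hh => hcon h hh
  rw [volume_setOf_mem_line_eq_zero_of_isParabolicNull hS t x₀ v hv, Real.volume_Ioo,
    nonpos_iff_eq_zero, ENNReal.ofReal_eq_zero] at hle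
  linarith

end Line

/-- **Seregin 2022, §2 Step 1, the measure-theoretic choice of the regular axis points** ("Since
the 1D parabolic Hausdorff measure of the set of singular points is equal to zero, there exist at
least two regular points `z₁ = (0, h₁, 0)` and `z₂ = (0, -h₂, 0)` of `v` such that
`0 < h₁, h₂ < 1`"), in the generality actually used: a `𝒫¹`-null set `S ⊆ ℝ × ℝ³`
(`IsParabolicNull 1 S`, e.g. a singular set by `ckn_partial_regularity_holds`) omits, on every
spatial line `h ↦ (t, x₀ + h v)` (`‖v‖ = 1`, fixed time `t`) and in every parameter window
`]a, b[`, some point. [cite: Seregin2022LocalAxisym, §2 Step 1 (arXiv:2201.00153 p. 5)] -/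
theorem exists_not_mem_line_of_isParabolicNull : ∀ (S : Set (ℝ × EuclideanSpace ℝ (Fin 3))), IsParabolicNull 1 S → ∀ (t : ℝ) (x₀ v : EuclideanSpace ℝ (Fin 3)), ‖v‖ = 1 → ∀ (a b : ℝ), a < b → ∃ h ∈ Ioo a b, (t, x₀ + h • v) ∉ S :=
  fun _ hS t x₀ v hv _ _ hab => exists_not_mem_line_of_isParabolicNull' hS t x₀ v hv hab

end Literature.Analysis.SereginLogSwirlOrigin.EulerScaling

end Part8

/-!
## Part 9 — port of `Summits/NavierStokesRegularity/NavierStokesRegularity/Theorems/AxisymmetricExtremalityAxisymmetricKatoGlobalStubSeregin2020TypeIINoSwirlFirstSingular.lean` (7 declarations kept)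

# Seregin 2020, proof of Thm 2.1, the no-swirl endgame: a first singular point on the axis with
# a clean parabolic past

Helper toward the stub `stub_seregin2020TypeII` of the crux `AxisymmetricKatoGlobal` (= the named
fact `Literature.Analysis.FluidPDE.Seregin2020_axisymmetricSingularPoint_typeII`, G. Seregin,
Anal. Math. Phys. 10 (2020) Paper 46 = arXiv:2006.04140, Thm 2.1). The last step of the printed
proof (arXiv p. 8) invokes: "any axially symmetric suitable weak solution with no swirl, i.e.,
`u_φ = 0`, is smooth … (it can be done by considering a problem for `η = ω_φ/ϱ` … and reduction
of it to spatial dimension 5, see, for example, [KangK2004])". The tree renders the `η`-argument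
as a LOCAL maximum principle (`Literature.Analysis.FluidPDE.noSwirl_abs_scalar_le_of_boundary`:
a bound for `|η|` on the parabolic boundary of a cylinder `[t₀, t₁] × B̄(c, R)` centred on the
axis, inside which the solution is smooth, propagates inside). To remove the axis singularities
with it one argues by contradiction from a singular point whose parabolic past is clean: a point
`ẑ = (t̂, ĉ)` of the singular set `S` and a radius `R > 0` such that every point of `S` in the
closed cylinder `[t̂ - R², t̂] × B̄(ĉ, R)` lies at the top time `t̂` and strictly inside, so that
the solution is smooth below `t̂` and near the whole parabolic boundary.

This file proves that such a configuration exists inside any prescribed parabolic neighbourhood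
of any point of `S`, for every CLOSED set `S` of points of the axis whose projections to the time
axis and to the symmetry axis are Lebesgue-null (`exists_clean_first_singular_point`) — in
particular for every closed `𝒫¹`-null subset of the axis
(`exists_clean_first_singular_point_of_isParabolicNull`, with the projection lemma
`volume_image_coord_eq_zero_of_isParabolicNull`; the time projection is the sibling
`volume_image_fst_eq_zero_of_isParabolicNull`). For the singular set of an axisymmetric suitable
weak solution both inputs are in the tree (`singularSet_subset_axis`,
`ckn_partial_regularity_holds`, `isParabolicNull_backwardSingular_top`).

Proof: below the given point `z₀ = (t₀, c₀)` choose a singularity-free time `t_b ∈ ]t₀ - δ², t₀[`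
and two singularity-free heights `h₋ ∈ ]c₀₃ - δ, c₀₃ - δ/2[`, `h₊ ∈ ]c₀₃ + δ/2, c₀₃ + δ[` (null
projections); the part `K` of `S` in the compact box `[t_b, t₀] × [h₋, h₊]` (along the axis)
contains `z₀`, so it has a point `ẑ` of least time `t̂`; necessarily `t̂ > t_b` and
`h₋ < ĉ₃ < h₊` (the faces are singularity free). Any `R > 0` below `ĉ₃ - h₋`, `h₊ - ĉ₃`,
`√(t̂ - t_b)` with `ĉ₃ ± R` outside the (null) height projection works: a point of `S` in
`[t̂ - R², t̂] × {|x₃ - ĉ₃| ≤ R}` lies in `K`, so its time is `≥ t̂`, and its height is not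
`ĉ₃ ± R`.

## References

* G. Seregin, Anal. Math. Phys. 10 (2020), Paper 46 = arXiv:2006.04140, proof of Thm. 2.1, last
  paragraph (arXiv p. 8). [Seregin2020]
* L. Caffarelli, R. Kohn, L. Nirenberg, Comm. Pure Appl. Math. 35 (1982), Theorem B and (2.6)
  (`𝒫¹`-null sets and their covers). [CaffarelliKohnNirenberg1982]
-/

section Part9

open _root_.MeasureTheory _root_.Set _root_.Function _root_.Filter _root_.Topology _root_.TopologicalSpace
  _root_.Metric
open scoped _root_.NNReal _root_.ENNReal

namespace Literature.Analysis.SereginLogSwirlOrigin.EulerScaling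

open Literature.Analysis.FluidPDE

/-! ### Null sets on the line -/

/-- An interval of positive length is not covered by a Lebesgue-null set. [folklore]
[cite: Seregin2020, proof of Thm 2.1 (off-axis / no-swirl representatives, first singular point) (source of the ARGUMENT this module implements; this declaration is the cell’s own lemma or plumbing, NOT a printed statement)] -/
theorem exists_mem_Ioo_not_mem_of_volume_eq_zero {N : Set ℝ} (hN : volume N = 0) {a b : ℝ}
    (hab : a < b) : ∃ x ∈ Ioo a b, x ∉ N := by
  by_contra hcon
  push Not at hcon
  have hle : volume (Ioo a b) ≤ volume N := measure_mono fun x hx => hcon x hx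
  rw [hN, Real.volume_Ioo, nonpos_iff_eq_zero, ENNReal.ofReal_eq_zero] at hle
  linarith

/-- Translates and reflections of a Lebesgue-null set of reals are null:
`{R | c + R ∈ N} ∪ {R | c - R ∈ N}` is null. [folklore]
[cite: Seregin2020, proof of Thm 2.1 (off-axis / no-swirl representatives, first singular point) (source of the ARGUMENT this module implements; this declaration is the cell’s own lemma or plumbing, NOT a printed statement)] -/
theorem volume_setOf_add_mem_union_sub_mem_eq_zero {N : Set ℝ} (hN : volume N = 0) (c : ℝ) :
    volume ({R : ℝ | c + R ∈ N} ∪ {R : ℝ | c - R ∈ N}) = 0 := by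
  refine measure_union_null ?_ ?_
  · exact measure_preimage_add volume c N ▸ hN ▸ rfl
  · exact (Measure.measurePreserving_sub_left volume c).quasiMeasurePreserving.preimage_null hN

/-! ### The height projection of a `𝒫¹`-null set -/

/-- **The projection of a `𝒫¹`-null set of `ℝ × ℝ³` to a coordinate axis is Lebesgue-null**
(all times together): `volume ((fun z ↦ z.2 i) '' S) = 0` — each centred cylinder `Q*_{rⱼ}(zⱼ)`
of a cheap cover projects into an interval of diameter `≤ 2rⱼ`.
[cite: CaffarelliKohnNirenberg1982, (2.6)] -/
theorem volume_image_coord_eq_zero_of_isParabolicNull {S : Set (ℝ × EuclideanSpace ℝ (Fin 3))}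
    (hS : IsParabolicNull 1 S) (i : Fin 3) :
    volume ((fun z : ℝ × EuclideanSpace ℝ (Fin 3) => z.2 i) '' S) = 0 := by
  refine le_antisymm (ENNReal.le_of_forall_pos_le_add fun ε hε _ => ?_) bot_le
  rw [zero_add]
  have hε2 : (0 : ℝ≥0∞) < (ε : ℝ≥0∞) / 2 := by
    refine ENNReal.div_pos_iff.2 ⟨?_, ENNReal.ofNat_ne_top⟩
    exact_mod_cast hε.ne'
  obtain ⟨z, r, hr, hcov, hsum⟩ := exists_cover_of_isParabolicNull hS hε2
  set A : ℕ → Set ℝ := fun j =>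
    (fun w : ℝ × EuclideanSpace ℝ (Fin 3) => w.2 i) '' parabolicCylinderCentered (r j) (z j) with hA
  have hsub : (fun w : ℝ × EuclideanSpace ℝ (Fin 3) => w.2 i) '' S ⊆ ⋃ j, A j := by
    rintro _ ⟨w, hw, rfl⟩
    obtain ⟨j, hj⟩ := mem_iUnion.1 (hcov hw)
    exact mem_iUnion.2 ⟨j, ⟨w, hj, rfl⟩⟩
  have hdiam : ∀ j, volume (A j) ≤ 2 * ENNReal.ofReal (r j) := by
    intro j
    rw [← ENNReal.ofReal_ofNat, ← ENNReal.ofReal_mul (by norm_num)]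
    refine (Real.volume_le_diam _).trans (Metric.ediam_le ?_)
    rintro _ ⟨w, hw, rfl⟩ _ ⟨w', hw', rfl⟩
    rw [edist_dist, Real.dist_eq]
    refine ENNReal.ofReal_le_ofReal ?_
    have h1 : dist w.2 (z j).2 < r j := (mem_parabolicCylinderCentered.1 hw).2
    have h2 : dist w'.2 (z j).2 < r j := (mem_parabolicCylinderCentered.1 hw').2
    have h3 : |w.2 i - w'.2 i| ≤ dist w.2 w'.2 := by
      rw [← Real.dist_eq]
      exact PiLp.dist_apply_le w.2 w'.2 i
    have h4 := dist_triangle_right w.2 w'.2 (z j).2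
    linarith
  calc volume ((fun w : ℝ × EuclideanSpace ℝ (Fin 3) => w.2 i) '' S)
      ≤ volume (⋃ j, A j) := measure_mono hsub
    _ ≤ ∑' j, volume (A j) := measure_iUnion_le _
    _ ≤ ∑' j, 2 * ENNReal.ofReal (r j) := ENNReal.tsum_le_tsum hdiam
    _ = 2 * ∑' j, ENNReal.ofReal (r j) := ENNReal.tsum_mul_left
    _ ≤ 2 * ((ε : ℝ≥0∞) / 2) := by gcongr
    _ = ε := by rw [mul_comm, ENNReal.div_mul_cancel two_ne_zero ENNReal.ofNat_ne_top]

/-! ### Points of the axis -/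

/-- On the axis the norm is the modulus of the height: `‖x‖ = |x₃|` if `ϱ(x) = 0`. [folklore]
[cite: Seregin2020, proof of Thm 2.1 (off-axis / no-swirl representatives, first singular point) (source of the ARGUMENT this module implements; this declaration is the cell’s own lemma or plumbing, NOT a printed statement)] -/
theorem norm_eq_abs_of_cylRadius_eq_zero {x : EuclideanSpace ℝ (Fin 3)} (hx : cylRadius x = 0) :
    ‖x‖ = |x 2| := by
  obtain ⟨h0, h1⟩ := (cylRadius_eq_zero_iff x).1 hx
  rw [EuclideanSpace.norm_eq, Fin.sum_univ_three]
  simp [h0, h1, Real.sqrt_sq_eq_abs]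

/-- On the axis distances are differences of heights: `dist x y = |x₃ - y₃|`. [folklore]
[cite: Seregin2020, proof of Thm 2.1 (off-axis / no-swirl representatives, first singular point) (source of the ARGUMENT this module implements; this declaration is the cell’s own lemma or plumbing, NOT a printed statement)] -/
theorem dist_eq_abs_sub_of_cylRadius_eq_zero {x y : EuclideanSpace ℝ (Fin 3)}
    (hx : cylRadius x = 0) (hy : cylRadius y = 0) : dist x y = |x 2 - y 2| := by
  obtain ⟨hx0, hx1⟩ := (cylRadius_eq_zero_iff x).1 hx
  obtain ⟨hy0, hy1⟩ := (cylRadius_eq_zero_iff y).1 hy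
  have hxy : cylRadius (x - y) = 0 :=
    (cylRadius_eq_zero_iff _).2 ⟨by simp [hx0, hy0], by simp [hx1, hy1]⟩
  rw [dist_eq_norm, norm_eq_abs_of_cylRadius_eq_zero hxy]
  simp

/-! ### The first singular point with a clean past -/

/-- **A singular point of the axis with a clean parabolic past.** Let `S ⊆ ℝ × ℝ³` be closed,
contained in the axis `{ϱ = 0}`, with Lebesgue-null time projection `{t | ∃ x, (t, x) ∈ S}` and
Lebesgue-null height projection `{x₃ | ∃ t x, (t, x) ∈ S, x₃ = x 2}`; let `z₀ = (t₀, c₀) ∈ S` and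
`δ > 0`. Then there are `ẑ = (t̂, ĉ) ∈ S` with `t₀ - δ² < t̂ ≤ t₀`, `dist ĉ c₀ < δ`, and
`0 < R ≤ δ` such that every `z = (t, x) ∈ S` with `dist x ĉ ≤ R` and `t̂ - R² ≤ t ≤ t̂` has
`t = t̂` and `dist x ĉ < R`: below the top time and on the lateral boundary the closed cylinder
`[t̂ - R², t̂] × B̄(ĉ, R)` carries no point of `S` (on the axis `dist x ĉ = |x₃ - ĉ₃|`,
`dist_eq_abs_sub_of_cylRadius_eq_zero`, so the proof runs with heights). This is the
configuration in which the local maximum principle for `η = ω_φ/ϱ` is run when removing axis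
singularities of swirl-free solutions.
[cite: Seregin2020, proof of Thm 2.1, last paragraph] -/
theorem exists_clean_first_singular_point :
    ∀ (S : Set (ℝ × EuclideanSpace ℝ (Fin 3))), IsClosed S →
      (∀ z ∈ S, cylRadius z.2 = 0) →
      volume (Prod.fst '' S) = 0 →
      volume ((fun z : ℝ × EuclideanSpace ℝ (Fin 3) => z.2 2) '' S) = 0 →
      ∀ z₀ ∈ S, ∀ δ : ℝ, 0 < δ →
        ∃ zc ∈ S, ∃ R : ℝ, 0 < R ∧ R ≤ δ ∧ zc.1 ∈ Ioc (z₀.1 - δ ^ 2) z₀.1 ∧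
          dist zc.2 z₀.2 < δ ∧
          ∀ z ∈ S, dist z.2 zc.2 ≤ R → zc.1 - R ^ 2 ≤ z.1 → z.1 ≤ zc.1 →
            z.1 = zc.1 ∧ dist z.2 zc.2 < R := by
  intro S hS haxis hT hN z₀ hz₀ δ hδ
  -- on the axis, distances are differences of heights
  have hdist : ∀ z ∈ S, ∀ z' ∈ S, dist z.2 z'.2 = |z.2 2 - z'.2 2| := fun z hz z' hz' =>
    dist_eq_abs_sub_of_cylRadius_eq_zero (haxis z hz) (haxis z' hz')
  -- ### the singularity-free bottom time and heights
  have hδ2 : 0 < δ ^ 2 := by positivity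
  obtain ⟨tb, htb, htbT⟩ := exists_mem_Ioo_not_mem_of_volume_eq_zero hT
    (show z₀.1 - δ ^ 2 < z₀.1 by linarith)
  obtain ⟨hp, hhp, hhpN⟩ := exists_mem_Ioo_not_mem_of_volume_eq_zero hN
    (show z₀.2 2 + δ / 2 < z₀.2 2 + δ by linarith)
  obtain ⟨hm, hhm, hhmN⟩ := exists_mem_Ioo_not_mem_of_volume_eq_zero hN
    (show z₀.2 2 - δ < z₀.2 2 - δ / 2 by linarith)
  -- membership in the projections
  have hTmem : ∀ z ∈ S, z.1 ∈ Prod.fst '' S := fun z hz => ⟨z, hz, rfl⟩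
  have hNmem : ∀ z ∈ S, z.2 2 ∈ (fun z : ℝ × EuclideanSpace ℝ (Fin 3) => z.2 2) '' S :=
    fun z hz => ⟨z, hz, rfl⟩
  -- ### the compact piece `K` of `S` and its point of least time
  set K : Set (ℝ × EuclideanSpace ℝ (Fin 3)) :=
    S ∩ {z | z.1 ∈ Icc tb z₀.1 ∧ z.2 2 ∈ Icc hm hp} with hK
  have hKclosed : IsClosed K := by
    refine hS.inter (IsClosed.inter ?_ ?_)
    · exact isClosed_Icc.preimage continuous_fst
    · exact isClosed_Icc.preimage ((EuclideanSpace.proj (2 : Fin 3)).continuous.comp continuous_snd)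
  have hKsub : K ⊆ Icc tb z₀.1 ×ˢ closedBall (0 : EuclideanSpace ℝ (Fin 3)) (max |hm| |hp|) := by
    rintro z ⟨hzS, hz1, hz2⟩
    refine ⟨hz1, ?_⟩
    rw [mem_closedBall, dist_zero_right, norm_eq_abs_of_cylRadius_eq_zero (haxis z hzS)]
    exact abs_le_max_abs_abs hz2.1 hz2.2
  have hKc : IsCompact K :=
    (isCompact_Icc.prod (isCompact_closedBall _ _)).of_isClosed_subset hKclosed hKsub
  have hz₀K : z₀ ∈ K :=
    ⟨hz₀, ⟨htb.2.le, le_rfl⟩, ⟨by linarith [hhm.2], by linarith [hhp.1]⟩⟩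
  obtain ⟨zh, hzhK, hmin⟩ := hKc.exists_isMinOn ⟨z₀, hz₀K⟩ continuous_fst.continuousOn
  obtain ⟨hzhS, hzh1, hzh2⟩ := hzhK
  -- `t̂ > t_b` and `h₋ < ĉ₃ < h₊`: the faces of the box are singularity free
  have htb_lt : tb < zh.1 := by
    rcases hzh1.1.eq_or_lt with h | h
    · exact absurd (h ▸ hTmem zh hzhS) htbT
    · exact h
  have hhm_lt : hm < zh.2 2 := by
    rcases hzh2.1.eq_or_lt with h | h
    · exact absurd (h ▸ hNmem zh hzhS) hhmN
    · exact h
  have hhp_gt : zh.2 2 < hp := by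
    rcases hzh2.2.eq_or_lt with h | h
    · exact absurd (h ▸ hNmem zh hzhS) hhpN
    · exact h
  -- ### the radius
  set R₀ : ℝ := min (min (min (hp - zh.2 2) (zh.2 2 - hm)) (Real.sqrt (zh.1 - tb))) δ with hR₀
  have hR₀pos : 0 < R₀ :=
    lt_min (lt_min (lt_min (by linarith) (by linarith)) (Real.sqrt_pos.2 (by linarith))) hδ
  obtain ⟨R, hR, hRgood⟩ := exists_mem_Ioo_not_mem_of_volume_eq_zero
    (volume_setOf_add_mem_union_sub_mem_eq_zero hN (zh.2 2)) hR₀pos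
  have hRp : R < hp - zh.2 2 :=
    hR.2.trans_le ((min_le_left _ _).trans ((min_le_left _ _).trans (min_le_left _ _)))
  have hRm : R < zh.2 2 - hm :=
    hR.2.trans_le ((min_le_left _ _).trans ((min_le_left _ _).trans (min_le_right _ _)))
  have hRt : R ^ 2 < zh.1 - tb := by
    have h1 : R < Real.sqrt (zh.1 - tb) :=
      hR.2.trans_le ((min_le_left _ _).trans (min_le_right _ _))
    have h2 : R ^ 2 < Real.sqrt (zh.1 - tb) ^ 2 := by gcongr; exact hR.1.le
    rwa [Real.sq_sqrt (by linarith)] at h2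
  refine ⟨zh, hzhS, R, hR.1, hR.2.le.trans (min_le_right _ _), ⟨htb.1.trans htb_lt, hzh1.2⟩,
    ?_, fun z hzS hzx hzt1 hzt2 => ?_⟩
  · rw [hdist zh hzhS z₀ hz₀, abs_lt]; constructor <;> linarith [hhm.1, hhp.2]
  rw [hdist z hzS zh hzhS] at hzx ⊢
  -- ### a point of `S` in the closed cylinder lies in `K`, hence at the top time …
  have hzK : z ∈ K := by
    refine ⟨hzS, ⟨by linarith, hzt2.trans hzh1.2⟩, ?_⟩
    rw [abs_le] at hzx
    exact ⟨by linarith [hzx.1], by linarith [hzx.2]⟩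
  have hzt : z.1 = zh.1 := le_antisymm hzt2 (hmin hzK)
  -- … and not on the rim: `ĉ₃ ± R` are not heights of points of `S`
  refine ⟨hzt, lt_of_le_of_ne hzx fun heq => hRgood ?_⟩
  rcases (abs_eq hR.1.le).1 heq with h | h
  · refine Or.inl ?_
    show zh.2 2 + R ∈ (fun z : ℝ × EuclideanSpace ℝ (Fin 3) => z.2 2) '' S
    rw [show zh.2 2 + R = z.2 2 by linarith]
    exact hNmem z hzS
  · refine Or.inr ?_
    show zh.2 2 - R ∈ (fun z : ℝ × EuclideanSpace ℝ (Fin 3) => z.2 2) '' S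
    rw [show zh.2 2 - R = z.2 2 by linarith]
    exact hNmem z hzS

/-- **The same for a closed `𝒫¹`-null subset of the axis** (the singular set of an axisymmetric
suitable weak solution in a compact region: `singularSet_subset_axis`,
`ckn_partial_regularity_holds`, `isParabolicNull_backwardSingular_top`): both projections of a
`𝒫¹`-null set are Lebesgue-null (`volume_image_fst_eq_zero_of_isParabolicNull`,
`volume_image_coord_eq_zero_of_isParabolicNull`).
[cite: Seregin2020, proof of Thm 2.1, last paragraph] -/
theorem exists_clean_first_singular_point_of_isParabolicNull :
    ∀ (S : Set (ℝ × EuclideanSpace ℝ (Fin 3))), IsClosed S →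
      (∀ z ∈ S, cylRadius z.2 = 0) → IsParabolicNull 1 S →
      ∀ z₀ ∈ S, ∀ δ : ℝ, 0 < δ →
        ∃ zc ∈ S, ∃ R : ℝ, 0 < R ∧ R ≤ δ ∧ zc.1 ∈ Ioc (z₀.1 - δ ^ 2) z₀.1 ∧
          dist zc.2 z₀.2 < δ ∧
          ∀ z ∈ S, dist z.2 zc.2 ≤ R → zc.1 - R ^ 2 ≤ z.1 → z.1 ≤ zc.1 →
            z.1 = zc.1 ∧ dist z.2 zc.2 < R :=
  fun S hS haxis hP z₀ hz₀ δ hδ =>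
    exists_clean_first_singular_point S hS haxis (volume_image_fst_eq_zero_of_isParabolicNull hP)
      (volume_image_coord_eq_zero_of_isParabolicNull hP 2) z₀ hz₀ δ hδ

end Literature.Analysis.SereginLogSwirlOrigin.EulerScaling

end Part9

/-!
## Part 10 — port of `Summits/NavierStokesRegularity/NavierStokesRegularity/Theorems/AxisymmetricExtremalityAxisymmetricKatoGlobalStubSereginLogSwirlOriginTopTimePartialRegularity.lean` (7 declarations kept)

# Seregin 2022, §2 Step 1: partial regularity up to the top time — the backward-singular set of
# `𝒞 × ]-1, 0]` is `𝒫¹`-null —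
# crux stmt-NavierStokesRegularity-15453 (`AxisymmetricExtremality.AxisymmetricKatoGlobal`), line registered, support for stub `stub_sereginLogSwirlOrigin`

Support file (`--supports stmt-NavierStokesRegularity-15453`; theorems only, everything proved)
toward the registered stub `stub_sereginLogSwirlOrigin` = the named fact
`Literature.Analysis.FluidPDE.seregin2022_logSwirl_regularAtOrigin` (G. Seregin, J. Math. Fluid
Mech. 24 (2022), Paper 27 = arXiv:2201.00153, §2).  Step 1 of that proof (arXiv p. 5) starts:
"Since the 1D parabolic Hausdorff measure of the set of singular points is equal to zero, there
exist at least two regular points `z₁ = (0, h₁, 0)` and `z₂ = (0, -h₂, 0)` of `v` …".  The points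
`zᵢ` lie on the TOP time `t = 0 ∉ Q = 𝒞 × ]-1, 0[`, so "regular" there is meant in the backward
sense (`v ∈ L_∞(Q(zᵢ, δ))`), and the `𝒫¹`-nullity invoked is that of the BACKWARD-singular set of
`𝒞 × ]-1, 0]`, top time included — not the interior statement `ckn_partial_regularity`
(`singularSet u Q`, `Q` open, centred cylinders).  This file proves it for the hypothesis block of
the fact (Def. 1.1: suitable weak solution in `Q` with the global classes
`v ∈ L_{2,∞}(Q)`, `∇v ∈ L₂(Q)`, `q ∈ L_{3/2}(Q)`):

* `isParabolicNull_backwardSingular_top` (registered sub-goal) — the set of points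
  `z = (t, x)`, `-1 < t ≤ 0`, `x ∈ 𝒞`, at which `v` is essentially unbounded on every backward
  ball cylinder `Q_r(z)`, is `𝒫¹`-null.

Proof (Caffarelli–Kohn–Nirenberg 1982, §6, run with backward cylinders):
(1) `isSuitableWeakSolutionInBall_of_parCyl` — the Def.-1.1 class restricts to Albritton–Barker's
class on every ball cylinder `Q_ρ(z) ⊆ Q` (also for `t = 0`, where the closed box leaves `Q` and
only the GLOBAL classes serve); (2) `frequently_lt_dissipation_of_backwardSingular` — at a
backward-singular `z`, `ε/2 · r < ∫∫_{Q_r(z)} |∇v|²` for arbitrarily small `r`: otherwise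
`E(r; z) ≤ ε/2` on a whole interval `]0, ρ[`, the zoom `v_ρ(s, y) = ρ v(t + ρ²s, x + ρy)`
(`IsSuitableWeakSolutionInBall.zoom`, `cknE_nsZoom`) has `sup_{0<r<1} E(r) ≤ ε/2 < ε`, and the
backward ε-regularity criterion of Seregin 2014, Ch. 6, Thm. 1.4 (`seregin2014_thm14_holds`)
bounds `v_ρ` on some `Q_ϱ(0)`, i.e. `v` on `Q_{ρϱ}(z)` (`eLpNorm_top_nsZoom`); (3)
`isParabolicNull_of_frequently` — the Vitali covering estimate of the tree
(`parabolicHausdorff_one_le_of_frequently`, centred cylinders `Q*_r(z) ⊇ Q_r(z)`) for the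
density `F = 𝟙_Q |∇v|² ∈ L¹(ℝ × ℝ³)` gives `𝒫¹(S) ≤ 10 ε⁻¹ ∫∫_V F` for every open `V ⊇ S`, hence
`𝒫¹(S) < ∞`, `|S| = 0` (`volume_eq_zero_of_parabolicHausdorff_one_ne_top`), and `𝒫¹(S) = 0` by
outer regularity of Lebesgue measure and absolute continuity of `∫ F`.

## References

* G. Seregin, J. Math. Fluid Mech. 24 (2022), Paper No. 27 = arXiv:2201.00153, §2 Step 1 (arXiv
  p. 5), Def. 1.1. [`Seregin2022LocalAxisym`]
* L. Caffarelli, R. Kohn, L. Nirenberg, Comm. Pure Appl. Math. 35 (1982), §6 (Theorem B from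
  Proposition 2, covering Lemma 6.1). [`CaffarelliKohnNirenberg1982`]
* G. Seregin, *Lecture Notes on Regularity Theory for the Navier–Stokes Equations*, World
  Scientific 2014, Ch. 6, §6.1, Thm. 1.4. [`Seregin2014`]
* J. C. Robinson, J. L. Rodrigo, W. Sadowski, *The Three-Dimensional Navier–Stokes Equations*,
  CUP 2016, Thm. 16.2, (16.21). [`RobinsonRodrigoSadowski2016`]
-/

section Part10

open _root_.Set _root_.MeasureTheory _root_.Filter _root_.Topology _root_.Function _root_.Metric
open scoped _root_.ENNReal _root_.NNReal
open Literature.Analysis.FluidPDE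

namespace Literature.Analysis.SereginLogSwirlOrigin.EulerScaling

/-! ### The covering step: concentration of an integrable density forces `𝒫¹`-nullity -/

/-- **`𝒫¹`-nullity from concentration of an integrable density** (Caffarelli–Kohn–Nirenberg
1982, §6, proof of Theorem B; Robinson–Rodrigo–Sadowski 2016, Thm. 16.2): if `F ∈ L¹(ℝ × ℝ³)`,
`F ≥ 0`, and every point `z ∈ Y` admits arbitrarily small radii `r` with
`l · r < ∫∫_{Q*_r(z)} F` (`0 < l < ∞`), then `𝒫¹(Y) = 0`: the covering estimate
`𝒫¹(Y) ≤ 5 l⁻¹ ∫∫_V F` for every open `V ⊇ Y` (`parabolicHausdorff_one_le_of_frequently`) gives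
`𝒫¹(Y) < ∞`, so `|Y| = 0`, so `Y` has open neighbourhoods of arbitrarily small `∫∫ F`.
[cite: CaffarelliKohnNirenberg1982, §6 (proof of Theorem B)] -/
theorem isParabolicNull_of_frequently {F : ℝ × EuclideanSpace ℝ (Fin 3) → ℝ≥0∞}
    (hF : ∫⁻ w, F w ≠ ∞) {Y : Set (ℝ × EuclideanSpace ℝ (Fin 3))} {l : ℝ≥0∞} (hl0 : l ≠ 0)
    (hlt : l ≠ ∞)
    (hY : ∀ z ∈ Y, ∃ᶠ r in 𝓝[>] (0 : ℝ),
      l * ENNReal.ofReal r < ∫⁻ w in parabolicCylinderCentered r z, F w) :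
    IsParabolicNull 1 Y := by
  have step : ∀ V : Set (ℝ × EuclideanSpace ℝ (Fin 3)), IsOpen V → Y ⊆ V →
      parabolicHausdorff 1 Y ≤ 5 * l⁻¹ * ∫⁻ w in V, F w := fun V hV hYV =>
    parabolicHausdorff_one_le_of_frequently hV hYV hl0 hlt hY
  have h5 : (5 : ℝ≥0∞) * l⁻¹ ≠ ∞ := ENNReal.mul_ne_top (by simp) (ENNReal.inv_ne_top.2 hl0)
  have hfin : parabolicHausdorff 1 Y ≠ ∞ := by
    refine ne_top_of_le_ne_top (ENNReal.mul_ne_top h5 hF) ?_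
    have h := step univ isOpen_univ (subset_univ _)
    rwa [Measure.restrict_univ] at h
  have hvol : volume Y = 0 := volume_eq_zero_of_parabolicHausdorff_one_ne_top hfin
  change parabolicHausdorff 1 Y = 0
  refine le_antisymm (ENNReal.le_of_forall_pos_le_add fun η hη _ => ?_) zero_le
  rw [zero_add]
  have h50 : (5 : ℝ≥0∞) * l⁻¹ ≠ 0 := mul_ne_zero (by norm_num) (ENNReal.inv_ne_zero.2 hlt)
  set η' : ℝ≥0∞ := ((5 : ℝ≥0∞) * l⁻¹)⁻¹ * η with hη'
  have hη'0 : η' ≠ 0 :=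
    mul_ne_zero (ENNReal.inv_ne_zero.2 h5) (ENNReal.coe_ne_zero.2 hη.ne')
  obtain ⟨θ, hθ0, hθ⟩ := exists_pos_setLIntegral_lt_of_measure_lt hF hη'0
  obtain ⟨U, hYU, hUo, hUθ⟩ := Set.exists_isOpen_lt_of_lt Y θ (by rw [hvol]; exact hθ0)
  calc parabolicHausdorff 1 Y ≤ 5 * l⁻¹ * ∫⁻ w in U, F w := step U hUo hYU
    _ ≤ 5 * l⁻¹ * η' := mul_le_mul' le_rfl (hθ U hUθ).le
    _ = η := by rw [hη', ← mul_assoc, ENNReal.mul_inv_cancel h50 h5, one_mul]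

/-! ### Geometry of `Q = 𝒞 × ]-1, 0[` near points of `𝒞 × ]-1, 0]` -/

/-- A ball cylinder `Q_ρ(z)` whose time window lies in `]-1, 0[` and whose ball lies in `𝒞` lies
in `Q = 𝒞 × ]-1, 0[`. [folklore]
[cite: Seregin2022LocalAxisym, §2 proof of Thm. 1.2, Step 1 (arXiv:2201.00153 pp. 4–7) (source of the ARGUMENT this module implements; this declaration is the cell’s own lemma or plumbing, NOT a printed statement)] -/
theorem parabolicCylinder_subset_parCyl_of {z : ℝ × EuclideanSpace ℝ (Fin 3)} {ρ : ℝ}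
    (hI : Ioo (z.1 - ρ ^ 2) z.1 ⊆ Ioo (-1 : ℝ) 0)
    (hB : ball z.2 ρ ⊆ SereginSverak2009.spaceCyl (0 : EuclideanSpace ℝ (Fin 3)) 1) :
    parabolicCylinder ρ z ⊆ SereginSverak2009.parCyl 0 1 := by
  rintro ⟨t, x⟩ ⟨ht, hx⟩
  rw [SereginSverak2009.mem_parCyl]
  have ht' := hI ht
  have hx' := hB hx
  rw [SereginSverak2009.mem_spaceCyl] at hx'
  refine ⟨?_, hx'.1, hx'.2⟩
  simpa using ht'

/-- **Small backward cylinders at points of `𝒞 × ]-1, 0]` lie in `Q`**: for `-1 < t ≤ 0` and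
`x ∈ 𝒞` (open), eventually along `ρ → 0⁺` the time window `]t - ρ², t[` lies in `]-1, 0[` and the
ball `B(x, ρ)` in `𝒞` — the top time `t = 0` included, backward cylinders looking only into the
past. [cite: Seregin2022LocalAxisym, §2 Step 1 (arXiv:2201.00153 p. 5)] -/
theorem eventually_nhdsGT_window_ball_subset {z : ℝ × EuclideanSpace ℝ (Fin 3)}
    (hz1 : z.1 ∈ Ioc (-1 : ℝ) 0)
    (hz2 : z.2 ∈ SereginSverak2009.spaceCyl (0 : EuclideanSpace ℝ (Fin 3)) 1) :
    ∀ᶠ ρ in 𝓝[>] (0 : ℝ), 0 < ρ ∧ Ioo (z.1 - ρ ^ 2) z.1 ⊆ Ioo (-1 : ℝ) 0 ∧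
      ball z.2 ρ ⊆ SereginSverak2009.spaceCyl (0 : EuclideanSpace ℝ (Fin 3)) 1 := by
  obtain ⟨δ, hδ, hδsub⟩ := Metric.isOpen_iff.1 (SereginSverak2009.isOpen_spaceCyl 0 1) z.2 hz2
  have hpos : 0 < min δ (z.1 + 1) := lt_min hδ (by linarith [hz1.1])
  filter_upwards [Ioo_mem_nhdsGT hpos] with ρ hρ
  have hρδ : ρ < δ := hρ.2.trans_le (min_le_left _ _)
  have hρt : ρ < z.1 + 1 := hρ.2.trans_le (min_le_right _ _)
  have hρ1 : ρ ≤ 1 := by linarith [hz1.2]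
  have hρsq : ρ ^ 2 ≤ ρ := by nlinarith [hρ.1]
  refine ⟨hρ.1, fun t ht => ⟨by linarith [ht.1], lt_of_lt_of_le ht.2 hz1.2⟩,
    (ball_subset_ball hρδ.le).trans hδsub⟩

/-! ### The Def.-1.1 class in ball cylinders inside `Q` -/

/-- **The Def.-1.1 class restricts to Albritton–Barker's class on every ball cylinder `Q_ρ(z)`
with `]t - ρ², t[ ⊆ ]-1, 0[` and `B(x, ρ) ⊆ 𝒞`**, in particular at top-time centres `t = 0`
(where the closed box `[t - ρ², t] × B̄(x, ρ)` is NOT inside the open `Q`, so that the local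
classes of `IsSuitableWeakSolutionOn` do not serve and the global classes of Def. 1.1 are used).
[cite: Seregin2022LocalAxisym, Def. 1.1 and §2 Step 1 (arXiv:2201.00153 p. 5)] -/
theorem isSuitableWeakSolutionInBall_of_parCyl
    {v : ℝ → EuclideanSpace ℝ (Fin 3) → EuclideanSpace ℝ (Fin 3)} {q : ℝ → EuclideanSpace ℝ (Fin 3) → ℝ}
    {G : ℝ → EuclideanSpace ℝ (Fin 3) → EuclideanSpace ℝ (Fin 3) →L[ℝ] EuclideanSpace ℝ (Fin 3)}
    (hsw : IsSuitableWeakSolutionOn (SereginSverak2009.parCylOpens 0 1) 1 0 v q)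
    (hA : ∃ C : ℝ≥0, ∀ᵐ t ∂(volume.restrict (Ioo (-1 : ℝ) 0)),
      ∫⁻ x in SereginSverak2009.spaceCyl 0 1, ‖v t x‖ₑ ^ 2 ≤ C)
    (hG : HasWeakSpatialGradientOn (SereginSverak2009.parCylOpens 0 1) v G)
    (hE : ∫⁻ z in SereginSverak2009.parCyl 0 1, ENNReal.ofReal (frobeniusNormSq (G z.1 z.2)) < ∞)
    (hq : ∫⁻ z in SereginSverak2009.parCyl 0 1, ‖q z.1 z.2‖ₑ ^ (3 / 2 : ℝ) < ∞)
    {z : ℝ × EuclideanSpace ℝ (Fin 3)} {ρ : ℝ}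
    (hI : Ioo (z.1 - ρ ^ 2) z.1 ⊆ Ioo (-1 : ℝ) 0)
    (hB : ball z.2 ρ ⊆ SereginSverak2009.spaceCyl (0 : EuclideanSpace ℝ (Fin 3)) 1) :
    IsSuitableWeakSolutionInBall ρ z v q := by
  have hQR : parabolicCylinder ρ z ⊆ SereginSverak2009.parCyl 0 1 :=
    parabolicCylinder_subset_parCyl_of hI hB
  have hleR : parabolicCylinderOpens ρ z ≤ SereginSverak2009.parCylOpens 0 1 := fun w hw => hQR hw
  refine ⟨hsw.of_le hleR, ?_, ⟨G, hG.mono hleR, (lintegral_mono_set hQR).trans_lt hE⟩, ?_⟩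
  · obtain ⟨C, hC⟩ := hA
    refine ⟨C, ?_⟩
    filter_upwards [ae_restrict_of_ae_restrict_of_subset hI hC] with t ht
    exact (lintegral_mono_set hB).trans ht
  · have hpm : AEStronglyMeasurable (uncurry q) (volume.restrict (parabolicCylinder ρ z)) :=
      hsw.distributional.2.2.1.aestronglyMeasurable.mono_measure
        (Measure.restrict_mono (hQR.trans (subset_of_eq (SereginSverak2009.coe_parCylOpens 0 1).symm))
          le_rfl)
    have hfin : ∫⁻ w in parabolicCylinder ρ z, ‖uncurry q w‖ₑ ^ (3 / 2 : ℝ) ≠ ∞ :=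
      ((lintegral_mono_set hQR).trans_lt hq).ne
    exact (memLp_threeHalves_of_lintegral_le hpm hfin le_rfl).1

/-! ### Dissipation concentrates at backward-singular points -/

/-- The zoom centre: `Φ(0) = z` for `Φ(s, y) = (t + ρ² s, x + ρ y)`. [folklore]
[cite: Seregin2022LocalAxisym, §2 proof of Thm. 1.2, Step 1 (arXiv:2201.00153 pp. 4–7) (source of the ARGUMENT this module implements; this declaration is the cell’s own lemma or plumbing, NOT a printed statement)] -/
theorem stAffine_zero_eq (ρ : ℝ) (z : ℝ × EuclideanSpace ℝ (Fin 3)) :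
    stAffine (ρ ^ 2) ρ z.1 z.2 (0 : ℝ × EuclideanSpace ℝ (Fin 3)) = z := by
  ext <;> simp [stAffine]

/-- **Dissipation concentrates at backward-singular points of `𝒞 × ]-1, 0]`** (the backward form
of "otherwise the point would be regular", CKN 1982 §6 / Robinson–Rodrigo–Sadowski 2016, proof
of Thm. 16.2, with Seregin's backward criterion, *Lecture Notes* 2014, Ch. 6, Thm. 1.4, as the
ε-regularity input — hypothesis `H`, the matrix of `seregin2014_thm14`, proved in the tree as
`seregin2014_thm14_holds`).  For the Def.-1.1 class in `Q = 𝒞 × ]-1, 0[` with weak gradient `G`: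
if `z = (t, x)`, `-1 < t ≤ 0`, `x ∈ 𝒞`, and `v` is essentially unbounded on every `Q_r(z)`, then
`(ε/2) · r < ∫∫_{Q_r(z)} |G|²` for arbitrarily small `r > 0`.  Otherwise `E(r; z) ≤ ε/2` for all
`r` below some `ρ` with `Q_ρ(z) ⊆ Q`; the zoom `v_ρ = ρ v ∘ Φ`, `q_ρ = ρ² q ∘ Φ` is in the class on
`Q_1(0)` (`IsSuitableWeakSolutionInBall.zoom`) with `sup_{0<r<1} E(r; 0) ≤ ε/2 < ε`
(`cknE_nsZoom`), so `H` bounds `v_ρ` on some `Q_ϱ(0)`, i.e. `v` on `Q_{ρϱ}(z)`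
(`eLpNorm_top_nsZoom`) — a contradiction.
[cite: CaffarelliKohnNirenberg1982, §6 (proof of Theorem B)] -/
theorem frequently_lt_dissipation_of_backwardSingular {ε : ℝ} (hε : 0 < ε)
    (H : ∀ (v : ℝ → EuclideanSpace ℝ (Fin 3) → EuclideanSpace ℝ (Fin 3))
      (q : ℝ → EuclideanSpace ℝ (Fin 3) → ℝ),
      IsSuitableWeakSolutionInBall 1 0 v q →
      (∃ G : ℝ → EuclideanSpace ℝ (Fin 3) → EuclideanSpace ℝ (Fin 3) →L[ℝ] EuclideanSpace ℝ (Fin 3),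
        HasWeakSpatialGradientOn (parabolicCylinderOpens 1 (0 : ℝ × EuclideanSpace ℝ (Fin 3))) v G ∧
        (⨆ r ∈ Ioo (0 : ℝ) 1, cknE r (0 : ℝ × EuclideanSpace ℝ (Fin 3)) G) < ENNReal.ofReal ε) →
      ∃ ϱ ∈ Ioo (0 : ℝ) 1, eLpNorm (uncurry v) ∞
        (volume.restrict (parabolicCylinder ϱ (0 : ℝ × EuclideanSpace ℝ (Fin 3)))) < ∞)
    {v : ℝ → EuclideanSpace ℝ (Fin 3) → EuclideanSpace ℝ (Fin 3)} {q : ℝ → EuclideanSpace ℝ (Fin 3) → ℝ}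
    {G : ℝ → EuclideanSpace ℝ (Fin 3) → EuclideanSpace ℝ (Fin 3) →L[ℝ] EuclideanSpace ℝ (Fin 3)}
    (hsw : IsSuitableWeakSolutionOn (SereginSverak2009.parCylOpens 0 1) 1 0 v q)
    (hA : ∃ C : ℝ≥0, ∀ᵐ t ∂(volume.restrict (Ioo (-1 : ℝ) 0)),
      ∫⁻ x in SereginSverak2009.spaceCyl 0 1, ‖v t x‖ₑ ^ 2 ≤ C)
    (hG : HasWeakSpatialGradientOn (SereginSverak2009.parCylOpens 0 1) v G)
    (hE : ∫⁻ z in SereginSverak2009.parCyl 0 1, ENNReal.ofReal (frobeniusNormSq (G z.1 z.2)) < ∞)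
    (hq : ∫⁻ z in SereginSverak2009.parCyl 0 1, ‖q z.1 z.2‖ₑ ^ (3 / 2 : ℝ) < ∞)
    {z : ℝ × EuclideanSpace ℝ (Fin 3)} (hz1 : z.1 ∈ Ioc (-1 : ℝ) 0)
    (hz2 : z.2 ∈ SereginSverak2009.spaceCyl (0 : EuclideanSpace ℝ (Fin 3)) 1)
    (hsing : ¬ ∃ r > 0, eLpNorm (uncurry v) ∞ (volume.restrict (parabolicCylinder r z)) < ∞) :
    ∃ᶠ r in 𝓝[>] (0 : ℝ), ENNReal.ofReal (ε / 2) * ENNReal.ofReal r <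
      ∫⁻ w in parabolicCylinder r z, ENNReal.ofReal (frobeniusNormSq (G w.1 w.2)) := by
  by_contra hcon
  rw [Filter.not_frequently] at hcon
  -- an interval `]0, r₁[` of radii with `∫∫_{Q_r(z)} |G|² ≤ (ε/2) r`
  obtain ⟨r₁, hr₁, hsub⟩ := mem_nhdsGT_iff_exists_Ioo_subset.1 hcon
  have hr₁' : (0 : ℝ) < r₁ := hr₁
  -- a radius `ρ < r₁` with `Q_ρ(z) ⊆ Q`
  obtain ⟨ρ, ⟨hρ, hI, hB⟩, hρr₁⟩ :=
    ((eventually_nhdsGT_window_ball_subset hz1 hz2).and (Ioo_mem_nhdsGT hr₁')).exists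
  have hρ2 : 0 < ρ ^ 2 := pow_pos hρ 2
  -- the class on `Q_ρ(z)` and its zoom to `Q_1(0)`
  have hball : IsSuitableWeakSolutionInBall ρ z v q :=
    isSuitableWeakSolutionInBall_of_parCyl hsw hA hG hE hq hI hB
  have hzoom := hball.zoom hρ
  -- the zoomed gradient
  have hQR : parabolicCylinder ρ z ⊆ SereginSverak2009.parCyl 0 1 :=
    parabolicCylinder_subset_parCyl_of hI hB
  have hleR : parabolicCylinderOpens ρ z ≤ SereginSverak2009.parCylOpens 0 1 := fun w hw => hQR hw
  have hGρ : HasWeakSpatialGradientOn (parabolicCylinderOpens ρ z) v G := hG.mono hleR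
  have hG' : HasWeakSpatialGradientOn (parabolicCylinderOpens 1 (0 : ℝ × EuclideanSpace ℝ (Fin 3)))
      (ρ • stPull (ρ ^ 2) ρ z.1 z.2 v) ((ρ ^ 2) • stPull (ρ ^ 2) ρ z.1 z.2 G) := by
    have h := hGρ.stRescale ρ hρ2 hρ z.1 z.2
    rw [zoom_stPreimage_parabolicCylinderOpens hρ z, ← sq] at h
    exact h
  -- smallness of `E` at all scales `0 < r < 1` of the zoom
  have hEsmall : ∀ r ∈ Ioo (0 : ℝ) 1,
      cknE r (0 : ℝ × EuclideanSpace ℝ (Fin 3)) ((ρ ^ 2) • stPull (ρ ^ 2) ρ z.1 z.2 G) ≤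
        ENNReal.ofReal (ε / 2) := by
    intro r hr
    rw [cknE_nsZoom hρ hr.1, stAffine_zero_eq]
    have hρr : 0 < ρ * r := mul_pos hρ hr.1
    have hρr₁ : ρ * r ∈ Ioo (0 : ℝ) r₁ :=
      ⟨hρr, lt_of_lt_of_le (mul_lt_of_lt_one_right hρ hr.2) hρr₁.2.le⟩
    have hle : ∫⁻ w in parabolicCylinder (ρ * r) z, ENNReal.ofReal (frobeniusNormSq (G w.1 w.2)) ≤
        ENNReal.ofReal (ε / 2) * ENNReal.ofReal (ρ * r) := not_lt.1 (hsub hρr₁)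
    have h0 : ENNReal.ofReal (ρ * r) ≠ 0 := (ENNReal.ofReal_pos.2 hρr).ne'
    unfold cknE
    calc (ENNReal.ofReal (ρ * r))⁻¹ *
          ∫⁻ w in parabolicCylinder (ρ * r) z, ENNReal.ofReal (frobeniusNormSq (G w.1 w.2))
        ≤ (ENNReal.ofReal (ρ * r))⁻¹ * (ENNReal.ofReal (ε / 2) * ENNReal.ofReal (ρ * r)) :=
          mul_le_mul' le_rfl hle
      _ = ENNReal.ofReal (ε / 2) := by
          rw [mul_comm (ENNReal.ofReal (ε / 2)), ← mul_assoc,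
            ENNReal.inv_mul_cancel h0 ENNReal.ofReal_ne_top, one_mul]
  have hsup : (⨆ r ∈ Ioo (0 : ℝ) 1,
      cknE r (0 : ℝ × EuclideanSpace ℝ (Fin 3)) ((ρ ^ 2) • stPull (ρ ^ 2) ρ z.1 z.2 G)) <
        ENNReal.ofReal ε := by
    refine lt_of_le_of_lt (iSup₂_le hEsmall) ?_
    exact (ENNReal.ofReal_lt_ofReal_iff hε).2 (by linarith)
  -- the criterion at the zoomed origin
  obtain ⟨ϱ, hϱ, hfin⟩ := H _ _ hzoom ⟨_, hG', hsup⟩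
  rw [eLpNorm_top_nsZoom hρ z.1 z.2 ϱ 0 v, stAffine_zero_eq] at hfin
  refine hsing ⟨ρ * ϱ, mul_pos hρ hϱ.1, ?_⟩
  by_contra htop
  rw [not_lt, top_le_iff] at htop
  rw [htop, ENNReal.mul_top (ENNReal.ofReal_pos.2 hρ).ne'] at hfin
  exact lt_irrefl _ hfin

/-! ### Partial regularity up to the top time -/

/-- **Seregin 2022, §2 Step 1: the backward-singular set of `𝒞 × ]-1, 0]` is `𝒫¹`-null**
(Caffarelli–Kohn–Nirenberg's Theorem B up to the top time, backward cylinders).  For a suitable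
weak solution `(v, q)` of Def. 1.1 in `Q = 𝒞 × ]-1, 0[` — `IsSuitableWeakSolutionOn` on
`SereginSverak2009.parCylOpens 0 1` with `v ∈ L_{2,∞}(Q)`, a weak spatial gradient `G ∈ L₂(Q)`
and `q ∈ L_{3/2}(Q)` — the set of points `z = (t, x)` with `-1 < t ≤ 0`, `x ∈ 𝒞`, at which `v` is
essentially unbounded on every backward ball cylinder `Q_r(z)`, `r > 0`, has one-dimensional
parabolic Hausdorff measure zero.  (This is the nullity behind "there exist at least two regular
points `z₁ = (0, h₁, 0)` and `z₂ = (0, -h₂, 0)`", arXiv:2201.00153 p. 5, whose points lie on the top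
time.)  Proof: dissipation concentrates at such points
(`frequently_lt_dissipation_of_backwardSingular`, from `seregin2014_thm14_holds`), `Q_r(z) ⊆
Q*_r(z) ∩ Q` for small `r`, and the covering step `isParabolicNull_of_frequently` for the
integrable density `𝟙_Q |G|²`. [cite: Seregin2022LocalAxisym, §2 Step 1 (arXiv:2201.00153 p. 5)] -/
theorem isParabolicNull_backwardSingular_top : ∀ (v : ℝ → EuclideanSpace ℝ (Fin 3) → EuclideanSpace ℝ (Fin 3)) (q : ℝ → EuclideanSpace ℝ (Fin 3) → ℝ) (G : ℝ → EuclideanSpace ℝ (Fin 3) → EuclideanSpace ℝ (Fin 3) →L[ℝ] EuclideanSpace ℝ (Fin 3)), IsSuitableWeakSolutionOn (SereginSverak2009.parCylOpens 0 1) 1 0 v q → (∃ C : ℝ≥0, ∀ᵐ t ∂(volume.restrict (Ioo (-1 : ℝ) 0)), ∫⁻ x in SereginSverak2009.spaceCyl 0 1, ‖v t x‖ₑ ^ 2 ≤ C) → HasWeakSpatialGradientOn (SereginSverak2009.parCylOpens 0 1) v G → (∫⁻ z in SereginSverak2009.parCyl 0 1, ENNReal.ofReal (frobeniusNormSq (G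 z.1 z.2)) < ∞) → (∫⁻ z in SereginSverak2009.parCyl 0 1, ‖q z.1 z.2‖ₑ ^ (3 / 2 : ℝ) < ∞) → IsParabolicNull 1 {z : ℝ × EuclideanSpace ℝ (Fin 3) | z.1 ∈ Ioc (-1 : ℝ) 0 ∧ z.2 ∈ SereginSverak2009.spaceCyl 0 1 ∧ ¬ ∃ r > 0, eLpNorm (uncurry v) ∞ (volume.restrict (parabolicCylinder r z)) < ∞} := by
  intro v q G hsw hA hG hE hq
  obtain ⟨ε, hε, H⟩ := seregin2014_thm14_holds
  -- the integrable density `F = 𝟙_Q |G|²`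
  set f : ℝ × EuclideanSpace ℝ (Fin 3) → ℝ≥0∞ :=
    fun w => ENNReal.ofReal (frobeniusNormSq (G w.1 w.2)) with hf
  have hQm : MeasurableSet (SereginSverak2009.parCyl (0 : ℝ × EuclideanSpace ℝ (Fin 3)) 1) :=
    (SereginSverak2009.isOpen_parCyl 0 1).measurableSet
  set F : ℝ × EuclideanSpace ℝ (Fin 3) → ℝ≥0∞ :=
    (SereginSverak2009.parCyl (0 : ℝ × EuclideanSpace ℝ (Fin 3)) 1).indicator f with hF
  have hFint : ∫⁻ w, F w ≠ ∞ := by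
    rw [hF, lintegral_indicator hQm]
    exact hE.ne
  -- the concentration level `l = ε/2`
  have hl0 : ENNReal.ofReal (ε / 2) ≠ 0 := (ENNReal.ofReal_pos.2 (by positivity)).ne'
  refine isParabolicNull_of_frequently hFint hl0 ENNReal.ofReal_ne_top fun z hz => ?_
  obtain ⟨hz1, hz2, hsing⟩ := hz
  have hfreq := frequently_lt_dissipation_of_backwardSingular hε H hsw hA hG hE hq hz1 hz2 hsing
  refine hfreq.mp ?_
  filter_upwards [eventually_nhdsGT_window_ball_subset hz1 hz2] with r hr hlt
  obtain ⟨-, hI, hB⟩ := hr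
  have hQR : parabolicCylinder r z ⊆ SereginSverak2009.parCyl 0 1 :=
    parabolicCylinder_subset_parCyl_of hI hB
  refine hlt.trans_le ?_
  calc ∫⁻ w in parabolicCylinder r z, f w
      ≤ ∫⁻ w in SereginSverak2009.parCyl 0 1 ∩ parabolicCylinderCentered r z, f w :=
        lintegral_mono_set (subset_inter hQR (parabolicCylinder_subset_centered r z))
    _ = ∫⁻ w in parabolicCylinderCentered r z, F w := by
        rw [hF, lintegral_indicator hQm, Measure.restrict_restrict hQm]

end Literature.Analysis.SereginLogSwirlOrigin.EulerScaling

end Part10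

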